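import Summits.SmoothPoincare4.SmoothPoincare4.Theses.SymplecticOrigami
import Literature.Geometry.Symplectic.GromovR4StdModel
import Mathlib.Analysis.SpecialFunctions.Log.Deriv
import Mathlib.Analysis.SpecialFunctions.ExpDeriv
import Mathlib.Analysis.Calculus.BumpFunction.InnerProduct
import Mathlib.Analysis.SpecialFunctions.Trigonometric.Deriv
import Mathlib.Analysis.InnerProductSpace.Calculus
import Mathlib.Analysis.SpecialFunctions.SmoothTransition
import Mathlib.Analysis.Calculus.InverseFunctionTheorem.ContDiff
import Mathlib.Analysis.Calculus.Deriv.Abs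
import Mathlib.Analysis.Calculus.ContDiff.Deriv
import Mathlib.Analysis.Calculus.MeanValue
import Mathlib.Geometry.Manifold.Instances.Sphere
import Literature.AlgebraicTopology.Homotopy.HomotopyGroupsGeneralPosition

/-!
# Disproof work file for crux `GromovRecognitionRelEnd` (stmt-SmoothPoincare4-11009)

Standing adversary file (cdisprove seat). Prose only in docstrings; everything else is checked.

## Findings (cycle 1)

* `crux_iff_literature` — the route decl IS `Literature.Geometry.Symplectic.gromov_recognitionR4_relEnd`
  (`Iff.rfl`): a proof of either name closes the item; the Literature non-vacuity lemmas
  (`gromov_recognitionR4_relEnd.stdModel_hypotheses/stdModel_conclusion/apply_stdModel`) apply verbatim.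
* `crux_iff` — the crux restated over five named hypothesis blocks (`IsSymplectic`, `EndsCoCompact`,
  `IsEndChart`, `PullbackClause`) and `Conclusion`; the `Without…` variants below drop one block.
* STRUCTURE FORCED BY THE HYPOTHESES (positive helper lemmas, prover briefing):
  `isClosed_of_endsCoCompact`, `isCompact_of_endsCoCompact` — H5 (at `R' = R`) with H8 force `K`
  closed hence compact, although the crux never says so; `mfderiv_injective_of_pullbackClause` —
  H4 + H10 force `dψ_x` injective on `Kᶜ`, so the `mfderiv` junk value `0` never bites.
* LOAD-BEARING ANALYSIS:
  `gromovRecognitionRelEnd_false_without_ends` — dropping H5 (ends clause) is fatal: the shear end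
  `ψ = (y₀y₁, log y₁, y₂, y₃)` of `(ℝ⁴, ω₀)` on `Ω = {0 < y₁, 1 < ‖ψ‖}` (inverse
  `g = (x₀e^{-x₁}, e^{x₁}, x₂, x₃)`, a symplectomorphism `ℝ⁴ → {0 < y₁}`) satisfies H1–H4, H6–H10 with
  `K = Ωᶜ` non-compact, and no continuous `Φ` agrees with `ψ` off a compact set (`§4`).
  `gromovRecognitionRelEnd_false_withCompactK_of_pi2` — H5 weakened to `IsCompact K` ⇒ FALSE modulo
  `π₂({1 < ‖z‖}) = 0`: the standard end itself (`K = ∅`, `ψ` = inclusion) is a model of everything else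
  (`§5`); this is exactly what co-compactness of the sub-ends adds.
  `gromovRecognitionRelEnd_false_without_pullback` — dropping H10 (`sf = ψ*ω₀` on `Kᶜ`) is fatal: `M = ℝ⁴`, `sf = ω₀`,
  `K = B̄(0,1)`, `ψ = χ =` the reflection `x₀ ↦ -x₀` satisfy H1–H9, and no symplectomorphism agrees
  with an anti-symplectic map near infinity (`ω₀(-e₀, e₁) = -1 ≠ 1`).
  `gromovRecognitionRelEnd_false_without_nondegenerate` — dropping H4 is fatal (trivially: the conclusion
  forces nondegeneracy; witness the pinched form `F*ω₀`, `§6`);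
  `gromovRecognitionRelEnd_false_without_closed` — dropping H3 is fatal (trivially: `Φ*ω₀` is closed;
  witness the non-closed `ω₀ + b·dx₀∧dx₂`, `§6b`).
* SECOND MODEL + REFUTED STRENGTHENING (`§7`): the singular radial twist `ψ = e^{iθ(‖x‖²)}x`,
  `θ = (t-1)⁻¹`, of `(ℝ⁴, ω₀)` on `{1 < ‖x‖}` satisfies all ten hypotheses (`TwistEnd.hypotheses`), the
  crux's conclusion holds there (`TwistEnd.conclusion`, `K' = B̄(0,2)`), but "`Φ = ψ` on all of `Kᶜ`"
  fails (`not_gromovRecognitionRelEndStrong`): the `∃ K'` of the conclusion cannot be sharpened to `K' = K`.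
* REDUNDANT HYPOTHESES (`§8`): `crux_iff_noChi` — `χ`, H7, H9 follow from H4+H6+H8+H10 (+H5) by the
  inverse function theorem (`contMDiffOn_invFunOn`); the crux ⟺ its `χ`-free form.
  `gromovRecognitionRelEnd_noChi_false_without_smooth` (`§8b`) — in the `χ`-free form, H6 (`ψ` is `C^∞`)
  is load-bearing: the `C¹` symplectic shear `(x₀, x₁ + x₀|x₀|, x₂, x₃)` satisfies everything else.
* WHY THE CRUX RESISTS (no kill): see the docstring of `resists` at the end — the only freedom the
  ends clause leaves (the `∞`-side of the end accumulating on `K`) is excluded by a volume/frontier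
  argument, after which the statement is Gromov 1985 §0.3.C + McDuff–Salamon 2017 Rem. 4.5.2 (viii).

## Findings (cycle 2 — gen-2 seat; everything below is kernel-checked, no `sorry`)

* `§5'` `EndItself.subsingleton_pi_two` — `π₂({1 < ‖z‖}) = 0` PROVED (`{1 < ‖z‖} ≃ₕ S³` by radial
  retraction + tree lemma `subsingleton_homotopyGroup_sphere`), so
  `gromovRecognitionRelEnd_false_withCompactK` is now UNCONDITIONAL: "`K` compact" instead of the ENDS
  clause is false (the end itself is the counter-model).
* `§6c` `gromovRecognitionRelEnd_false_without_smoothForm` — H2 (`IsSmoothForm sf`) is load-bearing,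
  trivially via the conclusion; the witness `ω₀ + 𝟙_{0}ω₀` also documents that `IsClosedForm` ALONE
  (`mextDeriv = 0`, junk `fderiv = 0` at non-differentiable points) carries no regularity — harmless for
  the crux, which states H2 and H3 together.
* `§10` H1 (`π₂(M) = 0`): `subsingleton_pi_two_of_conclusion` — the conclusion FORCES H1 (homeomorphism
  invariance of `π₂ = 0`, tree lemma `subsingleton_homotopyGroup_of_homotopyEquiv`); hence the exact
  status `gromovRecognitionRelEndWithoutPi2_iff : WithoutPi2 ↔ crux ∧ ¬ NonMinimalModelExists`, where a
  `NonMinimalModel` (H2–H10 with `π₂ ≠ 0`; in print: the blow-up of `ℝ⁴`, McDuff 1990) is not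
  constructible here — `gromovRecognitionRelEnd_false_without_pi2_of` is the negative lemma modulo it.
* `§11` THE COMPACTIFICATION ATTACK, CONCRETELY: `M = S⁴` with a stereographic end (`Sphere4.*`)
  satisfies H1, H5–H9, connectedness etc., and H10 for the junk-extended `sf = ψ*ω₀`; the end RETURNS to
  the pole (`Sphere4.not_isOpen_truncation`) and `S⁴ ≄ ℝ⁴`. Consequences: the panel's common S-stub
  "the end does not return" (`StubEndDoesNotReturn`, = `stub_endDoesNotReturn` of line cross-cap-laurent,
  verbatim) is FALSE without H10 (`stubEndDoesNotReturn_false_without_pullback`, `sf = 0`), FALSE without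
  `IsSmoothForm sf` (`…_false_without_smoothForm`, `sf = ψ*ω₀`) and FALSE without H5
  (`…_false_without_ends`, shear end): its proof must be the symplectic VOLUME argument, there is no
  topological shortcut.
* `§12` `gromovRecognitionRelEnd_false_without_formRegularity` — with H2 ∧ H3 ∧ H4 deleted (H10 kept)
  the crux is false for a NON-junk reason (`M = S⁴` compact), even for the weak conclusion
  `Nonempty (M ≃ₜ ℝ⁴)`: the regularity of `sf` ACROSS `K` is the only hypothesis separating the crux from
  the one-point compactification of its own end.
* `§13` CHECKED DICHOTOMY behind every line's S-stub "the end does not return":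
  `noAccumulation_or_compactSpace` / `not_compactSpace_of_noAccumulation` /
  `noAccumulation_iff_not_compactSpace` — over the purely topological end hypotheses (H5, continuous
  `ψ`, `χ`, bijection) the truncations are all open IFF `M` is not compact; hence
  `stubEndDoesNotReturn_of_not_compactSpace`: what remains of the stub is exactly
  "H2 + H10 (+H5) ⇒ `¬ CompactSpace M`", the volume count (provers: import-free copy of §13 available).
* Load-bearing table after cycle 2 (hypothesis ↦ status): H1 forced by conclusion, droppable iff no
  blow-up-type model (§10); H2 ✓ (§6c); H3 ✓ (§6b); H4 ✓ (§6); H2∧H3∧H4 jointly, non-junk (§12);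
  H5 ✓ (§4), and `IsCompact K` does not suffice (§5, §5' unconditional); H6 ✓ in the `χ`-free form (§8b);
  H7, H9, `χ` redundant (§8); H10 ✓ (§3, and §11 against the S-stub); `T2`/`SecondCountable`/`Connected`:
  forced by the conclusion (not separately witnessed: a witness needs a compact symplectic aspherical
  4-manifold, e.g. `T⁴`, not constructible here); strengthening `K' = K` refuted (§7).
-/

noncomputable section

-- the prescribed namespace `Summit.<P>.<Sub>.…` duplicates `SmoothPoincare4` (P = Sub)
set_option linter.dupNamespace false

open scoped Manifold ContDiff Topology Real RealInnerProductSpace ContinuousMap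
open TopologicalSpace Set Filter Asymptotics Literature.Geometry.Kaehler Literature.Geometry.Symplectic
open Literature.AlgebraicTopology.Homotopy

namespace Summit.SmoothPoincare4.SmoothPoincare4.Cruxes.GromovRecognitionRelEnd.Disproof

/-- Local notation for the model space `ℝ⁴`. -/
local notation "E4" => EuclideanSpace ℝ (Fin 4)

/-! ## 0. The crux is the Literature named fact -/

/-- The route decl `GromovRecognitionRelEnd` is, definitionally, the audited Literature statement
`Literature.Geometry.Symplectic.gromov_recognitionR4_relEnd`. -/
theorem crux_iff_literature :
    Summit.SmoothPoincare4.SmoothPoincare4.Theses.SymplecticOrigami.GromovRecognitionRelEnd ↔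
      Literature.Geometry.Symplectic.gromov_recognitionR4_relEnd :=
  Iff.rfl

/-! ## 1. Named hypothesis blocks and the conclusion -/

section Blocks

variable {M : Type} [TopologicalSpace M] [ChartedSpace E4 M]

/-- H2–H4: `sf` is a smooth, closed, pointwise nondegenerate `2`-form. -/
def IsSymplectic (sf : MForm (𝓡 4) M ℝ 2) : Prop :=
  IsSmoothForm sf ∧ IsClosedForm sf ∧ ∀ x (v : TangentSpace (𝓡 4) x), v ≠ 0 → ∃ w, sf x ![v, w] ≠ 0

/-- H5, the ENDS clause: every sub-end `{R' < ‖ψ‖}` is co-compact. -/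
def EndsCoCompact (K : Set M) (R : ℝ) (ψ : M → E4) : Prop :=
  ∀ R', R ≤ R' → IsCompact (K ∪ {x | ‖ψ x‖ ≤ R'})

/-- H6–H9: `ψ|Kᶜ` is a `C^∞` bijection onto `{R < ‖z‖}` with `C^∞` inverse `χ`. -/
def IsEndChart (K : Set M) (R : ℝ) (ψ : M → E4) (χ : E4 → M) : Prop :=
  ContMDiffOn (𝓡 4) 𝓘(ℝ, E4) ∞ ψ Kᶜ ∧
    ContMDiffOn 𝓘(ℝ, E4) (𝓡 4) ∞ χ (Metric.closedBall (0 : E4) R)ᶜ ∧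
      Set.BijOn ψ Kᶜ (Metric.closedBall (0 : E4) R)ᶜ ∧ ∀ x, x ∈ Kᶜ → χ (ψ x) = x

/-- H10: `sf = ψ*ω₀` on `Kᶜ`. -/
def PullbackClause (sf : MForm (𝓡 4) M ℝ 2) (K : Set M) (ψ : M → E4) : Prop :=
  ∀ x, x ∈ Kᶜ → ∀ v w, sf x ![v, w] =
    stdSymplecticForm (mfderiv (𝓡 4) 𝓘(ℝ, E4) ψ x v) (mfderiv (𝓡 4) 𝓘(ℝ, E4) ψ x w)

/-- The conclusion: a symplectomorphism `Φ : (M, sf) → (ℝ⁴, ω₀)` equal to `ψ` off a compact set. -/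
def Conclusion [IsManifold (𝓡 4) ∞ M] (sf : MForm (𝓡 4) M ℝ 2) (ψ : M → E4) : Prop :=
  ∃ Φ : M ≃ₘ⟮𝓡 4, 𝓡 4⟯ E4,
    (∀ x v w, sf x ![v, w] =
      stdSymplecticForm (mfderiv (𝓡 4) 𝓘(ℝ, E4) Φ x v) (mfderiv (𝓡 4) 𝓘(ℝ, E4) Φ x w)) ∧
    ∃ K' : Set M, IsCompact K' ∧ ∀ x, x ∉ K' → Φ x = ψ x

end Blocks

/-- The crux, block form. -/
theorem crux_iff :
    Summit.SmoothPoincare4.SmoothPoincare4.Theses.SymplecticOrigami.GromovRecognitionRelEnd ↔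
      ∀ (M : Type) [TopologicalSpace M] [T2Space M] [SecondCountableTopology M]
        [ChartedSpace E4 M] [IsManifold (𝓡 4) ∞ M] [ConnectedSpace M]
        (sf : MForm (𝓡 4) M ℝ 2) (K : Set M) (R : ℝ) (ψ : M → E4) (χ : E4 → M),
        (∀ x : M, Subsingleton (π_ 2 M x)) → IsSymplectic sf → EndsCoCompact K R ψ →
          IsEndChart K R ψ χ → PullbackClause sf K ψ → Conclusion sf ψ := by
  constructor
  · intro h M _ _ _ _ _ _ sf K R ψ χ h1 h234 h5 h6789 h10
    exact h M sf K R ψ χ h1 h234.1 h234.2.1 h234.2.2 h5 h6789.1 h6789.2.1 h6789.2.2.1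
      h6789.2.2.2 h10
  · intro h M _ _ _ _ _ _ sf K R ψ χ h1 h2 h3 h4 h5 h6 h7 h8 h9 h10
    exact h M sf K R ψ χ h1 ⟨h2, h3, h4⟩ h5 ⟨h6, h7, h8, h9⟩ h10

/-! ## 2. Structure forced by the hypotheses (prover briefing) -/

section Structure

variable {M : Type} [TopologicalSpace M]

/-- H5 (at `R' = R`) and the `MapsTo` part of H8 force `K` to be CLOSED: a point of `closure K ∖ K`
lies in `Kᶜ`, so `R < ‖ψ x‖`, so it is outside the compact (closed) set `K ∪ {‖ψ‖ ≤ R} ⊇ K`. -/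
theorem isClosed_of_endsCoCompact [T2Space M] {K : Set M} {R : ℝ} {ψ : M → E4}
    (h5 : EndsCoCompact K R ψ) (h8 : Set.MapsTo ψ Kᶜ (Metric.closedBall (0 : E4) R)ᶜ) :
    IsClosed K := by
  have hC : IsClosed (K ∪ {x | ‖ψ x‖ ≤ R}) := (h5 R le_rfl).isClosed
  rw [← closure_subset_iff_isClosed]
  intro x hx
  have hxC : x ∈ K ∪ {x | ‖ψ x‖ ≤ R} := closure_minimal subset_union_left hC hx
  rcases hxC with hxK | hxR
  · exact hxK
  · by_contra hxK
    have h := h8 hxK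
    simp only [mem_compl_iff, Metric.mem_closedBall, dist_zero_right, not_le] at h
    exact absurd hxR (not_le.2 h)

/-- Hence `K` is COMPACT (closed subset of the compact `K ∪ {‖ψ‖ ≤ R}`), although the crux never
says so explicitly. -/
theorem isCompact_of_endsCoCompact [T2Space M] {K : Set M} {R : ℝ} {ψ : M → E4}
    (h5 : EndsCoCompact K R ψ) (h8 : Set.MapsTo ψ Kᶜ (Metric.closedBall (0 : E4) R)ᶜ) :
    IsCompact K :=
  (h5 R le_rfl).of_isClosed_subset (isClosed_of_endsCoCompact h5 h8) subset_union_left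

/-- `ω₀(0, b) = 0`. -/
theorem stdSymplecticForm_zero_left (b : E4) : stdSymplecticForm 0 b = 0 := by
  simp [stdSymplecticForm]

variable [ChartedSpace E4 M]

/-- H4 + H10 force `dψ_x` to be injective at every point of `Kᶜ` (so `ψ` is genuinely
differentiable there and the junk value `mfderiv = 0` of a non-differentiable map never occurs). -/
theorem mfderiv_injective_of_pullbackClause {sf : MForm (𝓡 4) M ℝ 2} {K : Set M} {ψ : M → E4}
    (h4 : ∀ x (v : TangentSpace (𝓡 4) x), v ≠ 0 → ∃ w, sf x ![v, w] ≠ 0)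
    (h10 : PullbackClause sf K ψ) {x : M} (hx : x ∈ Kᶜ) :
    Function.Injective (mfderiv (𝓡 4) 𝓘(ℝ, E4) ψ x) := by
  rw [injective_iff_map_eq_zero]
  intro v hv
  by_contra hv0
  obtain ⟨w, hw⟩ := h4 x v hv0
  rw [h10 x hx v w, hv] at hw
  have hw' : stdSymplecticForm (0 : E4) (mfderiv (𝓡 4) 𝓘(ℝ, E4) ψ x w) ≠ 0 := hw
  exact hw' (stdSymplecticForm_zero_left _)

end Structure

/-! ## 3. Load-bearing analysis: H10 (the pull-back clause) cannot be dropped -/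

/-- The crux with H10 (`sf = ψ*ω₀` on `Kᶜ`) deleted. -/
def GromovRecognitionRelEndWithoutPullback : Prop :=
  ∀ (M : Type) [TopologicalSpace M] [T2Space M] [SecondCountableTopology M]
    [ChartedSpace E4 M] [IsManifold (𝓡 4) ∞ M] [ConnectedSpace M]
    (sf : MForm (𝓡 4) M ℝ 2) (K : Set M) (R : ℝ) (ψ : M → E4) (χ : E4 → M),
    (∀ x : M, Subsingleton (π_ 2 M x)) → IsSymplectic sf → EndsCoCompact K R ψ →
      IsEndChart K R ψ χ → Conclusion sf ψ

namespace Reflection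

/-- `e i`, the standard basis vector. -/
abbrev e (i : Fin 4) : E4 := EuclideanSpace.single i 1

/-- The reflection `ρ(x) = x - 2 x₀ e₀`, i.e. `x₀ ↦ -x₀`, as a continuous linear map. -/
def ρL : E4 →L[ℝ] E4 :=
  ContinuousLinearMap.id ℝ E4 - (2 : ℝ) • (EuclideanSpace.proj (0 : Fin 4)).smulRight (e 0)

theorem ρL_apply (x : E4) (i : Fin 4) : ρL x i = if i = 0 then -x 0 else x i := by
  simp only [ρL, sub_apply, ContinuousLinearMap.id_apply, smul_apply,
    ContinuousLinearMap.smulRight_apply]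
  split_ifs with h
  · subst h
    simp [EuclideanSpace.proj, e]
    ring
  · simp [EuclideanSpace.proj, e, h]

theorem ρL_apply_zero (x : E4) : ρL x 0 = -x 0 := by simp [ρL_apply]

theorem ρL_apply_of_ne (x : E4) {i : Fin 4} (hi : i ≠ 0) : ρL x i = x i := by simp [ρL_apply, hi]

/-- `ρ` is an involution. -/
theorem ρL_ρL (x : E4) : ρL (ρL x) = x := by
  ext i
  by_cases hi : i = 0
  · subst hi; rw [ρL_apply_zero, ρL_apply_zero, neg_neg]
  · rw [ρL_apply_of_ne _ hi, ρL_apply_of_ne _ hi]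

/-- `ρ` preserves the norm. -/
theorem norm_ρL (x : E4) : ‖ρL x‖ = ‖x‖ := by
  have h : ‖ρL x‖ ^ 2 = ‖x‖ ^ 2 := by
    rw [EuclideanSpace.real_norm_sq_eq, EuclideanSpace.real_norm_sq_eq, Fin.sum_univ_four,
      Fin.sum_univ_four, ρL_apply_zero, ρL_apply_of_ne _ (by decide), ρL_apply_of_ne _ (by decide),
      ρL_apply_of_ne _ (by decide)]
    ring
  have := abs_eq_abs.2 (Or.inl rfl : ‖ρL x‖ = ‖ρL x‖ ∨ _)
  nlinarith [norm_nonneg (ρL x), norm_nonneg x, sq_nonneg (‖ρL x‖ - ‖x‖), sq_nonneg (‖ρL x‖ + ‖x‖)]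

/-- `ρ` maps the end `{1 < ‖z‖}` to itself. -/
theorem mapsTo_ρL : Set.MapsTo ρL (Metric.closedBall (0 : E4) 1)ᶜ (Metric.closedBall (0 : E4) 1)ᶜ := by
  intro x hx
  simpa [Metric.mem_closedBall, dist_zero_right, norm_ρL] using hx

theorem bijOn_ρL : Set.BijOn ρL (Metric.closedBall (0 : E4) 1)ᶜ (Metric.closedBall (0 : E4) 1)ᶜ :=
  Set.InvOn.bijOn ⟨fun x _ => ρL_ρL x, fun x _ => ρL_ρL x⟩ mapsTo_ρL mapsTo_ρL

/-- `dρ = ρ` (as `HasMFDerivAt` between the model manifolds). -/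
theorem hasMFDerivAt_ρL (x : E4) : HasMFDerivAt (𝓡 4) 𝓘(ℝ, E4) (ρL : E4 → E4) x ρL :=
  ρL.hasFDerivAt.hasMFDerivAt

/-- `ω₀(e₀, e₁) = 1`. -/
theorem std_e0_e1 : stdSymplecticForm (e 0) (e 1) = 1 := by
  simp [stdSymplecticForm, e]

/-- `ω₀(ρ e₀, ρ e₁) = -1`: `ρ` is anti-symplectic on the plane `⟨e₀, e₁⟩`. -/
theorem std_ρe0_ρe1 : stdSymplecticForm (ρL (e 0)) (ρL (e 1)) = -1 := by
  simp [stdSymplecticForm, ρL_apply, e]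

/-- All hypotheses but H10 hold for `M = ℝ⁴, sf = ω₀, K = B̄(0,1), R = 1, ψ = χ = ρ`. -/
theorem hypotheses :
    (∀ x : E4, Subsingleton (π_ 2 E4 x)) ∧ IsSymplectic stdSymplecticMForm ∧
      EndsCoCompact (Metric.closedBall (0 : E4) 1) 1 ρL ∧
        IsEndChart (Metric.closedBall (0 : E4) 1) 1 ρL ρL := by
  refine ⟨subsingleton_pi_two_euclideanSpace,
    ⟨isSmoothForm_stdSymplecticMForm, isClosedForm_stdSymplecticMForm, stdSymplecticMForm_nondegenerate⟩,
    ?_, ⟨ρL.contDiff.contMDiff.contMDiffOn, ρL.contDiff.contMDiff.contMDiffOn, bijOn_ρL,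
      fun x _ => ρL_ρL x⟩⟩
  intro R' _
  have h : {x : E4 | ‖ρL x‖ ≤ R'} = Metric.closedBall (0 : E4) R' := by
    ext x; simp [Metric.mem_closedBall, dist_zero_right, norm_ρL]
  rw [h]
  exact (isCompact_closedBall _ _).union (isCompact_closedBall _ _)

/-- … but the conclusion fails there: a symplectomorphism `Φ` of `(ℝ⁴, ω₀)` cannot agree with the
anti-symplectic `ρ` on the (nonempty, open) complement of a compact set. -/
theorem not_conclusion : ¬ Conclusion stdSymplecticMForm (ρL : E4 → E4) := by
  rintro ⟨Φ, hΦ, K', hK', hagree⟩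
  -- a point outside `K'`
  obtain ⟨r, hr⟩ := hK'.isBounded.subset_closedBall (0 : E4)
  set x₀ : E4 := (|r| + 1) • e 0 with hx₀
  have hx₀n : ‖x₀‖ = |r| + 1 := by
    rw [hx₀, norm_smul, Real.norm_eq_abs, abs_of_pos (by positivity)]
    simp [e]
  have hx₀K : x₀ ∉ K' := by
    intro h
    have := hr h
    rw [Metric.mem_closedBall, dist_zero_right, hx₀n] at this
    linarith [le_abs_self r]
  -- `Φ = ρ` near `x₀`, so `dΦ_{x₀} = ρ`
  have hev : (⇑Φ : E4 → E4) =ᶠ[𝓝 x₀] (ρL : E4 → E4) :=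
    Filter.eventuallyEq_of_mem (hK'.isClosed.isOpen_compl.mem_nhds hx₀K) fun x hx => hagree x hx
  have hΦ' : HasMFDerivAt (𝓡 4) 𝓘(ℝ, E4) Φ x₀ ρL := (hasMFDerivAt_ρL x₀).congr_of_eventuallyEq hev
  have key := hΦ x₀ (e 0) (e 1)
  rw [stdSymplecticMForm_apply, hΦ'.mfderiv] at key
  have key' : stdSymplecticForm (e 0) (e 1) = stdSymplecticForm (ρL (e 0)) (ρL (e 1)) := key
  rw [std_e0_e1, std_ρe0_ρe1] at key'
  norm_num at key'

end Reflection

/-- **H10 is load-bearing**: the crux with the pull-back clause deleted is FALSE (witness: the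
reflection end `ψ = χ = (x₀ ↦ -x₀)` of `(ℝ⁴, ω₀)`, `K = B̄(0,1)`, `R = 1`). Any proof of the crux
must use `sf = ψ*ω₀` near infinity — in particular that `ψ` is orientation-preserving for the
`sf²`- and `ω₀²`-orientations. -/
theorem gromovRecognitionRelEnd_false_without_pullback : ¬ GromovRecognitionRelEndWithoutPullback := by
  intro h
  obtain ⟨h1, h234, h5, h6789⟩ := Reflection.hypotheses
  exact Reflection.not_conclusion (h E4 stdSymplecticMForm (Metric.closedBall (0 : E4) 1) 1
    Reflection.ρL Reflection.ρL h1 h234 h5 h6789)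


/-! ## 4. Load-bearing analysis: H5 (the ENDS clause) cannot be dropped

Witness: `M = ℝ⁴`, `sf = ω₀`, and the end chart `ψ(y) = (y₀y₁, log y₁, y₂, y₃)` on
`Ω = {0 < y₁, 1 < ‖ψ y‖}`, inverse `g(x) = (x₀e^{-x₁}, e^{x₁}, x₂, x₃)` — `g` is a symplectomorphism of
`(ℝ⁴, ω₀)` onto the half-space `{0 < y₁}`, so `ψ : (Ω, ω₀) → ({1 < ‖z‖}, ω₀)` is an honest
symplectomorphism onto the standard end (H6–H10 hold), but `K = Ωᶜ ⊇ {y₁ ≤ 0}` is not compact and the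
`R`-side AND the `∞`-side of the end both accumulate on the hyperplane `{y₁ = 0}`: no continuous `Φ`
can agree with `ψ` off a compact set. So the ends clause is what excludes "the end coming back". -/

/-- The crux with H5 (ends clause) deleted. -/
def GromovRecognitionRelEndWithoutEnds : Prop :=
  ∀ (M : Type) [TopologicalSpace M] [T2Space M] [SecondCountableTopology M]
    [ChartedSpace E4 M] [IsManifold (𝓡 4) ∞ M] [ConnectedSpace M]
    (sf : MForm (𝓡 4) M ℝ 2) (K : Set M) (R : ℝ) (ψ : M → E4) (χ : E4 → M),
    (∀ x : M, Subsingleton (π_ 2 M x)) → IsSymplectic sf →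
      IsEndChart K R ψ χ → PullbackClause sf K ψ → Conclusion sf ψ

namespace ShearEnd


/-- `|x i| ≤ ‖x‖` on `ℝ⁴`. -/
theorem abs_apply_le_norm (x : E4) (i : Fin 4) : |x i| ≤ ‖x‖ := by
  rw [EuclideanSpace.norm_eq]
  refine Real.abs_le_sqrt ?_
  have h : (x i) ^ 2 = ‖x i‖ ^ 2 := by simp [Real.norm_eq_abs, sq_abs]
  rw [h]
  exact Finset.single_le_sum (f := fun j => ‖x j‖ ^ 2) (fun j _ => sq_nonneg _) (Finset.mem_univ i)

/-- The candidate end map `ψ(y) = (y₀ y₁, log y₁, y₂, y₃)` (symplectic on `{0 < y₁}`). -/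
def ψ (y : E4) : E4 := WithLp.toLp 2 ![y 0 * y 1, Real.log (y 1), y 2, y 3]

/-- Its inverse `g(x) = (x₀ e^{-x₁}, e^{x₁}, x₂, x₃)`, a symplectomorphism of `ℝ⁴` onto `{0 < y₁}`. -/
def g (x : E4) : E4 := WithLp.toLp 2 ![x 0 * Real.exp (-(x 1)), Real.exp (x 1), x 2, x 3]

@[simp] theorem ψ_apply0 (y : E4) : ψ y 0 = y 0 * y 1 := by simp [ψ]
@[simp] theorem ψ_apply1 (y : E4) : ψ y 1 = Real.log (y 1) := by simp [ψ]
@[simp] theorem ψ_apply2 (y : E4) : ψ y 2 = y 2 := by simp [ψ]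
@[simp] theorem ψ_apply3 (y : E4) : ψ y 3 = y 3 := by simp [ψ]
@[simp] theorem g_apply0 (x : E4) : g x 0 = x 0 * Real.exp (-(x 1)) := by simp [g]
@[simp] theorem g_apply1 (x : E4) : g x 1 = Real.exp (x 1) := by simp [g]
@[simp] theorem g_apply2 (x : E4) : g x 2 = x 2 := by simp [g]
@[simp] theorem g_apply3 (x : E4) : g x 3 = x 3 := by simp [g]

theorem g_ψ {y : E4} (hy : 0 < y 1) : g (ψ y) = y := by
  ext i
  fin_cases i
  · simp [Real.exp_neg, Real.exp_log hy, mul_assoc, mul_inv_cancel₀ hy.ne']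
  · simp [Real.exp_log hy]
  · simp
  · simp

theorem ψ_g (x : E4) : ψ (g x) = x := by
  ext i
  fin_cases i
  · simp [Real.exp_neg]
  · simp [Real.log_exp]
  · simp
  · simp

theorem g_pos (x : E4) : 0 < g x 1 := by simp [Real.exp_pos]

/-- the coordinate functions are smooth -/
theorem contDiff_coord (i : Fin 4) : ContDiff ℝ ∞ fun x : E4 => x i :=
  contDiff_euclidean.1 contDiff_id i

theorem contDiff_g : ContDiff ℝ ∞ g := by
  rw [contDiff_euclidean]
  intro i
  fin_cases i
  · simpa using (contDiff_coord 0).mul (contDiff_coord 1).neg.exp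
  · simpa using (contDiff_coord 1).exp
  · simpa using contDiff_coord 2
  · simpa using contDiff_coord 3

theorem contDiffOn_ψ : ContDiffOn ℝ ∞ ψ {y : E4 | 0 < y 1} := by
  rw [contDiffOn_euclidean]
  intro i
  fin_cases i
  · simpa using ((contDiff_coord 0).mul (contDiff_coord 1)).contDiffOn
  · have h : ContDiffOn ℝ ∞ (fun y : E4 => Real.log (y 1)) {y : E4 | 0 < y 1} :=
      (contDiff_coord 1).contDiffOn.log (fun y hy => ne_of_gt hy)
    simpa using h
  · simpa using (contDiff_coord 2).contDiffOn
  · simpa using (contDiff_coord 3).contDiffOn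

/-- the coordinate projections as continuous linear maps -/
abbrev pr (i : Fin 4) : E4 →L[ℝ] ℝ := PiLp.proj (𝕜 := ℝ) 2 (fun _ : Fin 4 => ℝ) i

/-- coordinate projections as derivatives -/
theorem hasFDerivAt_coord (i : Fin 4) (y : E4) :
    HasFDerivAt (fun x : E4 => x i) (pr i) y :=
  (pr i).hasFDerivAt

/-- The derivative of `ψ` at a point with `0 < y₁`, coordinatewise. -/
theorem fderiv_ψ_apply {y : E4} (hy : 0 < y 1) (v : E4) :
    fderiv ℝ ψ y v 0 = y 0 * v 1 + y 1 * v 0 ∧ fderiv ℝ ψ y v 1 = (y 1)⁻¹ * v 1 ∧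
      fderiv ℝ ψ y v 2 = v 2 ∧ fderiv ℝ ψ y v 3 = v 3 := by
  have hdiff : DifferentiableAt ℝ ψ y :=
    (contDiffOn_ψ.differentiableOn (by simp)).differentiableAt
      ((isOpen_lt continuous_const (pr 1).continuous).mem_nhds hy)
  have hD : ∀ i, HasFDerivAt (fun x => ψ x i) (pr i ∘L fderiv ℝ ψ y) y := by
    intro i
    exact (hasFDerivWithinAt_euclidean.1 hdiff.hasFDerivAt.hasFDerivWithinAt i).hasFDerivAt_of_univ
  -- explicit derivatives of the four coordinates
  have h0 : HasFDerivAt (fun x => ψ x 0) (y 0 • pr 1 + y 1 • pr 0) y := by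
    have := (hasFDerivAt_coord 0 y).mul (hasFDerivAt_coord 1 y)
    simpa [Pi.mul_def] using this
  have h1 : HasFDerivAt (fun x => ψ x 1) ((y 1)⁻¹ • pr 1) y := by
    have := (Real.hasDerivAt_log hy.ne').comp_hasFDerivAt y (hasFDerivAt_coord 1 y)
    simpa [Function.comp_def] using this
  have h2 : HasFDerivAt (fun x => ψ x 2) (pr 2) y := by
    simpa using hasFDerivAt_coord 2 y
  have h3 : HasFDerivAt (fun x => ψ x 3) (pr 3) y := by
    simpa using hasFDerivAt_coord 3 y
  have e0 := (hD 0).unique h0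
  have e1 := (hD 1).unique h1
  have e2 := (hD 2).unique h2
  have e3 := (hD 3).unique h3
  refine ⟨?_, ?_, ?_, ?_⟩
  · have := congrArg (fun L : E4 →L[ℝ] ℝ => L v) e0
    simpa [mul_comm] using this
  · have := congrArg (fun L : E4 →L[ℝ] ℝ => L v) e1
    simpa using this
  · have := congrArg (fun L : E4 →L[ℝ] ℝ => L v) e2
    simpa using this
  · have := congrArg (fun L : E4 →L[ℝ] ℝ => L v) e3
    simpa using this

/-- `ψ` is symplectic on `{0 < y₁}`: `ω₀(dψ v, dψ w) = ω₀(v, w)`. -/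
theorem std_fderiv_ψ {y : E4} (hy : 0 < y 1) (v w : E4) :
    stdSymplecticForm (fderiv ℝ ψ y v) (fderiv ℝ ψ y w) = stdSymplecticForm v w := by
  obtain ⟨a0, a1, a2, a3⟩ := fderiv_ψ_apply hy v
  obtain ⟨b0, b1, b2, b3⟩ := fderiv_ψ_apply hy w
  simp only [stdSymplecticForm, a0, a1, a2, a3, b0, b1, b2, b3]
  field_simp
  ring


/-! ### The end region and the end chart -/

/-- The end region `Ω = {0 < y₁, 1 < ‖ψ y‖} = g({1 < ‖z‖})`. -/
def Ω : Set E4 := {y | 0 < y 1 ∧ 1 < ‖ψ y‖}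

theorem mem_Ω {y : E4} : y ∈ Ω ↔ 0 < y 1 ∧ 1 < ‖ψ y‖ := Iff.rfl

theorem isOpen_Ω : IsOpen Ω := by
  have h1 : IsOpen {y : E4 | 0 < y 1} := isOpen_lt continuous_const (pr 1).continuous
  have h2 : ContinuousOn (fun y => ‖ψ y‖) {y : E4 | 0 < y 1} :=
    continuous_norm.comp_continuousOn contDiffOn_ψ.continuousOn
  have h3 := h2.isOpen_inter_preimage h1 (isOpen_Ioi (a := (1 : ℝ)))
  convert h3 using 1
  ext y
  simp [Ω, mem_Ioi]

theorem mem_compl_closedBall {z : E4} {R : ℝ} : z ∈ (Metric.closedBall (0 : E4) R)ᶜ ↔ R < ‖z‖ := by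
  simp [Metric.mem_closedBall, dist_zero_right]

theorem bijOn_ψ : Set.BijOn ψ Ω (Metric.closedBall (0 : E4) 1)ᶜ := by
  refine ⟨fun y hy => mem_compl_closedBall.2 hy.2, ?_, ?_⟩
  · intro y hy y' hy' h
    have := congrArg g h
    rwa [g_ψ hy.1, g_ψ hy'.1] at this
  · intro z hz
    refine ⟨g z, ⟨g_pos z, ?_⟩, ψ_g z⟩
    rw [ψ_g]
    exact mem_compl_closedBall.1 hz

theorem contMDiffOn_ψ : ContMDiffOn (𝓡 4) 𝓘(ℝ, E4) ∞ ψ Ω :=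
  (contDiffOn_ψ.mono fun _ hy => hy.1).contMDiffOn

theorem contMDiff_g : ContMDiff 𝓘(ℝ, E4) (𝓡 4) ∞ g := contDiff_g.contMDiff

/-- `sf = ψ*ω₀` on `Ω` for `sf = ω₀`: `ψ` is a symplectomorphism of `(Ω, ω₀)` onto the standard
end. -/
theorem pullback_ψ (y : E4) (hy : y ∈ Ω) (v w : TangentSpace (𝓡 4) y) :
    stdSymplecticMForm y ![v, w] =
      stdSymplecticForm (mfderiv (𝓡 4) 𝓘(ℝ, E4) ψ y v) (mfderiv (𝓡 4) 𝓘(ℝ, E4) ψ y w) := by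
  have h : mfderiv (𝓡 4) 𝓘(ℝ, E4) ψ y = fderiv ℝ ψ y := mfderiv_eq_fderiv
  rw [stdSymplecticMForm_apply, h]
  exact (std_fderiv_ψ hy.1 v w).symm

/-! ### The conclusion fails: the end returns to the hyperplane `{y₁ = 0}` -/

/-- The test points `p t = (0, t, ρ, 0)`. -/
def pt (ρ t : ℝ) : E4 := WithLp.toLp 2 ![0, t, ρ, 0]

@[simp] theorem pt_apply1 (ρ t : ℝ) : pt ρ t 1 = t := by simp [pt]
@[simp] theorem pt_apply2 (ρ t : ℝ) : pt ρ t 2 = ρ := by simp [pt]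

theorem dist_pt (ρ t : ℝ) : dist (pt ρ t) (pt ρ 0) = |t| := by
  rw [EuclideanSpace.dist_eq, Fin.sum_univ_four]
  simp [pt, Real.sqrt_sq_eq_abs]

theorem norm_ψ_pt (ρ : ℝ) {t : ℝ} : |Real.log t| ≤ ‖ψ (pt ρ t)‖ := by
  have := abs_apply_le_norm (ψ (pt ρ t)) 1
  simpa using this

theorem le_norm_pt (ρ t : ℝ) : |ρ| ≤ ‖pt ρ t‖ := by
  have := abs_apply_le_norm (pt ρ t) 2
  simpa using this

/-- No CONTINUOUS `Φ : ℝ⁴ → ℝ⁴` agrees with `ψ` off a compact set: along `t ↦ (0, t, ρ, 0)`,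
`t → 0⁺`, the points stay outside the compact set while `‖ψ‖ ≥ |log t| → ∞`. -/
theorem not_agrees_of_continuous {Φ : E4 → E4} (hΦ : Continuous Φ) {K' : Set E4}
    (hK' : IsCompact K') (hagree : ∀ x, x ∉ K' → Φ x = ψ x) : False := by
  obtain ⟨r, hr⟩ := hK'.isBounded.subset_closedBall (0 : E4)
  set ρ : ℝ := |r| + 1 with hρ
  have hout : ∀ t, pt ρ t ∉ K' := by
    intro t ht
    have h1 := hr ht
    rw [Metric.mem_closedBall, dist_zero_right] at h1
    have h2 := le_norm_pt ρ t
    rw [hρ, abs_of_pos (by positivity)] at h2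
    linarith [le_abs_self r]
  set q : E4 := pt ρ 0 with hq
  obtain ⟨δ, hδ, hcont⟩ := Metric.continuousAt_iff.1 (hΦ.continuousAt (x := q)) 1 one_pos
  set t : ℝ := min (δ / 2) (Real.exp (-(‖Φ q‖ + 2))) with ht
  have htpos : 0 < t := lt_min (half_pos hδ) (Real.exp_pos _)
  have htδ : dist (pt ρ t) q < δ := by
    rw [hq, dist_pt, abs_of_pos htpos]
    exact (min_le_left _ _).trans_lt (half_lt_self hδ)
  have hlog : ‖Φ q‖ + 2 ≤ |Real.log t| := by
    have h1 : Real.log t ≤ -(‖Φ q‖ + 2) := by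
      have := Real.log_le_log htpos (min_le_right (δ / 2) (Real.exp (-(‖Φ q‖ + 2))))
      rwa [Real.log_exp] at this
    have h2 : Real.log t ≤ 0 := by linarith [norm_nonneg (Φ q)]
    rw [abs_of_nonpos h2]
    linarith
  have hbig : ‖Φ q‖ + 2 ≤ ‖Φ (pt ρ t)‖ := by
    rw [hagree _ (hout t)]
    exact hlog.trans (norm_ψ_pt ρ)
  have hsmall : ‖Φ (pt ρ t)‖ < ‖Φ q‖ + 1 := by
    have h1 : dist (Φ (pt ρ t)) (Φ q) < 1 := hcont htδ
    rw [dist_eq_norm] at h1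
    have h2 : ‖Φ (pt ρ t)‖ ≤ ‖Φ q‖ + ‖Φ (pt ρ t) - Φ q‖ := by
      have := norm_add_le (Φ q) (Φ (pt ρ t) - Φ q)
      rwa [add_sub_cancel] at this
    linarith
  linarith


/-- All hypotheses but H5 hold for `M = ℝ⁴, sf = ω₀, K = Ωᶜ, R = 1, ψ, χ = g`. -/
theorem hypotheses :
    (∀ x : E4, Subsingleton (π_ 2 E4 x)) ∧ IsSymplectic stdSymplecticMForm ∧
      IsEndChart Ωᶜ 1 ψ g ∧ PullbackClause stdSymplecticMForm Ωᶜ ψ := by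
  refine ⟨subsingleton_pi_two_euclideanSpace,
    ⟨isSmoothForm_stdSymplecticMForm, isClosedForm_stdSymplecticMForm, stdSymplecticMForm_nondegenerate⟩,
    ?_, ?_⟩
  · refine ⟨?_, contMDiff_g.contMDiffOn, ?_, ?_⟩
    · rw [compl_compl]; exact contMDiffOn_ψ
    · rw [compl_compl]; exact bijOn_ψ
    · intro y hy
      rw [compl_compl] at hy
      exact g_ψ hy.1
  · intro y hy v w
    rw [compl_compl] at hy
    exact pullback_ψ y hy v w

/-- … and H5 indeed fails there (consistency check: the witness is not secretly a model of the
crux): `K ∪ {‖ψ‖ ≤ 1} ⊇ {y₁ ≤ 0}` is unbounded. -/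
theorem not_endsCoCompact : ¬ EndsCoCompact Ωᶜ 1 ψ := by
  intro h
  obtain ⟨r, hr⟩ := (h 1 le_rfl).isBounded.subset_closedBall (0 : E4)
  have hmem : pt (|r| + 1) (-1) ∈ Ωᶜ ∪ {x | ‖ψ x‖ ≤ 1} := by
    left
    intro hΩ
    have := hΩ.1
    simp at this
    linarith
  have h1 := hr hmem
  rw [Metric.mem_closedBall, dist_zero_right] at h1
  have h2 := le_norm_pt (|r| + 1) (-1)
  rw [abs_of_pos (by positivity)] at h2
  linarith [le_abs_self r]

/-- The conclusion fails for `(ℝ⁴, ω₀, ψ)`. -/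
theorem not_conclusion : ¬ Conclusion stdSymplecticMForm ψ := by
  rintro ⟨Φ, -, K', hK', hagree⟩
  exact not_agrees_of_continuous Φ.continuous hK' hagree

end ShearEnd

/-- **H5 is load-bearing**: the crux with the ends clause deleted is FALSE. The end chart of the
witness is a genuine symplectomorphism of an open `Ω ⊆ ℝ⁴` onto the standard end `{1 < ‖z‖}` (no junk
is used: the contradiction is derived along points of `Ω`), but `ℝ⁴ ∖ Ω` is non-compact and the end
accumulates on the hyperplane `{y₁ = 0}`. Any proof of the crux must use the co-compactness of the
sub-ends `{R' < ‖ψ‖}` — it is exactly what rules out `M` = "the end itself" and ends that return. -/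
theorem gromovRecognitionRelEnd_false_without_ends : ¬ GromovRecognitionRelEndWithoutEnds := by
  intro h
  obtain ⟨h1, h234, h6789, h10⟩ := ShearEnd.hypotheses
  exact ShearEnd.not_conclusion (h E4 stdSymplecticMForm ShearEnd.Ωᶜ 1 ShearEnd.ψ ShearEnd.g
    h1 h234 h6789 h10)


/-! ## 5. What the ENDS clause adds over "`K` compact": the end itself (modulo `π₂` of the end)

With H5 weakened to `IsCompact K`, the crux fails for `M = {1 < ‖z‖}` itself (`K = ∅`, `ψ` = inclusion):
every other hypothesis holds, and no homeomorphism `M ≅ ℝ⁴` can be the inclusion near the missing sphere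
`‖z‖ = 1`. Cycle 1 recorded this MODULO `π₂({1 < ‖z‖}) = π₂(S³) = 0`; cycle 2 discharges that hypothesis
in `§5'` (`EndItself.subsingleton_pi_two`, via the tree's general-position proof of `π_k(Sⁿ) = 0`, `k < n`),
so `gromovRecognitionRelEnd_false_withCompactK` below is unconditional. This is the model the Literature
docstring of `gromov_recognitionR4_relEnd` cites in prose ("fails for `M = ℝ⁴ ∖ B̄(0,R)` with `K = ∅`"). -/

/-- The crux with the ENDS clause H5 weakened to `IsCompact K`. -/
def GromovRecognitionRelEndWithCompactK : Prop :=
  ∀ (M : Type) [TopologicalSpace M] [T2Space M] [SecondCountableTopology M]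
    [ChartedSpace E4 M] [IsManifold (𝓡 4) ∞ M] [ConnectedSpace M]
    (sf : MForm (𝓡 4) M ℝ 2) (K : Set M) (R : ℝ) (ψ : M → E4) (χ : E4 → M),
    (∀ x : M, Subsingleton (π_ 2 M x)) → IsSymplectic sf → IsCompact K →
      IsEndChart K R ψ χ → PullbackClause sf K ψ → Conclusion sf ψ

namespace EndItself

/-- The standard end `{1 < ‖z‖}` of `ℝ⁴` as an open submanifold. -/
def stdEnd : Opens E4 := ⟨(Metric.closedBall (0 : E4) 1)ᶜ, Metric.isClosed_closedBall.isOpen_compl⟩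

/-- Membership in the standard end. -/
theorem mem_stdEnd {z : E4} : z ∈ stdEnd ↔ 1 < ‖z‖ := by
  simp [stdEnd, Metric.mem_closedBall, dist_zero_right]

/-- `e₀`. -/
abbrev e0 : E4 := EuclideanSpace.single 0 1

/-- `‖e₀‖ = 1`. -/
theorem norm_e0 : ‖e0‖ = 1 := by simp [e0]

/-- `ℝ⁴` has dimension `> 1`. -/
theorem one_lt_rank : 1 < Module.rank ℝ E4 := by
  rw [← Module.finrank_eq_rank, finrank_euclideanSpace_fin]
  norm_num

/-- The standard end is connected: it is the image of `S³ × (1, ∞)` under `(x, t) ↦ t • x`. -/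
theorem isConnected_stdEnd : IsConnected ((stdEnd : Opens E4) : Set E4) := by
  have hS : IsConnected (Metric.sphere (0 : E4) 1 ×ˢ Ioi (1 : ℝ)) :=
    (isConnected_sphere one_lt_rank 0 zero_le_one).prod isConnected_Ioi
  have himg : (fun p : E4 × ℝ => p.2 • p.1) '' (Metric.sphere (0 : E4) 1 ×ˢ Ioi (1 : ℝ)) =
      ((stdEnd : Opens E4) : Set E4) := by
    ext z
    simp only [mem_image, mem_prod, mem_sphere_iff_norm, sub_zero, mem_Ioi, Prod.exists]
    constructor
    · rintro ⟨x, t, ⟨hx, ht⟩, rfl⟩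
      rw [SetLike.mem_coe, mem_stdEnd, norm_smul, hx, mul_one, Real.norm_eq_abs, abs_of_pos (by linarith)]
      exact ht
    · intro hz
      rw [SetLike.mem_coe, mem_stdEnd] at hz
      have hz0 : ‖z‖ ≠ 0 := by linarith
      refine ⟨‖z‖⁻¹ • z, ‖z‖, ⟨?_, hz⟩, ?_⟩
      · rw [norm_smul, norm_inv, norm_norm, inv_mul_cancel₀ hz0]
      · rw [smul_smul, mul_inv_cancel₀ hz0, one_smul]
  rw [← himg]
  exact hS.image _ ((continuous_snd.smul continuous_fst).continuousOn)

/-- The standard end is a connected space. -/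
instance : ConnectedSpace (stdEnd : Opens E4) :=
  isConnected_iff_connectedSpace.1 isConnected_stdEnd

/-- The junk-extended inverse chart `χ z = z` for `1 < ‖z‖`, else the point `2e₀`. -/
def χ (z : E4) : stdEnd :=
  if h : 1 < ‖z‖ then ⟨z, mem_stdEnd.2 h⟩ else ⟨(2 : ℝ) • e0, mem_stdEnd.2 (by
    rw [norm_smul, norm_e0, Real.norm_eq_abs]; norm_num)⟩

/-- `χ z = z` on the end. -/
theorem χ_val {z : E4} (hz : 1 < ‖z‖) : (χ z : E4) = z := by
  simp [χ, hz]

/-- The restricted form `ω₀|_{stdEnd}`. -/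
def sf : MForm (𝓡 4) stdEnd ℝ 2 :=
  stdSymplecticMForm.pullback (𝓡 4) (Subtype.val : stdEnd → E4)

/-- The inclusion of the end is `C^∞`. -/
theorem contMDiff_val : ContMDiff (𝓡 4) (𝓡 4) ∞ (Subtype.val : stdEnd → E4) :=
  contMDiff_subtype_val

/-- All hypotheses of the weakened crux hold for the end itself: `M = {1 < ‖z‖}`, `sf = ω₀|_M`, `K = ∅`,
`R = 1`, `ψ = inclusion`, modulo `π₂(M) = 0` (true — `M ≃ S³ × ℝ` and `π₂(S³) = 0` — but not provable
over Mathlib today). -/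
theorem hypotheses :
    IsSymplectic sf ∧ IsCompact (∅ : Set stdEnd) ∧
      IsEndChart (∅ : Set stdEnd) 1 Subtype.val χ ∧ PullbackClause sf ∅ Subtype.val := by
  refine ⟨⟨?_, ?_, ?_⟩, isCompact_empty, ⟨?_, ?_, ?_, ?_⟩, ?_⟩
  · exact isSmoothForm_stdSymplecticMForm_pullback contMDiff_val
  · exact isClosedForm_stdSymplecticMForm_pullback contMDiff_val
  · intro x v hv
    obtain ⟨w, hw⟩ := stdSymplecticMForm_nondegenerate (x : E4) v hv
    refine ⟨w, ?_⟩
    rwa [sf, MForm.pullback_subtypeVal_apply]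
  · exact contMDiff_val.contMDiffOn
  · intro z hz
    have hz' : 1 < ‖z‖ := by simpa [Metric.mem_closedBall, dist_zero_right] using hz
    rw [← ContMDiffWithinAt.subtypeVal_comp_iff]
    refine (contMDiffWithinAt_id (I := 𝓘(ℝ, E4)) (n := ∞)).congr (fun y hy => ?_) ?_
    · have hy' : 1 < ‖y‖ := by simpa [Metric.mem_closedBall, dist_zero_right] using hy
      simp [χ_val hy']
    · simp [χ_val hz']
  · refine ⟨fun x _ => x.2, Subtype.val_injective.injOn, fun z hz => ?_⟩
    exact ⟨⟨z, hz⟩, fun h => h, rfl⟩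
  · intro x _
    have hx : 1 < ‖(x : E4)‖ := mem_stdEnd.1 x.2
    exact Subtype.ext (χ_val hx)
  · intro x _ v w
    rw [sf, stdSymplecticMForm_pullback_apply]

/-- The points `z_n = (1 + 1/(n+1)) e₀` of the end, converging to `e₀ ∈ ∂B(0,1)` in `ℝ⁴`. -/
def zseq (n : ℕ) : E4 := (1 + 1 / ((n : ℝ) + 1)) • e0

/-- `‖z_n‖ = 1 + 1/(n+1)`. -/
theorem norm_zseq (n : ℕ) : ‖zseq n‖ = 1 + 1 / ((n : ℝ) + 1) := by
  rw [zseq, norm_smul, norm_e0, mul_one, Real.norm_eq_abs, abs_of_pos (by positivity)]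

/-- `z_n` lies in the end. -/
theorem one_lt_norm_zseq (n : ℕ) : 1 < ‖zseq n‖ := by
  rw [norm_zseq]; simp only [lt_add_iff_pos_right]; positivity

/-- … as points of the end. -/
def xseq (n : ℕ) : stdEnd := ⟨zseq n, mem_stdEnd.2 (one_lt_norm_zseq n)⟩

/-- `z_n → e₀` in `ℝ⁴`. -/
theorem tendsto_zseq : Tendsto zseq atTop (𝓝 e0) := by
  have h1 : Tendsto (fun n : ℕ => 1 / ((n : ℝ) + 1)) atTop (𝓝 0) :=
    tendsto_one_div_add_atTop_nhds_zero_nat (𝕜 := ℝ)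
  have h3 : Tendsto (fun n : ℕ => (1 + 1 / ((n : ℝ) + 1)) • e0) atTop (𝓝 ((1 + 0 : ℝ) • e0)) :=
    (tendsto_const_nhds.add h1).smul tendsto_const_nhds
  rw [add_zero, one_smul] at h3
  exact h3

/-- The conclusion fails for the end itself: a diffeomorphism `Φ : {1 < ‖z‖} ≃ ℝ⁴` equal to the
inclusion off a compact set would send `z_n → e₀` (in `ℝ⁴`) to a convergent sequence of the end, whose
limit would have to be the missing boundary point `e₀`. -/
theorem not_conclusion : ¬ Conclusion sf (Subtype.val : stdEnd → E4) := by
  rintro ⟨Φ, -, K', hK', hagree⟩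
  -- eventually `x_n ∉ K'`
  have hKc : IsClosed (Subtype.val '' K') := (hK'.image continuous_subtype_val).isClosed
  have he0 : e0 ∉ Subtype.val '' K' := by
    rintro ⟨x, -, hx⟩
    have := mem_stdEnd.1 x.2
    rw [hx, norm_e0] at this
    exact lt_irrefl _ this
  have hev : ∀ᶠ n in atTop, xseq n ∉ K' := by
    have h1 : ∀ᶠ n in atTop, zseq n ∈ (Subtype.val '' K')ᶜ :=
      tendsto_zseq (hKc.isOpen_compl.mem_nhds he0)
    filter_upwards [h1] with n hn hK
    exact hn ⟨xseq n, hK, rfl⟩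
  -- so `Φ x_n = z_n → e₀`, and applying `Φ⁻¹`, `x_n → Φ⁻¹ e₀` in the end
  have hΦx : Tendsto (fun n => Φ (xseq n)) atTop (𝓝 e0) := by
    refine tendsto_zseq.congr' ?_
    filter_upwards [hev] with n hn
    exact (hagree _ hn).symm
  have hx : Tendsto xseq atTop (𝓝 (Φ.symm e0)) := by
    have := (Φ.symm.continuous.tendsto e0).comp hΦx
    simpa [Function.comp_def] using this
  -- hence `z_n = val x_n → val (Φ⁻¹ e₀)`, so `val (Φ⁻¹ e₀) = e₀`, which is not in the end
  have hz : Tendsto zseq atTop (𝓝 ((Φ.symm e0 : stdEnd) : E4)) :=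
    (continuous_subtype_val.tendsto _).comp hx
  have heq : ((Φ.symm e0 : stdEnd) : E4) = e0 := tendsto_nhds_unique hz tendsto_zseq
  have := mem_stdEnd.1 (Φ.symm e0).2
  rw [heq, norm_e0] at this
  exact lt_irrefl _ this

end EndItself

/-- **What the ENDS clause adds over `K` compact.** With H5 weakened to `IsCompact K` the crux is
FALSE as soon as `π₂({1 < ‖z‖}) = 0` is available: the standard end itself (`K = ∅`, `ψ` = inclusion)
satisfies every other hypothesis and is not even homeomorphic to `ℝ⁴` relative to the end. -/
theorem gromovRecognitionRelEnd_false_withCompactK_of_pi2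
    (hπ : ∀ x : EndItself.stdEnd, Subsingleton (π_ 2 EndItself.stdEnd x)) :
    ¬ GromovRecognitionRelEndWithCompactK := by
  intro h
  obtain ⟨h234, hK, h6789, h10⟩ := EndItself.hypotheses
  exact EndItself.not_conclusion (h EndItself.stdEnd EndItself.sf ∅ 1 Subtype.val
    EndItself.χ hπ h234 hK h6789 h10)


/-! ## 5'. `π₂` of the standard end vanishes — `§5` made unconditional -/

namespace EndItself

/-- The end as a type. -/
abbrev End4 : Type := (stdEnd : Opens E4)

/-- Points of the end are non-zero (norm `> 1 > 0`). -/
theorem norm_pos (x : End4) : 0 < ‖(x : E4)‖ := zero_lt_one.trans (mem_stdEnd.1 x.2)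

/-- The retraction `x ↦ x/‖x‖` of the end onto the unit sphere, as a function. -/
def toSphereFun (x : End4) : Metric.sphere (0 : E4) 1 :=
  ⟨‖(x : E4)‖⁻¹ • (x : E4), by simp [norm_smul, inv_mul_cancel₀ (norm_pos x).ne']⟩

/-- Value of `toSphereFun`. -/
@[simp] theorem toSphereFun_val (x : End4) :
    ((toSphereFun x : Metric.sphere (0 : E4) 1) : E4) = ‖(x : E4)‖⁻¹ • (x : E4) := rfl

/-- The underlying map of the retraction is continuous. -/
theorem continuous_toSphereFun_val : Continuous fun x : End4 => ‖(x : E4)‖⁻¹ • (x : E4) :=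
  (Continuous.inv₀ (continuous_norm.comp continuous_subtype_val) fun x => (norm_pos x).ne').smul
    continuous_subtype_val

/-- `toSphereFun` is continuous. -/
theorem continuous_toSphereFun : Continuous toSphereFun :=
  continuous_toSphereFun_val.subtype_mk _

/-- The retraction as a continuous map. -/
def toSphere : C(End4, Metric.sphere (0 : E4) 1) := ⟨toSphereFun, continuous_toSphereFun⟩

/-- The inclusion `y ↦ 2y` of the unit sphere into the end, as a function. -/
def ofSphereFun (y : Metric.sphere (0 : E4) 1) : End4 :=
  ⟨(2 : ℝ) • (y : E4), mem_stdEnd.2 (by rw [norm_smul, norm_eq_of_mem_sphere y]; norm_num)⟩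

/-- Value of `ofSphereFun`. -/
@[simp] theorem ofSphereFun_val (y : Metric.sphere (0 : E4) 1) :
    ((ofSphereFun y : End4) : E4) = (2 : ℝ) • (y : E4) := rfl

/-- The underlying map of the inclusion is continuous. -/
theorem continuous_ofSphereFun_val : Continuous fun y : Metric.sphere (0 : E4) 1 => (2 : ℝ) • (y : E4) :=
  continuous_subtype_val.const_smul (2 : ℝ)

/-- `ofSphereFun` is continuous. -/
theorem continuous_ofSphereFun : Continuous ofSphereFun :=
  continuous_ofSphereFun_val.subtype_mk _

/-- The inclusion as a continuous map. -/
def ofSphere : C(Metric.sphere (0 : E4) 1, End4) := ⟨ofSphereFun, continuous_ofSphereFun⟩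

/-- `toSphere ∘ ofSphere = id`. -/
theorem toSphere_ofSphere (y : Metric.sphere (0 : E4) 1) : toSphere (ofSphere y) = y := by
  apply Subtype.ext
  simp only [toSphere, ofSphere, ContinuousMap.coe_mk, toSphereFun_val, ofSphereFun_val, norm_smul,
    norm_eq_of_mem_sphere y, smul_smul]
  norm_num

/-- The coefficient of the straight-line homotopy keeps the point in the end. -/
theorem one_lt_coeff_mul {t r : ℝ} (ht0 : 0 ≤ t) (ht1 : t ≤ 1) (hr : 1 < r) :
    1 < ((1 - t) * (2 * r⁻¹) + t) * r := by
  have hr0 : 0 < r := zero_lt_one.trans hr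
  have h : ((1 - t) * (2 * r⁻¹) + t) * r = (1 - t) * 2 + t * r := by
    field_simp
  rw [h]
  have h2 : t * 1 ≤ t * r := mul_le_mul_of_nonneg_left hr.le ht0
  rcases eq_or_lt_of_le ht1 with h1 | h1
  · subst h1; linarith
  · nlinarith

/-- The coefficient `(1-t)·2/‖x‖ + t` of the straight-line homotopy. -/
def coeff (p : unitInterval × End4) : ℝ := (1 - (p.1 : ℝ)) * (2 * ‖(p.2 : E4)‖⁻¹) + (p.1 : ℝ)

/-- The coefficient is continuous. -/
theorem continuous_coeff : Continuous coeff := by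
  unfold coeff
  refine Continuous.add (Continuous.mul ?_ (continuous_const.mul (Continuous.inv₀ ?_ fun p => ?_))) ?_
  · exact continuous_const.sub (continuous_subtype_val.comp continuous_fst)
  · exact continuous_norm.comp (continuous_subtype_val.comp continuous_snd)
  · exact (norm_pos p.2).ne'
  · exact continuous_subtype_val.comp continuous_fst

/-- The coefficient keeps points in the end. -/
theorem one_lt_coeff_mul_norm (p : unitInterval × End4) : 1 < coeff p * ‖(p.2 : E4)‖ :=
  one_lt_coeff_mul p.1.2.1 p.1.2.2 (mem_stdEnd.1 p.2.2)

/-- The coefficient is positive. -/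
theorem coeff_pos (p : unitInterval × End4) : 0 < coeff p := by
  by_contra h
  rw [not_lt] at h
  have := mul_nonpos_of_nonpos_of_nonneg h (norm_nonneg (p.2 : E4))
  linarith [one_lt_coeff_mul_norm p]

/-- The straight-line homotopy `H(t, x) = ((1-t)·2/‖x‖ + t) x` from `ofSphere ∘ toSphere` to `id`,
as a function into the end. -/
def homotopyFun (p : unitInterval × End4) : End4 :=
  ⟨coeff p • (p.2 : E4), mem_stdEnd.2 (by
    rw [norm_smul, Real.norm_eq_abs, abs_of_pos (coeff_pos p)]
    exact one_lt_coeff_mul_norm p)⟩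

/-- The underlying map of the homotopy is continuous. -/
theorem continuous_homotopyFun_val : Continuous fun p : unitInterval × End4 => coeff p • (p.2 : E4) :=
  continuous_coeff.smul (continuous_subtype_val.comp continuous_snd)

/-- `homotopyFun` is continuous. -/
theorem continuous_homotopyFun : Continuous homotopyFun :=
  continuous_homotopyFun_val.subtype_mk _

/-- The homotopy `ofSphere ∘ toSphere ≃ id`. -/
def homotopy : (ofSphere.comp toSphere).Homotopy (ContinuousMap.id End4) where
  toFun := homotopyFun
  continuous_toFun := continuous_homotopyFun
  map_zero_left x := by
    apply Subtype.ext
    simp only [homotopyFun, coeff, ContinuousMap.comp_apply, toSphere, ofSphere, ContinuousMap.coe_mk,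
      ofSphereFun_val, toSphereFun_val, smul_smul]
    norm_num
  map_one_left x := by
    apply Subtype.ext
    simp [homotopyFun, coeff]

/-- The end `{1 < ‖z‖}` is homotopy equivalent to the unit sphere `S³`. -/
def homotopyEquivSphere : End4 ≃ₕ Metric.sphere (0 : E4) 1 where
  toFun := toSphere
  invFun := ofSphere
  left_inv := ⟨homotopy⟩
  right_inv := by
    have h : toSphere.comp ofSphere = ContinuousMap.id _ := by
      ext y : 1
      exact toSphere_ofSphere y
    rw [h]

/-- **`π₂` of the standard end vanishes**: `{1 < ‖z‖} ≃ₕ S³` and `π₂(S³) = 0` (tree lemma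
`subsingleton_homotopyGroup_sphere`, Hatcher Cor. 4.9 by general position). -/
theorem subsingleton_pi_two (x : End4) : Subsingleton (π_ 2 End4 x) :=
  subsingleton_homotopyGroup_of_homotopyEquiv homotopyEquivSphere
    (fun y => subsingleton_homotopyGroup_sphere (by rw [finrank_euclideanSpace_fin]; norm_num) y) x

end EndItself

/-- **H5 weakened to `IsCompact K` is FALSE — unconditionally** (gen-1's
`gromovRecognitionRelEnd_false_withCompactK_of_pi2` with its only hypothesis `π₂({1 < ‖z‖}) = 0`
now discharged by `EndItself.subsingleton_pi_two`): the standard end itself (`K = ∅`, `ψ` the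
inclusion) satisfies every other hypothesis of the crux and is not diffeomorphic to `ℝ⁴` relative to
the end. So the co-compactness of ALL sub-ends (not just compactness of `K`) is load-bearing. -/
theorem gromovRecognitionRelEnd_false_withCompactK : ¬ GromovRecognitionRelEndWithCompactK :=
  gromovRecognitionRelEnd_false_withCompactK_of_pi2 EndItself.subsingleton_pi_two


/-! ## 6. Load-bearing analysis: H4 (nondegeneracy) — trivially, via the conclusion

Dropping nondegeneracy (keeping smooth + closed) is fatal for the cheap reason that the conclusion
`sf = Φ*ω₀` forces `sf` nondegenerate. Witness: the pinched form `F*ω₀` on `ℝ⁴` with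
`F x = x - (c(x)·x₀)e₀` (`c` a bump at `0`), which is `ω₀` off `B̄(0, 1/2)` and degenerate at `0`.
(The same remark applies to H3, closedness: `Φ*ω₀` is closed; a checked witness would need a compactly
supported non-closed nondegenerate perturbation of `ω₀` and Mathlib's `extDeriv` bookkeeping — not done.
The informative versions — closedness needed even for the DIFFEOMORPHISM conclusion, e.g. `T⁴ ∖ pt` with an
almost-symplectic form standard at infinity; `π₂ = 0` needed, e.g. the blow-up of `ℝ⁴` — require
manifolds not constructible here.) -/

/-- The crux with the NONDEGENERACY of `sf` (H4) deleted (smooth and closed kept). -/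
def GromovRecognitionRelEndWithoutNondegenerate : Prop :=
  ∀ (M : Type) [TopologicalSpace M] [T2Space M] [SecondCountableTopology M]
    [ChartedSpace E4 M] [IsManifold (𝓡 4) ∞ M] [ConnectedSpace M]
    (sf : MForm (𝓡 4) M ℝ 2) (K : Set M) (R : ℝ) (ψ : M → E4) (χ : E4 → M),
    (∀ x : M, Subsingleton (π_ 2 M x)) → IsSmoothForm sf → IsClosedForm sf → EndsCoCompact K R ψ →
      IsEndChart K R ψ χ → PullbackClause sf K ψ → Conclusion sf ψ

namespace Pinch

/-- `e₀`. -/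
abbrev e0 : E4 := EuclideanSpace.single 0 1

/-- A bump function at the origin: `= 1` on `B̄(0, 1/4)`, supported in `B(0, 1/2)`. -/
def cb : ContDiffBump (0 : E4) := ⟨1 / 4, 1 / 2, by norm_num, by norm_num⟩

/-- The projection `P x = x - x₀ e₀` killing the first coordinate, as a continuous linear map. -/
def PL : E4 →L[ℝ] E4 :=
  ContinuousLinearMap.id ℝ E4 - (EuclideanSpace.proj (0 : Fin 4)).smulRight e0

/-- `P e₀ = 0`. -/
theorem PL_e0 : PL e0 = 0 := by
  ext i
  simp [PL, EuclideanSpace.proj, e0]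

/-- The pinching map `F x = x - (c x · x₀) e₀`: the identity off `B(0, 1/2)`, the projection `P` on
`B̄(0, 1/4)`. -/
def F (x : E4) : E4 := x - (cb x * x 0) • e0

/-- `F` is `C^∞`. -/
theorem contDiff_F : ContDiff ℝ ∞ F := by
  have h0 : ContDiff ℝ ∞ fun x : E4 => x 0 := contDiff_euclidean.1 contDiff_id 0
  exact contDiff_id.sub ((cb.contDiff.mul h0).smul contDiff_const)

/-- `F = id` off `B̄(0, 1/2)`. -/
theorem F_eq_id {x : E4} (hx : 1 / 2 ≤ ‖x‖) : F x = x := by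
  have h : cb x = 0 := cb.zero_of_le_dist (by simpa [cb, dist_zero_right] using hx)
  simp [F, h]

/-- `F = P` on `B̄(0, 1/4)`. -/
theorem F_eq_PL {x : E4} (hx : ‖x‖ ≤ 1 / 4) : F x = PL x := by
  have h : cb x = 1 := cb.one_of_mem_closedBall (by simpa [cb, dist_zero_right] using hx)
  simp [F, PL, h, EuclideanSpace.proj]

/-- `dF = id` at points with `1/2 < ‖x‖`. -/
theorem hasMFDerivAt_F_of_lt {x : E4} (hx : 1 / 2 < ‖x‖) :
    HasMFDerivAt (𝓡 4) (𝓡 4) F x (ContinuousLinearMap.id ℝ E4) := by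
  have hev : F =ᶠ[𝓝 x] (id : E4 → E4) := by
    have ho : IsOpen {y : E4 | 1 / 2 < ‖y‖} := isOpen_lt continuous_const continuous_norm
    filter_upwards [ho.mem_nhds hx] with y hy
    exact F_eq_id hy.le
  exact (hasMFDerivAt_id (I := 𝓡 4) x).congr_of_eventuallyEq hev

/-- `dF = P` at the origin. -/
theorem hasMFDerivAt_F_zero : HasMFDerivAt (𝓡 4) (𝓡 4) F 0 PL := by
  have hev : F =ᶠ[𝓝 (0 : E4)] (PL : E4 → E4) := by
    filter_upwards [Metric.ball_mem_nhds (0 : E4) (show (0 : ℝ) < 1 / 4 by norm_num)] with y hy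
    exact F_eq_PL (by simpa [dist_zero_right] using (Metric.mem_ball.1 hy).le)
  exact PL.hasFDerivAt.hasMFDerivAt.congr_of_eventuallyEq hev

/-- The pinched form `sf = F*ω₀`: smooth, closed, `= ω₀` off `B̄(0, 1/2)`, degenerate at `0`. -/
def sf : MForm (𝓡 4) E4 ℝ 2 := stdSymplecticMForm.pullback (𝓡 4) F

/-- `sf₀(e₀, ·) = 0`: the pinched form is degenerate at the origin. -/
theorem sf_zero_e0 (w : E4) : sf 0 ![e0, w] = 0 := by
  rw [sf, stdSymplecticMForm_pullback_apply, hasMFDerivAt_F_zero.mfderiv]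
  show stdSymplecticForm (PL e0) (PL w) = 0
  rw [PL_e0]
  simp [stdSymplecticForm]

/-- `sf = ω₀` at points with `1/2 < ‖x‖` (where `dF = id`). -/
theorem sf_apply_of_lt {x : E4} (hx : 1 / 2 < ‖x‖) (v w : E4) :
    sf x ![v, w] = stdSymplecticForm v w := by
  rw [sf, stdSymplecticMForm_pullback_apply, (hasMFDerivAt_F_of_lt hx).mfderiv]
  rfl

/-- All hypotheses of the crux except nondegeneracy hold for `M = ℝ⁴`, `sf = F*ω₀`, `K = B̄(0,1)`, `R = 1`,
`ψ = χ = id`. -/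
theorem hypotheses :
    (∀ x : E4, Subsingleton (π_ 2 E4 x)) ∧ IsSmoothForm sf ∧ IsClosedForm sf ∧
      EndsCoCompact (Metric.closedBall (0 : E4) 1) 1 id ∧
        IsEndChart (Metric.closedBall (0 : E4) 1) 1 id id ∧
          PullbackClause sf (Metric.closedBall (0 : E4) 1) id := by
  obtain ⟨h1, -, -, -, h5, h6, h7, h8, h9, h10⟩ := gromov_recognitionR4_relEnd.stdModel_hypotheses
  refine ⟨h1, isSmoothForm_stdSymplecticMForm_pullback contDiff_F.contMDiff,
    isClosedForm_stdSymplecticMForm_pullback contDiff_F.contMDiff, h5, ⟨h6, h7, h8, h9⟩, ?_⟩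
  intro x hx v w
  have hx' : 1 / 2 < ‖x‖ := by
    have : 1 < ‖x‖ := by simpa [Metric.mem_closedBall, dist_zero_right] using hx
    linarith
  rw [sf_apply_of_lt hx', ← stdSymplecticMForm_apply x v w]
  exact h10 x hx v w

/-- The conclusion fails: `Φ*ω₀` is nondegenerate at `0`, `sf` is not. -/
theorem not_conclusion : ¬ Conclusion sf (id : E4 → E4) := by
  rintro ⟨Φ, hΦ, -⟩
  have he0 : (e0 : E4) ≠ 0 := by
    intro h
    have := congrArg (fun z : E4 => z 0) h
    simp [e0] at this
  obtain ⟨w, hw⟩ := stdSymplecticMForm_pullback_nondegenerate Φ (0 : E4) e0 he0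
  rw [stdSymplecticMForm_pullback_apply] at hw
  exact hw ((hΦ 0 e0 w).symm.trans (sf_zero_e0 w))

end Pinch

/-- **H4 (nondegeneracy) is load-bearing** — for the trivial reason that the conclusion implies it: the
crux with nondegeneracy deleted is FALSE (witness: the pinched form `F*ω₀` on `ℝ⁴`, standard off
`B̄(0, 1/2)`, degenerate at the origin). -/
theorem gromovRecognitionRelEnd_false_without_nondegenerate : ¬ GromovRecognitionRelEndWithoutNondegenerate := by
  intro h
  obtain ⟨h1, h2, h3, h5, h6789, h10⟩ := Pinch.hypotheses
  exact Pinch.not_conclusion (h E4 Pinch.sf (Metric.closedBall (0 : E4) 1) 1 id id h1 h2 h3 h5 h6789 h10)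



/-! ## 6b. Load-bearing analysis: H3 (closedness) — trivially, via the conclusion

The companion of §6: `sf = ω₀ + b·(dx₀ ∧ dx₂)`, `b = ½·bump` at the origin, is smooth, pointwise
nondegenerate (`sf(v, J₀v) ≥ ‖v‖²/2`) and standard off `B̄(0, 1/2)`, but NOT closed
(`d sf = db ∧ dx₀ ∧ dx₂`, non-zero where `∂₁b ≠ 0`, a point supplied by the mean value theorem along the
`x₁`-axis, evaluated through Mathlib's `extDeriv_apply`). Since `Φ*ω₀` is closed, the crux with H3 deleted
is FALSE. -/

/-- The crux with the CLOSEDNESS of `sf` (H3) deleted (smoothness and nondegeneracy kept). -/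
def GromovRecognitionRelEndWithoutClosed : Prop :=
  ∀ (M : Type) [TopologicalSpace M] [T2Space M] [SecondCountableTopology M]
    [ChartedSpace E4 M] [IsManifold (𝓡 4) ∞ M] [ConnectedSpace M]
    (sf : MForm (𝓡 4) M ℝ 2) (K : Set M) (R : ℝ) (ψ : M → E4) (χ : E4 → M),
    (∀ x : M, Subsingleton (π_ 2 M x)) → IsSmoothForm sf →
      (∀ x (v : TangentSpace (𝓡 4) x), v ≠ 0 → ∃ w, sf x ![v, w] ≠ 0) → EndsCoCompact K R ψ →
        IsEndChart K R ψ χ → PullbackClause sf K ψ → Conclusion sf ψ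

namespace NonClosed

/-! ### The constant form `α₀ = dx₀ ∧ dx₂` -/

/-- The bilinear map `B(a, b) = a₀ b₂`. -/
def bil : E4 →L[ℝ] E4 →L[ℝ] ℝ :=
  (EuclideanSpace.proj (0 : Fin 4)).smulRight (EuclideanSpace.proj (2 : Fin 4) : E4 →L[ℝ] ℝ)

/-- `B(a, b) = a₀ b₂`. -/
@[simp] theorem bil_apply (a b : E4) : bil a b = a 0 * b 2 := by
  simp [bil, EuclideanSpace.proj]

/-- `α₀ = dx₀ ∧ dx₂` as a continuous alternating `2`-form: the alternatization of `B`. -/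
def α₀ : E4 [⋀^Fin 2]→L[ℝ] ℝ :=
  ContinuousMultilinearMap.alternatization
    (ContinuousLinearMap.uncurryLeft
      (((continuousMultilinearCurryFin1 ℝ E4 ℝ).symm : (E4 →L[ℝ] ℝ) →L[ℝ] _).comp bil))

/-- `α₀(v, w) = v₀ w₂ - w₀ v₂`. -/
@[simp] theorem α₀_apply (v w : E4) : α₀ ![v, w] = v 0 * w 2 - w 0 * v 2 := by
  change (ContinuousMultilinearMap.alternatization _ : E4 [⋀^Fin 2]→L[ℝ] ℝ)
    (show Fin 2 → E4 from ![v, w]) = _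
  rw [ContinuousMultilinearMap.alternatization_apply_apply]
  have huniv : (Finset.univ : Finset (Equiv.Perm (Fin 2))) = {1, Equiv.swap 0 1} := by decide
  rw [huniv, Finset.sum_pair (by decide)]
  simp [Equiv.Perm.sign_swap', Units.smul_def]
  ring

/-! ### The perturbation coefficient `b = ½ · bump` -/

/-- A bump at the origin, `= 1` on `B̄(0, 1/4)`, supported in `B(0, 1/2)`. -/
def cb : ContDiffBump (0 : E4) := ⟨1 / 4, 1 / 2, by norm_num, by norm_num⟩

/-- `b = ½ cb`. -/
def b (x : E4) : ℝ := 2⁻¹ * cb x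

/-- `b` is `C^∞`. -/
theorem contDiff_b : ContDiff ℝ ∞ b := contDiff_const.mul cb.contDiff

/-- `0 ≤ b`. -/
theorem b_nonneg (x : E4) : 0 ≤ b x := mul_nonneg (by norm_num) (cb.nonneg)

/-- `b ≤ ½`. -/
theorem b_le (x : E4) : b x ≤ 2⁻¹ := by
  have := cb.le_one (x := x)
  unfold b; nlinarith

/-- `b = 0` off `B̄(0, 1/2)`. -/
theorem b_eq_zero {x : E4} (hx : 1 / 2 ≤ ‖x‖) : b x = 0 := by
  have h : cb x = 0 := cb.zero_of_le_dist (by simpa [cb, dist_zero_right] using hx)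
  simp [b, h]

/-- `b 0 = ½`. -/
theorem b_zero : b 0 = 2⁻¹ := by
  have h : cb (0 : E4) = 1 := cb.one_of_mem_closedBall (by simp [cb])
  simp [b, h]

/-! ### The perturbed form `sf = ω₀ + b · α₀`: smooth, nondegenerate, standard off `B̄(0, 1/2)`, NOT closed -/

/-- The NON-CLOSED almost-symplectic form `x ↦ ω₀ + b(x) α₀`, as a map into `2`-forms. -/
def sfE (x : E4) : E4 [⋀^Fin 2]→L[ℝ] ℝ := stdSymplecticAlt + b x • α₀

/-- The same as a form on the manifold `ℝ⁴` (tree type `MForm`). -/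
def sf : MForm (𝓡 4) E4 ℝ 2 := fun x => sfE x

/-- `sf(v, w) = ω₀(v, w) + b (v₀w₂ - w₀v₂)`. -/
theorem sf_apply (x : E4) (v w : E4) :
    sf x ![v, w] = stdSymplecticForm v w + b x * (v 0 * w 2 - w 0 * v 2) := by
  show stdSymplecticAlt ![v, w] + b x • α₀ ![v, w] = _
  rw [stdSymplecticAlt_apply, α₀_apply, smul_eq_mul]

/-- `sf = ω₀` off `B̄(0, 1/2)`. -/
theorem sf_apply_of_le {x : E4} (hx : 1 / 2 ≤ ‖x‖) (v w : E4) : sf x ![v, w] = stdSymplecticForm v w := by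
  rw [sf_apply, b_eq_zero hx]; ring

/-- As a map into the space of `2`-forms, `sf` is `C^∞`. -/
theorem contDiff_sfE : ContDiff ℝ ∞ sfE :=
  contDiff_const.add (contDiff_b.smul contDiff_const)

/-- The chart representative of a form on the model space is the form itself. -/
theorem inChart_eq_self (α : MForm (𝓡 4) E4 ℝ 2) (x : E4) : α.inChart x = α := by
  funext y
  ext v
  simp [MForm.inChart_apply]
  rfl

/-- `sf` is a smooth form (tree predicate). -/
theorem isSmoothForm_sf : IsSmoothForm sf := by
  intro x
  rw [inChart_eq_self]
  exact (contDiff_sfE.contDiffAt (x := extChartAt (𝓡 4) x x)).contDiffWithinAt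

/-- `sf` is pointwise nondegenerate: `sf(v, J₀v) ≥ ‖v‖²/2`. -/
theorem sf_nondegenerate (x : E4) (v : E4) (hv : v ≠ 0) : ∃ w : E4, sf x ![v, w] ≠ 0 := by
  refine ⟨WithLp.toLp 2 ![-v 1, v 0, -v 3, v 2], ?_⟩
  rw [sf_apply, stdSymplecticForm_rot_eq_norm_sq]
  have hn : 0 < ‖v‖ ^ 2 := by positivity
  have hsq : ‖v‖ ^ 2 = v 0 * v 0 + v 1 * v 1 + v 2 * v 2 + v 3 * v 3 := by
    rw [EuclideanSpace.real_norm_sq_eq, Fin.sum_univ_four]; simp [sq]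
  have h0 := b_nonneg x
  have h1 := b_le x
  simp
  nlinarith [sq_nonneg (v 0 + v 3), sq_nonneg (v 0 - v 3), sq_nonneg (v 1 - v 2), sq_nonneg (v 1 + v 2),
    mul_nonneg h0 (sq_nonneg (v 0 + v 3)), mul_nonneg h0 (sq_nonneg (v 1 - v 2)),
    mul_nonneg (sub_nonneg.2 h1) (sq_nonneg (v 0 - v 3))]

/-! ### `sf` is not closed -/

/-- `e i`. -/
abbrev e (i : Fin 4) : E4 := EuclideanSpace.single i 1

/-- A point `x = t e₁`, `t ∈ (0, 1)`, where the directional derivative `∂₁ b` does not vanish (mean value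
theorem: `b(0) = ½`, `b(e₁) = 0`). -/
theorem exists_deriv_b_ne : ∃ t : ℝ, fderiv ℝ b ((t : ℝ) • e 1) (e 1) ≠ 0 := by
  have hdiff : ∀ t : ℝ, HasDerivAt (fun s : ℝ => b (s • e 1)) (fderiv ℝ b (t • e 1) (e 1)) t := by
    intro t
    have h1 : HasDerivAt (fun s : ℝ => s • e 1) (e 1) t := by
      simpa using (hasDerivAt_id t).smul_const (e 1)
    exact (contDiff_b.differentiable (by simp) _).hasFDerivAt.comp_hasDerivAt t h1
  obtain ⟨c, -, hc⟩ := exists_deriv_eq_slope (fun s : ℝ => b (s • e 1)) zero_lt_one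
    (fun s _ => (hdiff s).continuousAt.continuousWithinAt)
    (fun s _ => (hdiff s).differentiableAt.differentiableWithinAt)
  refine ⟨c, ?_⟩
  rw [← (hdiff c).deriv, hc]
  have h1 : b ((1 : ℝ) • e 1) = 0 := b_eq_zero (by norm_num [e])
  have h0 : b ((0 : ℝ) • e 1) = 2⁻¹ := by simp [b_zero]
  rw [h1, h0]
  norm_num

/-- `d sf ≠ 0`: at `x = t e₁` as above, `(d sf)_x(e₁, e₀, e₂) = ∂₁b(x) · α₀(e₀, e₂) = ∂₁b(x) ≠ 0`. -/
theorem not_isClosedForm_sf : ¬ IsClosedForm sf := by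
  obtain ⟨t, ht⟩ := exists_deriv_b_ne
  intro hclosed
  set x : E4 := t • e 1 with hx
  have h1 : mextDeriv sf x = 0 := by rw [show mextDeriv sf = 0 from hclosed]; rfl
  have h2 : mextDeriv sf x = extDeriv sfE x := mextDeriv_eq_extDeriv sf x
  have hdiff : DifferentiableAt ℝ sfE x := contDiff_sfE.differentiable (by simp) x
  have h3 : extDeriv sfE x ![e 1, e 0, e 2] = 0 := by rw [← h2, h1]; rfl
  rw [extDeriv_apply hdiff, Fin.sum_univ_three] at h3
  -- the three scalar functions and their derivatives
  have hcomp : ∀ (u : Fin 2 → E4), (fun y => sfE y u) = fun y => stdSymplecticAlt u + b y * α₀ u := by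
    intro u; funext y
    show stdSymplecticAlt u + b y • α₀ u = _
    rw [smul_eq_mul]
  have hder : ∀ (u : Fin 2 → E4) (w : E4), fderiv ℝ (fun y => sfE y u) x w = fderiv ℝ b x w * α₀ u := by
    intro u w
    rw [hcomp]
    have hb : DifferentiableAt ℝ b x := contDiff_b.differentiable (by simp) x
    rw [fderiv_const_add, fderiv_mul_const hb]
    simp [mul_comm]
  simp only [hder] at h3
  have r0 : Fin.removeNth (0 : Fin 3) ![e 1, e 0, e 2] = ![e 0, e 2] := by
    funext j; fin_cases j <;> rfl
  have r1 : Fin.removeNth (1 : Fin 3) ![e 1, e 0, e 2] = ![e 1, e 2] := by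
    funext j; fin_cases j <;> rfl
  have r2 : Fin.removeNth (2 : Fin 3) ![e 1, e 0, e 2] = ![e 1, e 0] := by
    funext j; fin_cases j <;> rfl
  rw [r0, r1, r2, α₀_apply, α₀_apply, α₀_apply] at h3
  simp [e] at h3
  exact ht h3

/-- All hypotheses of the crux except closedness hold for `M = ℝ⁴`, `sf = ω₀ + b α₀`, `K = B̄(0,1)`, `R = 1`,
`ψ = χ = id`. -/
theorem hypotheses :
    (∀ x : E4, Subsingleton (π_ 2 E4 x)) ∧ IsSmoothForm sf ∧
      (∀ (x : E4) (v : TangentSpace (𝓡 4) x), v ≠ 0 → ∃ w, sf x ![v, w] ≠ 0) ∧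
        EndsCoCompact (Metric.closedBall (0 : E4) 1) 1 id ∧
          IsEndChart (Metric.closedBall (0 : E4) 1) 1 id id ∧
            PullbackClause sf (Metric.closedBall (0 : E4) 1) id := by
  obtain ⟨h1, -, -, -, h5, h6, h7, h8, h9, h10⟩ := gromov_recognitionR4_relEnd.stdModel_hypotheses
  refine ⟨h1, isSmoothForm_sf, sf_nondegenerate, h5, ⟨h6, h7, h8, h9⟩, ?_⟩
  intro x hx v w
  have hx' : 1 / 2 ≤ ‖x‖ := by
    have : 1 < ‖x‖ := by simpa [Metric.mem_closedBall, dist_zero_right] using hx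
    linarith
  rw [sf_apply_of_le hx', ← stdSymplecticMForm_apply x v w]
  exact h10 x hx v w

/-- The conclusion fails: `sf = Φ*ω₀` would make `sf` closed. -/
theorem not_conclusion : ¬ Conclusion sf (id : E4 → E4) := by
  rintro ⟨Φ, hΦ, -⟩
  have heq : sf = stdSymplecticMForm.pullback (𝓡 4) Φ := by
    funext x
    ext u
    have hu : u = ![u 0, u 1] := by
      funext i; fin_cases i <;> rfl
    rw [hu, hΦ x (u 0) (u 1), stdSymplecticMForm_pullback_apply]
  have hclosed : IsClosedForm sf := by
    rw [heq]
    exact isClosedForm_stdSymplecticMForm_pullback Φ.contMDiff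
  exact not_isClosedForm_sf hclosed

end NonClosed

/-- **H3 (closedness) is load-bearing** — for the trivial reason that the conclusion implies it: the crux
with closedness deleted is FALSE (witness: the smooth nondegenerate NON-CLOSED form `ω₀ + b·(dx₀ ∧ dx₂)` on
`ℝ⁴`, `b = ½·bump`, standard off `B̄(0, 1/2)`). The informative version — closedness needed even for the
DIFFEOMORPHISM conclusion (e.g. `T⁴ ∖ pt` with an almost-symplectic form standard at infinity) — is out of
reach (no such manifold is constructible here). -/
theorem gromovRecognitionRelEnd_false_without_closed : ¬ GromovRecognitionRelEndWithoutClosed := by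
  intro h
  obtain ⟨h1, h2, h4, h5, h6789, h10⟩ := NonClosed.hypotheses
  exact NonClosed.not_conclusion (h E4 NonClosed.sf (Metric.closedBall (0 : E4) 1) 1 id id h1 h2 h4 h5
    h6789 h10)
/-! ## 6c. Load-bearing analysis: H2 (smoothness of `sf`) — trivially, via the conclusion

With H2 (`IsSmoothForm sf`) deleted, closedness H3 — DEFINED as `mextDeriv sf = 0`, where Mathlib's
`fderiv` (hence `extDeriv`) takes the junk value `0` at points of non-differentiability — no longer
entails any regularity: the DISCONTINUOUS form `α = ω₀ + 𝟙_{0}·ω₀` (`= 2ω₀` at the origin, `= ω₀`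
elsewhere) is "closed" (`extDeriv α = 0`: at `x ≠ 0` because `α` is locally constant, at `0` by junk),
pointwise nondegenerate and standard off `B̄(0, 1)`, so `(ℝ⁴, α, K = B̄(0,1), R = 1, ψ = χ = id)`
satisfies H1, H3–H10; but `α = Φ*ω₀` is impossible for a `C^∞` (even `C¹`) `Φ`, whose pulled-back form
is continuous in `x`. Informative content for auditors: `IsClosedForm` is only meaningful TOGETHER with
`IsSmoothForm`; the crux states both, so no junk enters the crux itself. -/

/-- The crux with the SMOOTHNESS of `sf` (H2) deleted (closedness and nondegeneracy kept). -/
def GromovRecognitionRelEndWithoutSmoothForm : Prop :=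
  ∀ (M : Type) [TopologicalSpace M] [T2Space M] [SecondCountableTopology M]
    [ChartedSpace E4 M] [IsManifold (𝓡 4) ∞ M] [ConnectedSpace M]
    (sf : MForm (𝓡 4) M ℝ 2) (K : Set M) (R : ℝ) (ψ : M → E4) (χ : E4 → M),
    (∀ x : M, Subsingleton (π_ 2 M x)) → IsClosedForm sf →
      (∀ x (v : TangentSpace (𝓡 4) x), v ≠ 0 → ∃ w, sf x ![v, w] ≠ 0) → EndsCoCompact K R ψ →
        IsEndChart K R ψ χ → PullbackClause sf K ψ → Conclusion sf ψ

namespace NonSmooth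

/-- `e i`. -/
abbrev e (i : Fin 4) : E4 := EuclideanSpace.single i 1

/-- The discontinuous form `α = ω₀ + 𝟙_{0} ω₀`, as a map into `2`-forms on `ℝ⁴`. -/
def αE (x : E4) : E4 [⋀^Fin 2]→L[ℝ] ℝ :=
  stdSymplecticAlt + Set.indicator {(0 : E4)} (fun _ => stdSymplecticAlt) x

/-- The same as a form on the manifold `ℝ⁴`. -/
def α : MForm (𝓡 4) E4 ℝ 2 := fun x => αE x

/-- `α = ω₀` away from the origin. -/
theorem αE_of_ne {x : E4} (hx : x ≠ 0) : αE x = stdSymplecticAlt := by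
  simp [αE, hx]

/-- `α 0 = ω₀ + ω₀`. -/
theorem αE_zero : αE 0 = stdSymplecticAlt + stdSymplecticAlt := by
  simp [αE]

/-- `α(v, w) = ω₀(v, w)` away from the origin. -/
theorem α_apply_of_ne {x : E4} (hx : x ≠ 0) (v w : E4) : α x ![v, w] = stdSymplecticForm v w := by
  show αE x ![v, w] = _
  rw [αE_of_ne hx, stdSymplecticAlt_apply]

/-- `α₀(v, w) = 2ω₀(v, w)`. -/
theorem α_apply_zero (v w : E4) : α 0 ![v, w] = 2 * stdSymplecticForm v w := by
  show αE 0 ![v, w] = _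
  rw [αE_zero, ContinuousAlternatingMap.add_apply, stdSymplecticAlt_apply]
  ring

/-- `ω₀(e₀, e₁) = 1`. -/
theorem std_e0_e1 : stdSymplecticForm (e 0) (e 1) = 1 := by
  simp [stdSymplecticForm, e]

/-- The test sequence `x_n = (n+1)⁻¹ e₀ → 0`. -/
theorem tendsto_seq : Tendsto (fun n : ℕ => ((n : ℝ) + 1)⁻¹ • e 0) atTop (𝓝 (0 : E4)) := by
  have h1 : Tendsto (fun n : ℕ => ((n : ℝ) + 1)⁻¹) atTop (𝓝 0) := by
    simpa using tendsto_one_div_add_atTop_nhds_zero_nat (𝕜 := ℝ)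
  simpa using h1.smul_const (e 0)

/-- The test points are non-zero. -/
theorem seq_ne_zero (n : ℕ) : ((n : ℝ) + 1)⁻¹ • e 0 ≠ (0 : E4) := by
  intro hn
  have := congrArg (fun z : E4 => z 0) hn
  simp [e] at this
  linarith [show (0 : ℝ) < (n : ℝ) + 1 by positivity]

/-- `α` is NOT continuous at the origin. -/
theorem not_continuousAt_αE : ¬ ContinuousAt αE 0 := by
  intro h
  have hlim : Tendsto (fun n : ℕ => αE (((n : ℝ) + 1)⁻¹ • e 0)) atTop (𝓝 (αE 0)) :=
    h.tendsto.comp tendsto_seq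
  have hconst : (fun n : ℕ => αE (((n : ℝ) + 1)⁻¹ • e 0)) = fun _ => stdSymplecticAlt :=
    funext fun n => αE_of_ne (seq_ne_zero n)
  rw [hconst] at hlim
  have heq : αE 0 = stdSymplecticAlt := tendsto_nhds_unique hlim tendsto_const_nhds
  rw [αE_zero] at heq
  have h2 := congrArg (fun (L : E4 [⋀^Fin 2]→L[ℝ] ℝ) => L ![e 0, e 1]) heq
  simp only [ContinuousAlternatingMap.add_apply, stdSymplecticAlt_apply, std_e0_e1] at h2
  norm_num at h2

/-- `extDeriv` vanishes where `fderiv` does (in particular at junk points). -/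
theorem extDeriv_eq_zero_of_fderiv {β : E4 → E4 [⋀^Fin 2]→L[ℝ] ℝ} {x : E4} (h : fderiv ℝ β x = 0) :
    extDeriv β x = 0 := by
  simp only [extDeriv, h]
  exact map_zero (ContinuousAlternatingMap.alternatizeUncurryFinCLM ℝ E4 ℝ)

/-- `α` is "closed" in the sense of the tree predicate: `extDeriv α = 0` everywhere — at `x ≠ 0`
honestly (locally constant), at `x = 0` by the junk value `fderiv = 0` of a non-differentiable map. -/
theorem isClosedForm_α : IsClosedForm α := by
  show mextDeriv α = 0
  funext x
  have h1 : mextDeriv α x = extDeriv αE x := mextDeriv_eq_extDeriv α x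
  rw [h1]
  show extDeriv αE x = 0
  by_cases hx : x = 0
  · subst hx
    apply extDeriv_eq_zero_of_fderiv
    exact fderiv_zero_of_not_differentiableAt fun h => not_continuousAt_αE h.continuousAt
  · have hev : αE =ᶠ[𝓝 x] fun _ => stdSymplecticAlt := by
      filter_upwards [isOpen_ne.mem_nhds hx] with y hy using αE_of_ne hy
    rw [hev.extDeriv_eq]
    apply extDeriv_eq_zero_of_fderiv
    exact fderiv_const_apply _

/-- `α` is pointwise nondegenerate (`α_x = ω₀` or `2ω₀`). -/
theorem α_nondegenerate (x : E4) (v : E4) (hv : v ≠ 0) : ∃ w : E4, α x ![v, w] ≠ 0 := by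
  obtain ⟨w, hw⟩ := stdSymplecticMForm_nondegenerate x v hv
  rw [stdSymplecticMForm_apply] at hw
  refine ⟨w, ?_⟩
  by_cases hx : x = 0
  · subst hx
    rw [α_apply_zero]
    intro h; apply hw; linarith
  · rwa [α_apply_of_ne hx]

/-- All hypotheses of the crux except H2 hold for `M = ℝ⁴`, `sf = α`, `K = B̄(0,1)`, `R = 1`, `ψ = χ = id`. -/
theorem hypotheses :
    (∀ x : E4, Subsingleton (π_ 2 E4 x)) ∧ IsClosedForm α ∧
      (∀ (x : E4) (v : TangentSpace (𝓡 4) x), v ≠ 0 → ∃ w, α x ![v, w] ≠ 0) ∧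
        EndsCoCompact (Metric.closedBall (0 : E4) 1) 1 id ∧
          IsEndChart (Metric.closedBall (0 : E4) 1) 1 id id ∧
            PullbackClause α (Metric.closedBall (0 : E4) 1) id := by
  obtain ⟨h1, -, -, -, h5, h6, h7, h8, h9, h10⟩ := gromov_recognitionR4_relEnd.stdModel_hypotheses
  refine ⟨h1, isClosedForm_α, α_nondegenerate, h5, ⟨h6, h7, h8, h9⟩, ?_⟩
  intro x hx v w
  have hx1 : 1 < ‖x‖ := by simpa [Metric.mem_closedBall, dist_zero_right] using hx
  have hx0 : x ≠ 0 := by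
    rintro rfl
    rw [norm_zero] at hx1
    norm_num at hx1
  rw [α_apply_of_ne hx0, ← stdSymplecticMForm_apply x v w]
  exact h10 x hx v w

/-- `x ↦ ω₀(dΦ_x e₀, dΦ_x e₁)` is continuous for a diffeomorphism `Φ` (indeed for any `C¹` map). -/
theorem continuous_pullback_coeff (Φ : E4 ≃ₘ⟮𝓡 4, 𝓡 4⟯ E4) :
    Continuous fun x => stdSymplecticForm (fderiv ℝ Φ x (e 0)) (fderiv ℝ Φ x (e 1)) := by
  have hΦ : ContDiff ℝ ∞ Φ := contMDiff_iff_contDiff.1 Φ.contMDiff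
  have hD : Continuous (fderiv ℝ (Φ : E4 → E4)) := hΦ.continuous_fderiv (by simp)
  have ha : ∀ (u : E4) (i : Fin 4), Continuous fun x => fderiv ℝ Φ x u i := fun u i =>
    (continuous_apply i).comp <| (PiLp.continuous_ofLp 2 _).comp
      ((ContinuousLinearMap.apply ℝ E4 u).continuous.comp hD)
  simp only [stdSymplecticForm]
  fun_prop

/-- The conclusion fails: `α = Φ*ω₀` would make `x ↦ α_x(e₀, e₁)` continuous, but it jumps at `0`. -/
theorem not_conclusion : ¬ Conclusion α (id : E4 → E4) := by
  rintro ⟨Φ, hΦ, -⟩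
  set g : E4 → ℝ := fun x => stdSymplecticForm (fderiv ℝ Φ x (e 0)) (fderiv ℝ Φ x (e 1)) with hg
  have hgα : ∀ x, g x = α x ![e 0, e 1] := by
    intro x
    have h := hΦ x (e 0) (e 1)
    have hD : mfderiv (𝓡 4) 𝓘(ℝ, E4) Φ x = fderiv ℝ Φ x := mfderiv_eq_fderiv
    rw [hD] at h
    exact h.symm
  have hcont : Continuous g := continuous_pullback_coeff Φ
  -- `g = 1` off the origin, `g 0 = 2`
  have hg0 : g 0 = 2 := by rw [hgα, α_apply_zero, std_e0_e1]; norm_num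
  have hg1 : ∀ x : E4, x ≠ 0 → g x = 1 := fun x hx => by rw [hgα, α_apply_of_ne hx, std_e0_e1]
  have hlim := (hcont.tendsto 0).comp tendsto_seq
  have hconst : (g ∘ fun n : ℕ => ((n : ℝ) + 1)⁻¹ • e 0) = fun _ => (1 : ℝ) :=
    funext fun n => hg1 _ (seq_ne_zero n)
  rw [hconst, hg0] at hlim
  have := tendsto_nhds_unique hlim tendsto_const_nhds
  norm_num at this

end NonSmooth

/-- **H2 (smoothness of `sf`) is load-bearing** — for the trivial reason that the conclusion implies it
(and because H3 alone, `mextDeriv sf = 0` with junk `fderiv`, carries no regularity): the crux with H2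
deleted is FALSE, witness the discontinuous "closed" nondegenerate form `ω₀ + 𝟙_{0}ω₀` on `ℝ⁴`. -/
theorem gromovRecognitionRelEnd_false_without_smoothForm : ¬ GromovRecognitionRelEndWithoutSmoothForm := by
  intro h
  obtain ⟨h1, h3, h4, h5, h6789, h10⟩ := NonSmooth.hypotheses
  exact NonSmooth.not_conclusion (h E4 NonSmooth.α (Metric.closedBall (0 : E4) 1) 1 id id h1 h3 h4 h5
    h6789 h10)


/-! ## 7. A second model of all ten hypotheses, and a refuted strengthening (`K' = K`)

The RADIAL TWIST `T_φ(x) = e^{iφ(‖x‖²)}x` of `ℂ² = ℝ⁴` is an `ω₀`-symplectomorphism for every smooth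
profile `φ` (time-one map of the Hamiltonian `F(‖x‖²/2)`, `F' = φ`; checked by the coordinate formula
`std_fderiv_twist`). With the SINGULAR profile `θ(t) = (t-1)⁻¹` the twist `ψ = T_θ` is a symplectomorphism
of the end `{1 < ‖x‖}` onto itself, so `(ℝ⁴, ω₀, K = B̄(0,1), R = 1, ψ, χ = T_{-θ})` satisfies ALL TEN
hypotheses (`TwistEnd.hypotheses` — a genuinely non-trivial end map, unlike the standard model), the
conclusion of the crux HOLDS there (`TwistEnd.conclusion`: cut the profile off, `Φ = T_φ`, `K' = B̄(0,2)`),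
but the natural strengthening "`Φ = ψ` on all of `Kᶜ`" FAILS (`TwistEnd.not_strongConclusion`: `ψ`
oscillates between `id` and `-id` along `√(1 + T⁻¹)e₀`, `T → ∞`, so it has no continuous extension to the
sphere `‖x‖ = 1`). Hence `not_gromovRecognitionRelEndStrong`: the shrinking `∃ K'` of the conclusion cannot
be sharpened to `K' = K`. -/

/-- The STRENGTHENED conclusion: `Φ = ψ` on all of `Kᶜ` (i.e. `K' = K`). -/
def StrongConclusion {M : Type} [TopologicalSpace M] [ChartedSpace E4 M] [IsManifold (𝓡 4) ∞ M]
    (sf : MForm (𝓡 4) M ℝ 2) (K : Set M) (ψ : M → E4) : Prop :=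
  ∃ Φ : M ≃ₘ⟮𝓡 4, 𝓡 4⟯ E4,
    (∀ x v w, sf x ![v, w] =
      stdSymplecticForm (mfderiv (𝓡 4) 𝓘(ℝ, E4) Φ x v) (mfderiv (𝓡 4) 𝓘(ℝ, E4) Φ x w)) ∧
    ∀ x, x ∈ Kᶜ → Φ x = ψ x

namespace TwistEnd

/-- the coordinate projections as continuous linear maps -/
abbrev pr (i : Fin 4) : E4 →L[ℝ] ℝ := PiLp.proj (𝕜 := ℝ) 2 (fun _ : Fin 4 => ℝ) i

/-- coordinate projections as derivatives -/
theorem hasFDerivAt_coord (i : Fin 4) (y : E4) : HasFDerivAt (fun x : E4 => x i) (pr i) y :=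
  (pr i).hasFDerivAt

/-- the coordinate functions are smooth -/
theorem contDiff_coord (i : Fin 4) : ContDiff ℝ ∞ fun x : E4 => x i :=
  contDiff_euclidean.1 contDiff_id i

/-! ### Rotations of `ℂ² = ℝ⁴` by a radius-dependent angle -/

/-- The rotation `R_{c,s} x = c x + s Jx` of `ℂ² = ℝ⁴` (`J(x₀,x₁,x₂,x₃) = (-x₁,x₀,-x₃,x₂)`), in coordinates. -/
def rot (c s : ℝ) (x : E4) : E4 :=
  WithLp.toLp 2 ![c * x 0 - s * x 1, c * x 1 + s * x 0, c * x 2 - s * x 3, c * x 3 + s * x 2]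

/-- First coordinate of `R_{c,s} x`. -/
@[simp] theorem rot_apply0 (c s : ℝ) (x : E4) : rot c s x 0 = c * x 0 - s * x 1 := by simp [rot]
/-- Second coordinate of `R_{c,s} x`. -/
@[simp] theorem rot_apply1 (c s : ℝ) (x : E4) : rot c s x 1 = c * x 1 + s * x 0 := by simp [rot]
/-- Third coordinate of `R_{c,s} x`. -/
@[simp] theorem rot_apply2 (c s : ℝ) (x : E4) : rot c s x 2 = c * x 2 - s * x 3 := by simp [rot]
/-- Fourth coordinate of `R_{c,s} x`. -/
@[simp] theorem rot_apply3 (c s : ℝ) (x : E4) : rot c s x 3 = c * x 3 + s * x 2 := by simp [rot]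

/-- `‖R_{c,s} x‖² = (c² + s²)‖x‖²`. -/
theorem norm_rot_sq (c s : ℝ) (x : E4) : ‖rot c s x‖ ^ 2 = (c ^ 2 + s ^ 2) * ‖x‖ ^ 2 := by
  rw [EuclideanSpace.real_norm_sq_eq, EuclideanSpace.real_norm_sq_eq, Fin.sum_univ_four,
    Fin.sum_univ_four, rot_apply0, rot_apply1, rot_apply2, rot_apply3]
  ring

/-- Rotations with `c² + s² = 1` are isometries. -/
theorem norm_rot {c s : ℝ} (h : c ^ 2 + s ^ 2 = 1) (x : E4) : ‖rot c s x‖ = ‖x‖ := by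
  have h2 := norm_rot_sq c s x
  rw [h, one_mul] at h2
  exact (pow_left_inj₀ (norm_nonneg _) (norm_nonneg _) two_ne_zero).1 h2

/-- `R_{c,-s} ∘ R_{c,s} = id` when `c² + s² = 1`. -/
theorem rot_neg_rot {c s : ℝ} (h : c ^ 2 + s ^ 2 = 1) (x : E4) : rot c (-s) (rot c s x) = x := by
  ext i
  fin_cases i <;> simp <;> linear_combination (x _) * h

/-- The angle functions `cos φ(‖x‖²)`, `sin φ(‖x‖²)` of a radial profile `φ`. -/
def cφ (φ : ℝ → ℝ) (x : E4) : ℝ := Real.cos (φ (‖x‖ ^ 2))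
/-- See `cφ`. -/
def sφ (φ : ℝ → ℝ) (x : E4) : ℝ := Real.sin (φ (‖x‖ ^ 2))

/-- `cos² + sin² = 1`. -/
theorem cφ_sq_add_sφ_sq (φ : ℝ → ℝ) (x : E4) : cφ φ x ^ 2 + sφ φ x ^ 2 = 1 := Real.cos_sq_add_sin_sq _

/-- The RADIAL TWIST `T_φ(x) = e^{iφ(‖x‖²)} x` of `ℂ² = ℝ⁴` by the radius-dependent angle `φ(‖x‖²)`. -/
def twist (φ : ℝ → ℝ) (x : E4) : E4 := rot (cφ φ x) (sφ φ x) x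

/-- Twists preserve the norm. -/
theorem norm_twist (φ : ℝ → ℝ) (x : E4) : ‖twist φ x‖ = ‖x‖ := norm_rot (cφ_sq_add_sφ_sq φ x) x

/-- The twist by `-φ` inverts the twist by `φ` (left). -/
theorem twist_neg_twist (φ : ℝ → ℝ) (x : E4) : twist (fun t => -φ t) (twist φ x) = x := by
  have hc : cφ (fun t => -φ t) (twist φ x) = cφ φ x := by simp only [cφ, norm_twist, Real.cos_neg]
  have hs : sφ (fun t => -φ t) (twist φ x) = -sφ φ x := by simp only [sφ, norm_twist, Real.sin_neg]
  rw [twist, hc, hs, twist, rot_neg_rot (cφ_sq_add_sφ_sq φ x)]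

/-- The twist by `-φ` inverts the twist by `φ` (right). -/
theorem twist_twist_neg (φ : ℝ → ℝ) (x : E4) : twist φ (twist (fun t => -φ t) x) = x := by
  have := twist_neg_twist (fun t => -φ t) x
  simpa using this

/-- A twist is `C^∞` wherever its angle `x ↦ φ(‖x‖²)` is. -/
theorem contDiffOn_twist {φ : ℝ → ℝ} {V : Set E4} (hφ : ContDiffOn ℝ ∞ (fun x : E4 => φ (‖x‖ ^ 2)) V) :
    ContDiffOn ℝ ∞ (twist φ) V := by
  have hc : ContDiffOn ℝ ∞ (cφ φ) V := Real.contDiff_cos.comp_contDiffOn hφ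
  have hs : ContDiffOn ℝ ∞ (sφ φ) V := Real.contDiff_sin.comp_contDiffOn hφ
  have h := fun i => (contDiff_coord i).contDiffOn (s := V)
  rw [contDiffOn_euclidean]
  intro i
  fin_cases i
  · simpa [twist] using (hc.mul (h 0)).sub (hs.mul (h 1))
  · simpa [twist] using (hc.mul (h 1)).add (hs.mul (h 0))
  · simpa [twist] using (hc.mul (h 2)).sub (hs.mul (h 3))
  · simpa [twist] using (hc.mul (h 3)).add (hs.mul (h 2))

/-- **The derivative of a twist**, coordinatewise: at a point `x` of an open set on which the angle is
`C^∞`, with `c = cos φ(‖x‖²)`, `s = sin φ(‖x‖²)`, `κ = φ'(‖x‖²)·2⟪x, v⟫`,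
`dT_φ(x) v = c v + s Jv + κ (-s x + c Jx)`. -/
theorem fderiv_twist_apply {φ : ℝ → ℝ} {V : Set E4} (hV : IsOpen V)
    (hφ : ContDiffOn ℝ ∞ (fun x : E4 => φ (‖x‖ ^ 2)) V) {x : E4} (hx : x ∈ V) {φ' : ℝ}
    (hφ' : HasDerivAt φ φ' (‖x‖ ^ 2)) (v : E4) :
    let κ : ℝ := φ' * (2 * ⟪x, v⟫)
    fderiv ℝ (twist φ) x v 0 = cφ φ x * v 0 - sφ φ x * v 1 + κ * (-sφ φ x * x 0 - cφ φ x * x 1) ∧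
    fderiv ℝ (twist φ) x v 1 = cφ φ x * v 1 + sφ φ x * v 0 + κ * (-sφ φ x * x 1 + cφ φ x * x 0) ∧
    fderiv ℝ (twist φ) x v 2 = cφ φ x * v 2 - sφ φ x * v 3 + κ * (-sφ φ x * x 2 - cφ φ x * x 3) ∧
    fderiv ℝ (twist φ) x v 3 = cφ φ x * v 3 + sφ φ x * v 2 + κ * (-sφ φ x * x 3 + cφ φ x * x 2) := by
  intro κ
  have hdiff : DifferentiableAt ℝ (twist φ) x :=
    ((contDiffOn_twist hφ).differentiableOn (by simp)).differentiableAt (hV.mem_nhds hx)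
  have hD : ∀ i, HasFDerivAt (fun y => twist φ y i) (pr i ∘L fderiv ℝ (twist φ) x) x := fun i =>
    (hasFDerivWithinAt_euclidean.1 hdiff.hasFDerivAt.hasFDerivWithinAt i).hasFDerivAt_of_univ
  -- derivative of the angle
  set N : E4 →L[ℝ] ℝ := 2 • innerSL ℝ x with hN
  have hn2 : HasFDerivAt (fun y : E4 => ‖y‖ ^ 2) N x := (hasStrictFDerivAt_norm_sq x).hasFDerivAt
  have hφn := hφ'.comp_hasFDerivAt x hn2
  set C : E4 →L[ℝ] ℝ := (-Real.sin (φ (‖x‖ ^ 2))) • (φ' • N) with hC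
  set S : E4 →L[ℝ] ℝ := (Real.cos (φ (‖x‖ ^ 2))) • (φ' • N) with hS
  have hc : HasFDerivAt (cφ φ) C x := (Real.hasDerivAt_cos _).comp_hasFDerivAt x hφn
  have hs : HasFDerivAt (sφ φ) S x := (Real.hasDerivAt_sin _).comp_hasFDerivAt x hφn
  have hNv : N v = 2 * ⟪x, v⟫ := by simp [hN]
  have hCv : C v = -sφ φ x * (φ' * (2 * ⟪x, v⟫)) := by
    simp only [hC, FunLike.coe_smul, Pi.smul_apply, hNv, smul_eq_mul, sφ]
  have hSv : S v = cφ φ x * (φ' * (2 * ⟪x, v⟫)) := by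
    simp only [hS, FunLike.coe_smul, Pi.smul_apply, hNv, smul_eq_mul, cφ]
  -- the four coordinates
  have h0 : HasFDerivAt (fun y => twist φ y 0) (cφ φ x • pr 0 + x 0 • C - (sφ φ x • pr 1 + x 1 • S)) x := by
    simpa [Pi.mul_def, Pi.sub_def, Pi.add_def, twist] using
      (hc.mul (hasFDerivAt_coord 0 x)).sub (hs.mul (hasFDerivAt_coord 1 x))
  have h1 : HasFDerivAt (fun y => twist φ y 1) (cφ φ x • pr 1 + x 1 • C + (sφ φ x • pr 0 + x 0 • S)) x := by
    simpa [Pi.mul_def, Pi.sub_def, Pi.add_def, twist] using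
      (hc.mul (hasFDerivAt_coord 1 x)).add (hs.mul (hasFDerivAt_coord 0 x))
  have h2 : HasFDerivAt (fun y => twist φ y 2) (cφ φ x • pr 2 + x 2 • C - (sφ φ x • pr 3 + x 3 • S)) x := by
    simpa [Pi.mul_def, Pi.sub_def, Pi.add_def, twist] using
      (hc.mul (hasFDerivAt_coord 2 x)).sub (hs.mul (hasFDerivAt_coord 3 x))
  have h3 : HasFDerivAt (fun y => twist φ y 3) (cφ φ x • pr 3 + x 3 • C + (sφ φ x • pr 2 + x 2 • S)) x := by
    simpa [Pi.mul_def, Pi.sub_def, Pi.add_def, twist] using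
      (hc.mul (hasFDerivAt_coord 3 x)).add (hs.mul (hasFDerivAt_coord 2 x))
  have c0 := congrArg (fun L : E4 →L[ℝ] ℝ => L v) ((hD 0).unique h0)
  have c1 := congrArg (fun L : E4 →L[ℝ] ℝ => L v) ((hD 1).unique h1)
  have c2 := congrArg (fun L : E4 →L[ℝ] ℝ => L v) ((hD 2).unique h2)
  have c3 := congrArg (fun L : E4 →L[ℝ] ℝ => L v) ((hD 3).unique h3)
  simp only [ContinuousLinearMap.comp_apply, FunLike.coe_add, FunLike.coe_sub,
    FunLike.coe_smul, Pi.add_apply, Pi.sub_apply, Pi.smul_apply, smul_eq_mul, hCv, hSv]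
    at c0 c1 c2 c3
  refine ⟨?_, ?_, ?_, ?_⟩
  · rw [show fderiv ℝ (twist φ) x v 0 = (pr 0) (fderiv ℝ (twist φ) x v) from rfl, c0]
    simp only [κ]; simp; ring
  · rw [show fderiv ℝ (twist φ) x v 1 = (pr 1) (fderiv ℝ (twist φ) x v) from rfl, c1]
    simp only [κ]; simp; ring
  · rw [show fderiv ℝ (twist φ) x v 2 = (pr 2) (fderiv ℝ (twist φ) x v) from rfl, c2]
    simp only [κ]; simp; ring
  · rw [show fderiv ℝ (twist φ) x v 3 = (pr 3) (fderiv ℝ (twist φ) x v) from rfl, c3]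
    simp only [κ]; simp; ring

/-- **Radial twists are symplectic**: `ω₀(dT v, dT w) = ω₀(v, w)` (the twist is the time-one map of the
Hamiltonian `H = F(‖x‖²/2)`, `F' = φ`; here checked by the coordinate formula: the `κ`-terms cancel
identically and the rotation part contributes `cos² + sin² = 1`). -/
theorem std_fderiv_twist {φ : ℝ → ℝ} {V : Set E4} (hV : IsOpen V)
    (hφ : ContDiffOn ℝ ∞ (fun x : E4 => φ (‖x‖ ^ 2)) V) {x : E4} (hx : x ∈ V) {φ' : ℝ}
    (hφ' : HasDerivAt φ φ' (‖x‖ ^ 2)) (v w : E4) :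
    stdSymplecticForm (fderiv ℝ (twist φ) x v) (fderiv ℝ (twist φ) x w) = stdSymplecticForm v w := by
  obtain ⟨a0, a1, a2, a3⟩ := fderiv_twist_apply hV hφ hx hφ' v
  obtain ⟨b0, b1, b2, b3⟩ := fderiv_twist_apply hV hφ hx hφ' w
  have h := cφ_sq_add_sφ_sq φ x
  have hin : ∀ u : E4, ⟪x, u⟫ = x 0 * u 0 + x 1 * u 1 + x 2 * u 2 + x 3 * u 3 := fun u => by
    simp [PiLp.inner_apply, Fin.sum_univ_four, mul_comm]
  simp only [stdSymplecticForm, a0, a1, a2, a3, b0, b1, b2, b3, hin]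
  linear_combination (v 0 * w 1 - v 1 * w 0 + v 2 * w 3 - v 3 * w 2) * h

/-! ### The model: the singular twist `ψ = T_θ`, `θ(t) = (t-1)⁻¹`, on the end `{1 < ‖x‖}` -/

/-- The twisting profile `θ(t) = (t - 1)⁻¹`, blowing up at `t = 1` (i.e. at the sphere `‖x‖ = 1`). -/
def θ (t : ℝ) : ℝ := (t - 1)⁻¹

/-- The end `U = {1 < ‖x‖} = B̄(0,1)ᶜ`. -/
def U : Set E4 := (Metric.closedBall (0 : E4) 1)ᶜ

/-- Membership in `U`. -/
theorem mem_U {x : E4} : x ∈ U ↔ 1 < ‖x‖ := by simp [U, Metric.mem_closedBall, dist_zero_right]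

/-- `U` is open. -/
theorem isOpen_U : IsOpen U := Metric.isClosed_closedBall.isOpen_compl

/-- `‖x‖² - 1 ≠ 0` on `U`. -/
theorem normSq_sub_one_ne {x : E4} (hx : x ∈ U) : ‖x‖ ^ 2 - 1 ≠ 0 := by
  have h := mem_U.1 hx
  nlinarith

/-- The angle `θ(‖x‖²)` is `C^∞` on `U`. -/
theorem contDiffOn_θ : ContDiffOn ℝ ∞ (fun x : E4 => θ (‖x‖ ^ 2)) U :=
  (((contDiff_norm_sq ℝ).sub contDiff_const).contDiffOn).inv fun _ hx => normSq_sub_one_ne hx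

/-- … and so is `-θ(‖x‖²)`. -/
theorem contDiffOn_neg_θ : ContDiffOn ℝ ∞ (fun x : E4 => -θ (‖x‖ ^ 2)) U := contDiffOn_θ.neg

/-- `θ' = -(t-1)⁻²` on `U`. -/
theorem hasDerivAt_θ {x : E4} (hx : x ∈ U) : HasDerivAt θ (-((‖x‖ ^ 2 - 1) ^ 2)⁻¹) (‖x‖ ^ 2) := by
  show HasDerivAt (fun t : ℝ => (t - 1)⁻¹) _ (‖x‖ ^ 2)
  refine ((hasDerivAt_inv (normSq_sub_one_ne hx)).comp (‖x‖ ^ 2)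
    ((hasDerivAt_id (‖x‖ ^ 2)).sub_const 1)).congr_deriv ?_
  ring

/-- THE END MAP of the model: the singular twist `ψ = T_θ`. -/
def ψ : E4 → E4 := twist θ

/-- Its inverse `χ = T_{-θ}`. -/
def χ : E4 → E4 := twist fun t => -θ t

/-- `ψ` is a bijection of the end onto itself. -/
theorem bijOn_ψ : Set.BijOn ψ U U :=
  Set.InvOn.bijOn ⟨fun x _ => twist_neg_twist θ x, fun y _ => twist_twist_neg θ y⟩
    (fun x hx => mem_U.2 (by rw [ψ, norm_twist]; exact mem_U.1 hx))
    (fun y hy => mem_U.2 (by rw [norm_twist]; exact mem_U.1 hy))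

/-- `ψ` is symplectic on the end: `ω₀ = ψ*ω₀` there (the pull-back clause H10 of the crux). -/
theorem pullback_ψ (x : E4) (hx : x ∈ U) (v w : TangentSpace (𝓡 4) x) :
    stdSymplecticMForm x ![v, w] =
      stdSymplecticForm (mfderiv (𝓡 4) 𝓘(ℝ, E4) ψ x v) (mfderiv (𝓡 4) 𝓘(ℝ, E4) ψ x w) := by
  have h : mfderiv (𝓡 4) 𝓘(ℝ, E4) ψ x = fderiv ℝ ψ x := mfderiv_eq_fderiv
  rw [stdSymplecticMForm_apply, h]
  exact (std_fderiv_twist isOpen_U contDiffOn_θ hx (hasDerivAt_θ hx) v w).symm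

/-! ### A smooth global twist agreeing with `ψ` off `B̄(0, 2)` -/

/-- A smooth profile `φ = cutoff · θ`: `= 0` on `(-∞, 2]`, `= θ` on `[3, ∞)`. -/
def φ (t : ℝ) : ℝ := Real.smoothTransition (t - 2) * θ t

/-- `φ = θ` on `[3, ∞)`. -/
theorem φ_eq_θ {t : ℝ} (ht : 3 ≤ t) : φ t = θ t := by
  rw [φ, Real.smoothTransition.one_of_one_le (by linarith), one_mul]

/-- `φ = 0` on `(-∞, 2]`. -/
theorem φ_eq_zero {t : ℝ} (ht : t ≤ 2) : φ t = 0 := by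
  rw [φ, Real.smoothTransition.zero_of_nonpos (by linarith), zero_mul]

/-- `φ` is `C^∞` (it vanishes near the singularity `t = 1` of `θ`). -/
theorem contDiff_φ : ContDiff ℝ ∞ φ := by
  rw [contDiff_iff_contDiffAt]
  intro t
  by_cases ht : t < 2
  · have hev : φ =ᶠ[𝓝 t] fun _ => 0 := by
      filter_upwards [(isOpen_gt' (2 : ℝ)).mem_nhds ht] with u hu using φ_eq_zero (le_of_lt hu)
    exact (contDiffAt_const (c := (0 : ℝ))).congr_of_eventuallyEq hev
  · have ht1 : 1 < t := by linarith
    have hθt : ContDiffAt ℝ ∞ θ t := by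
      have h : ContDiffAt ℝ ∞ (fun u : ℝ => (u - 1)⁻¹) t :=
        (contDiffAt_id.sub contDiffAt_const).inv (by simp only [id]; linarith)
      exact h
    exact ((Real.smoothTransition.contDiff (n := ⊤)).contDiffAt.comp t
      (contDiffAt_id.sub contDiffAt_const)).mul hθt

/-- The angle `φ(‖x‖²)` is `C^∞` on all of `ℝ⁴`. -/
theorem contDiffOn_φ_univ : ContDiffOn ℝ ∞ (fun x : E4 => φ (‖x‖ ^ 2)) univ :=
  (contDiff_φ.comp (contDiff_norm_sq ℝ)).contDiffOn

/-- The twist by a negated profile is `C^∞` where the profile is. -/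
theorem contDiffOn_neg_φ_univ : ContDiffOn ℝ ∞ (fun x : E4 => -φ (‖x‖ ^ 2)) univ :=
  contDiffOn_φ_univ.neg

/-- THE GLOBAL SYMPLECTOMORPHISM `Φ = T_φ` of `ℝ⁴` (inverse `T_{-φ}`). -/
def Φ : E4 ≃ₘ⟮𝓡 4, 𝓡 4⟯ E4 where
  toFun := twist φ
  invFun := twist fun t => -φ t
  left_inv := twist_neg_twist φ
  right_inv := twist_twist_neg φ
  contMDiff_toFun := (contDiffOn_univ.1 (contDiffOn_twist contDiffOn_φ_univ)).contMDiff
  contMDiff_invFun := (contDiffOn_univ.1 (contDiffOn_twist contDiffOn_neg_φ_univ)).contMDiff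

/-- `Φ = ψ` off `B̄(0, √3)`, in particular off `B̄(0, 2)`. -/
theorem Φ_eq_ψ {x : E4} (hx : 2 < ‖x‖) : Φ x = ψ x := by
  have h3 : 3 ≤ ‖x‖ ^ 2 := by nlinarith
  show twist φ x = twist θ x
  simp only [twist, cφ, sφ, φ_eq_θ h3]

/-- `Φ` is a symplectomorphism of `(ℝ⁴, ω₀)`: `ω₀ = Φ*ω₀` everywhere. -/
theorem pullback_Φ (x : E4) (v w : TangentSpace (𝓡 4) x) :
    stdSymplecticMForm x ![v, w] =
      stdSymplecticForm (mfderiv (𝓡 4) 𝓘(ℝ, E4) Φ x v) (mfderiv (𝓡 4) 𝓘(ℝ, E4) Φ x w) := by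
  have h : mfderiv (𝓡 4) 𝓘(ℝ, E4) Φ x = fderiv ℝ (twist φ) x := mfderiv_eq_fderiv
  rw [stdSymplecticMForm_apply, h]
  have hφ' : HasDerivAt φ (deriv φ (‖x‖ ^ 2)) (‖x‖ ^ 2) :=
    ((contDiff_φ.differentiable (by simp)).differentiableAt).hasDerivAt
  exact (std_fderiv_twist isOpen_univ contDiffOn_φ_univ (mem_univ x) hφ' v w).symm

/-! ### `ψ` does not extend continuously to the sphere `‖x‖ = 1` -/

/-- `e₀`. -/
abbrev e0 : E4 := EuclideanSpace.single 0 1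

/-- The radial test points `q(T) = √(1 + T⁻¹) e₀`, `T > 0`: they lie in the end, with `θ(‖q(T)‖²) = T`. -/
def q (T : ℝ) : E4 := Real.sqrt (1 + T⁻¹) • e0

/-- `‖q(T)‖² = 1 + T⁻¹`. -/
theorem norm_q_sq {T : ℝ} (hT : 0 < T) : ‖q T‖ ^ 2 = 1 + T⁻¹ := by
  rw [q, norm_smul, Real.norm_eq_abs, abs_of_nonneg (Real.sqrt_nonneg _)]
  simp [e0, Real.sq_sqrt (by positivity : (0 : ℝ) ≤ 1 + T⁻¹)]

/-- `θ(‖q(T)‖²) = T`. -/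
theorem θ_q {T : ℝ} (hT : 0 < T) : θ (‖q T‖ ^ 2) = T := by
  rw [norm_q_sq hT, θ]; simp

/-- `ψ(q(T)) = (cos T) q(T)` … more precisely `rot (cos T) (sin T)` of the radial point. -/
theorem ψ_q {T : ℝ} (hT : 0 < T) : ψ (q T) = rot (Real.cos T) (Real.sin T) (q T) := by
  rw [ψ, twist, cφ, sφ, θ_q hT]

/-- A rotation of a radial point `r e₀` by angle with `sin = 0`, `cos = c` is `c r e₀`. -/
theorem rot_q (c : ℝ) (T : ℝ) : rot c 0 (q T) = c • q T := by
  ext i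
  fin_cases i <;> simp [q, e0]

/-- `ψ = id` at the points `q(n·2π)`. -/
theorem ψ_q_even (n : ℕ) : ψ (q ((n + 1 : ℕ) * (2 * π))) = q ((n + 1 : ℕ) * (2 * π)) := by
  have hT : 0 < ((n + 1 : ℕ) : ℝ) * (2 * π) := by positivity
  rw [ψ_q hT, Real.cos_nat_mul_two_pi]
  have hs : Real.sin (((n + 1 : ℕ) : ℝ) * (2 * π)) = 0 := by
    have := Real.sin_nat_mul_pi (2 * (n + 1))
    rw [← this]; congr 1; push_cast; ring
  rw [hs, rot_q, one_smul]

/-- `ψ = -id` at the points `q(n·2π + π)`. -/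
theorem ψ_q_odd (n : ℕ) :
    ψ (q ((n + 1 : ℕ) * (2 * π) + π)) = -q ((n + 1 : ℕ) * (2 * π) + π) := by
  have hT : 0 < ((n + 1 : ℕ) : ℝ) * (2 * π) + π := by positivity
  rw [ψ_q hT, Real.cos_nat_mul_two_pi_add_pi]
  have hs : Real.sin (((n + 1 : ℕ) : ℝ) * (2 * π) + π) = 0 := by
    rw [Real.sin_add_pi]
    have := Real.sin_nat_mul_pi (2 * (n + 1))
    rw [neg_eq_zero, ← this]; congr 1; push_cast; ring
  rw [hs, rot_q, neg_one_smul]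

/-- `q(T) → e₀` as `T → ∞`. -/
theorem tendsto_q : Tendsto q atTop (𝓝 e0) := by
  have h1 : Tendsto (fun T : ℝ => 1 + T⁻¹) atTop (𝓝 (1 + 0)) := tendsto_const_nhds.add tendsto_inv_atTop_zero
  rw [add_zero] at h1
  have h2 : Tendsto (fun T : ℝ => Real.sqrt (1 + T⁻¹)) atTop (𝓝 1) := by
    have := (Real.continuous_sqrt.tendsto 1).comp h1
    rwa [Function.comp_def, Real.sqrt_one] at this
  have h3 := h2.smul_const e0
  rwa [one_smul] at h3

/-- The even and odd angle sequences tend to `∞`. -/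
theorem tendsto_T_even : Tendsto (fun n : ℕ => ((n + 1 : ℕ) : ℝ) * (2 * π)) atTop atTop :=
  (tendsto_natCast_atTop_atTop.comp (tendsto_add_atTop_nat 1)).atTop_mul_const (by positivity)

/-- The odd angle sequence tends to `∞`. -/
theorem tendsto_T_odd : Tendsto (fun n : ℕ => ((n + 1 : ℕ) : ℝ) * (2 * π) + π) atTop atTop :=
  tendsto_atTop_add_const_right _ _ tendsto_T_even

/-- **`ψ` has no continuous extension across the sphere `‖x‖ = 1`**: a continuous `Φ' : ℝ⁴ → ℝ⁴`
agreeing with `ψ` on the end would satisfy `Φ' e₀ = e₀` (along `q(n·2π) → e₀`, where `ψ = id`) and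
`Φ' e₀ = -e₀` (along `q(n·2π + π) → e₀`, where `ψ = -id`). -/
theorem no_continuous_extension {Φ' : E4 → E4} (hΦ' : Continuous Φ') (hagree : ∀ x ∈ U, Φ' x = ψ x) :
    False := by
  have hqU : ∀ {T : ℝ}, 0 < T → q T ∈ U := fun {T} hT => by
    rw [mem_U]
    have h := norm_q_sq hT
    nlinarith [norm_nonneg (q T), inv_pos.2 hT]
  -- along the even sequence `Φ' → e₀`
  have hev : Tendsto (fun n : ℕ => Φ' (q (((n + 1 : ℕ) : ℝ) * (2 * π)))) atTop (𝓝 e0) := by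
    refine (tendsto_q.comp tendsto_T_even).congr fun n => ?_
    rw [Function.comp_apply, hagree _ (hqU (by positivity)), ψ_q_even]
  have h1 : Φ' e0 = e0 :=
    tendsto_nhds_unique ((hΦ'.tendsto e0).comp (tendsto_q.comp tendsto_T_even)) hev
  -- along the odd sequence `Φ' → -e₀`
  have hodd : Tendsto (fun n : ℕ => Φ' (q (((n + 1 : ℕ) : ℝ) * (2 * π) + π))) atTop (𝓝 (-e0)) := by
    refine ((tendsto_q.comp tendsto_T_odd).neg).congr fun n => ?_
    rw [Function.comp_apply, hagree _ (hqU (by positivity)), ψ_q_odd]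
  have h2 : Φ' e0 = -e0 :=
    tendsto_nhds_unique ((hΦ'.tendsto e0).comp (tendsto_q.comp tendsto_T_odd)) hodd
  have h3 : (e0 : E4) = -e0 := h1.symm.trans h2
  have h4 := congrArg (fun z : E4 => z 0) h3
  simp [e0] at h4
  linarith

end TwistEnd

/-- The natural strengthening of the crux: the symplectomorphism extends the given end chart itself
(`Φ = ψ` on `Kᶜ`, no shrinking of the end). -/
def GromovRecognitionRelEndStrong : Prop :=
  ∀ (M : Type) [TopologicalSpace M] [T2Space M] [SecondCountableTopology M]
    [ChartedSpace E4 M] [IsManifold (𝓡 4) ∞ M] [ConnectedSpace M]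
    (sf : MForm (𝓡 4) M ℝ 2) (K : Set M) (R : ℝ) (ψ : M → E4) (χ : E4 → M),
    (∀ x : M, Subsingleton (π_ 2 M x)) → IsSymplectic sf → EndsCoCompact K R ψ →
      IsEndChart K R ψ χ → PullbackClause sf K ψ → StrongConclusion sf K ψ

namespace TwistEnd

/-- **A second model of ALL TEN hypotheses of the crux** (besides the standard model `ψ = id` of
`gromov_recognitionR4_relEnd.stdModel_hypotheses`): `M = ℝ⁴`, `sf = ω₀`, `K = B̄(0, 1)`, `R = 1`, and the
singular twist `ψ = T_θ`, `χ = T_{-θ}` — a genuinely non-trivial end symplectomorphism. -/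
theorem hypotheses :
    (∀ x : E4, Subsingleton (π_ 2 E4 x)) ∧ IsSymplectic stdSymplecticMForm ∧
      EndsCoCompact (Metric.closedBall (0 : E4) 1) 1 ψ ∧
        IsEndChart (Metric.closedBall (0 : E4) 1) 1 ψ χ ∧
          PullbackClause stdSymplecticMForm (Metric.closedBall (0 : E4) 1) ψ := by
  refine ⟨subsingleton_pi_two_euclideanSpace,
    ⟨isSmoothForm_stdSymplecticMForm, isClosedForm_stdSymplecticMForm, stdSymplecticMForm_nondegenerate⟩,
    ?_, ⟨?_, ?_, bijOn_ψ, fun x _ => twist_neg_twist θ x⟩, fun x hx v w => pullback_ψ x hx v w⟩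
  · intro R' _
    have h : {x : E4 | ‖ψ x‖ ≤ R'} = Metric.closedBall (0 : E4) R' := by
      ext x; simp [Metric.mem_closedBall, dist_zero_right, ψ, norm_twist]
    rw [h]
    exact (isCompact_closedBall _ _).union (isCompact_closedBall _ _)
  · exact (contDiffOn_twist contDiffOn_θ).contMDiffOn
  · exact (contDiffOn_twist contDiffOn_neg_θ).contMDiffOn

/-- **The crux's conclusion HOLDS in this model** (consistency): `Φ = T_φ` is a symplectomorphism of
`(ℝ⁴, ω₀)` equal to `ψ` off the compact `B̄(0, 2)` — the cut-off is done on the smooth profile, exactly the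
cut-off-Hamiltonian step of the printed proof of the relative clause. -/
theorem conclusion : Conclusion stdSymplecticMForm ψ := by
  refine ⟨Φ, pullback_Φ, Metric.closedBall (0 : E4) 2, isCompact_closedBall _ _, fun x hx => ?_⟩
  exact Φ_eq_ψ (by simpa [Metric.mem_closedBall, dist_zero_right] using hx)

/-- … but **the strengthened conclusion FAILS** there: no diffeomorphism (indeed no continuous map) of
`ℝ⁴` agrees with `ψ` on the whole end `{1 < ‖x‖}`. -/
theorem not_strongConclusion : ¬ StrongConclusion stdSymplecticMForm (Metric.closedBall (0 : E4) 1) ψ := by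
  rintro ⟨Φ', -, hagree⟩
  exact no_continuous_extension Φ'.continuous fun x hx => hagree x hx

end TwistEnd

/-- **Refuted natural strengthening**: "`Φ = ψ` on all of `Kᶜ`" (`K' = K`) does NOT follow from the
hypotheses of the crux — the shrinking `∃ K'` in the conclusion is necessary. (In the model the crux
itself holds with `K' = B̄(0, 2)`, or any `B̄(0, 1 + ε)`, never with `K' = K = B̄(0, 1)`.) -/
theorem not_gromovRecognitionRelEndStrong : ¬ GromovRecognitionRelEndStrong := by
  intro h
  obtain ⟨h1, h234, h5, h6789, h10⟩ := TwistEnd.hypotheses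
  exact TwistEnd.not_strongConclusion (h E4 stdSymplecticMForm (Metric.closedBall (0 : E4) 1) 1
    TwistEnd.ψ TwistEnd.χ h1 h234 h5 h6789 h10)


/-! ## 8. Redundant hypotheses: the inverse chart `χ` (H7, H9) is decoration

By the inverse function theorem, H4 + H6 + H8 + H10 (with `Kᶜ` open, which H5 + H8 give) already make
`ψ|Kᶜ` a diffeomorphism onto the end: `χ := invFunOn ψ Kᶜ` is `C^∞` on `{R < ‖z‖}` and inverts `ψ`
(`contMDiffOn_invFunOn`). Hence the crux is EQUIVALENT to its `χ`-free form (`crux_iff_noChi`): provers may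
ignore `χ`, H7 and H9; planners may drop them from the statement. -/

section NoChi

variable {M : Type} [TopologicalSpace M] [ChartedSpace E4 M] [IsManifold (𝓡 4) ∞ M]

/-- **The inverse of the end chart is automatically smooth** (inverse function theorem): if `ψ` is `C^∞`
on the open set `Kᶜ`, bijective from `Kᶜ` onto `T`, with injective differential on `Kᶜ`, then
`χ = invFunOn ψ Kᶜ` is `C^∞` on `T` (as a map into the manifold `M`) and inverts `ψ` on `Kᶜ`. -/
theorem contMDiffOn_invFunOn [Nonempty M] {ψ : M → E4} {K : Set M} {T : Set E4} (hK : IsOpen Kᶜ)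
    (h6 : ContMDiffOn (𝓡 4) 𝓘(ℝ, E4) ∞ ψ Kᶜ) (h8 : Set.BijOn ψ Kᶜ T)
    (hinj : ∀ x ∈ Kᶜ, Function.Injective (mfderiv (𝓡 4) 𝓘(ℝ, E4) ψ x)) :
    ContMDiffOn 𝓘(ℝ, E4) (𝓡 4) ∞ (Function.invFunOn ψ Kᶜ) T ∧
      ∀ x, x ∈ Kᶜ → Function.invFunOn ψ Kᶜ (ψ x) = x := by
  set χ : E4 → M := Function.invFunOn ψ Kᶜ with hχ
  have hleft : ∀ x, x ∈ Kᶜ → χ (ψ x) = x := fun x hx => h8.invOn_invFunOn.1 hx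
  have hright : ∀ y, y ∈ T → ψ (χ y) = y := fun y hy => h8.invOn_invFunOn.2 hy
  have hχK : Set.MapsTo χ T Kᶜ := h8.surjOn.mapsTo_invFunOn
  refine ⟨fun b hb => ?_, hleft⟩
  -- the point `a = χ b ∈ Kᶜ`, `ψ a = b`, and the chart `e` at `a`
  set a : M := χ b with ha_def
  have ha : a ∈ Kᶜ := hχK hb
  have hψa : ψ a = b := hright b hb
  set e := extChartAt (𝓡 4) a with he
  have hea : e.symm (e a) = a := extChartAt_to_inv (I := 𝓡 4) a
  -- `f = ψ ∘ e⁻¹` is `C^∞` at `e a`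
  set f : E4 → E4 := ψ ∘ e.symm with hf_def
  have hψ_at : ContMDiffAt (𝓡 4) 𝓘(ℝ, E4) ∞ ψ a := (h6 a ha).contMDiffAt (hK.mem_nhds ha)
  have hsymm : ContMDiffAt 𝓘(ℝ, E4) (𝓡 4) ∞ e.symm (e a) :=
    (contMDiffOn_extChartAt_symm (I := 𝓡 4) (n := ∞) a (e a) (mem_extChartAt_target (I := 𝓡 4) a)).contMDiffAt
      (extChartAt_target_mem_nhds (I := 𝓡 4) a)
  have hfm : ContMDiffAt 𝓘(ℝ, E4) 𝓘(ℝ, E4) ∞ f (e a) :=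
    ContMDiffAt.comp (I' := 𝓡 4) (e a) (by rw [hea]; exact hψ_at) hsymm
  have hfC : ContDiffAt ℝ ∞ f (e a) := contMDiffAt_iff_contDiffAt.1 hfm
  -- its derivative is injective, hence invertible
  have hψd : MDifferentiableAt (𝓡 4) 𝓘(ℝ, E4) ψ a := hψ_at.mdifferentiableAt (by simp)
  have hsd : MDifferentiableAt 𝓘(ℝ, E4) (𝓡 4) e.symm (e a) := hsymm.mdifferentiableAt (by simp)
  have hDf : fderiv ℝ f (e a) = (mfderiv (𝓡 4) 𝓘(ℝ, E4) ψ (e.symm (e a))).comp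
      (mfderiv 𝓘(ℝ, E4) (𝓡 4) e.symm (e a)) := by
    rw [← mfderiv_eq_fderiv, hf_def]
    exact mfderiv_comp_of_eq hψd hsd hea
  have ha' : e.symm (e a) ∈ Kᶜ := by rw [hea]; exact ha
  have hsymm_inv : (mfderiv 𝓘(ℝ, E4) (𝓡 4) e.symm (e a)).IsInvertible := by
    have := isInvertible_mfderivWithin_extChartAt_symm (I := 𝓡 4) (x := a)
      (mem_extChartAt_target (I := 𝓡 4) a)
    rwa [ModelWithCorners.Boundaryless.range_eq_univ, mfderivWithin_univ] at this
  have hsymm_inj : Function.Injective (mfderiv 𝓘(ℝ, E4) (𝓡 4) e.symm (e a)) := by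
    obtain ⟨L, hL⟩ := hsymm_inv
    rw [← hL]
    exact L.injective
  have hDinj : Function.Injective (fderiv ℝ f (e a)) := by
    rw [hDf]
    intro v w hvw
    exact hsymm_inj (hinj _ ha' hvw)
  have hDsurj : Function.Surjective (fderiv ℝ f (e a)) :=
    (LinearMap.injective_iff_surjective (f := (fderiv ℝ f (e a) : E4 →ₗ[ℝ] E4))).1 hDinj
  set L : E4 ≃L[ℝ] E4 :=
    (LinearEquiv.ofBijective (fderiv ℝ f (e a) : E4 →ₗ[ℝ] E4) ⟨hDinj, hDsurj⟩).toContinuousLinearEquiv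
    with hL_def
  have hLcoe : (L : E4 →L[ℝ] E4) = fderiv ℝ f (e a) := by ext v; rfl
  have hf' : HasFDerivAt f (L : E4 →L[ℝ] E4) (e a) := by
    rw [hLcoe]; exact (hfC.differentiableAt (by simp)).hasFDerivAt
  have hn : (∞ : WithTop ℕ∞) ≠ 0 := by simp
  -- the local inverse of the inverse function theorem is `e ∘ χ` near `b`
  have hfea : f (e a) = b := by simp [hf_def, hea, hψa]
  have hG : ∀ᶠ z in 𝓝 (e a), (e ∘ χ) (f z) = z := by
    have h1 : ∀ᶠ z in 𝓝 (e a), z ∈ e.target := extChartAt_target_mem_nhds (I := 𝓡 4) a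
    have h2 : ∀ᶠ z in 𝓝 (e a), e.symm z ∈ Kᶜ :=
      (continuousAt_extChartAt_symm (I := 𝓡 4) a).preimage_mem_nhds (by rw [hea]; exact hK.mem_nhds ha)
    filter_upwards [h1, h2] with z hz1 hz2
    simp only [Function.comp_apply, hf_def, hleft _ hz2, e.right_inv hz1]
  have hstrict := hfC.hasStrictFDerivAt' hf' hn
  have huniq : ∀ᶠ y in 𝓝 b, (e ∘ χ) y = hfC.localInverse hf' hn y := by
    have := hstrict.localInverse_unique hG
    rwa [hfea] at this
  have hGC : ContDiffAt ℝ ∞ (e ∘ χ) b := by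
    have h := hfC.to_localInverse hf' hn
    rw [hfea] at h
    exact h.congr_of_eventuallyEq huniq
  -- continuity of `χ` at `b` (open mapping)
  have hcont : ContinuousAt χ b := by
    rw [ContinuousAt, ← ha_def]
    intro W hW
    have hW' : W ∩ Kᶜ ∩ e.source ∈ 𝓝 a :=
      inter_mem (inter_mem hW (hK.mem_nhds ha)) (extChartAt_source_mem_nhds (I := 𝓡 4) a)
    have himg : e '' (W ∩ Kᶜ ∩ e.source) ∈ 𝓝 (e a) :=
      extChartAt_image_nhds_mem_nhds_of_boundaryless hW'
    have hmap : f '' (e '' (W ∩ Kᶜ ∩ e.source)) ∈ 𝓝 b := by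
      rw [← hfea, ← hstrict.map_nhds_eq_of_equiv]
      exact image_mem_map himg
    refine Filter.mem_map.2 (mem_of_superset hmap ?_)
    rintro _ ⟨_, ⟨w, ⟨⟨hwW, hwK⟩, hws⟩, rfl⟩, rfl⟩
    show χ (ψ (e.symm (e w))) ∈ W
    rw [e.left_inv hws, hleft w hwK]
    exact hwW
  -- conclusion
  have hχb : ContMDiffAt 𝓘(ℝ, E4) (𝓡 4) ∞ χ b := by
    rw [contMDiffAt_iff_target]
    exact ⟨hcont, contMDiffAt_iff_contDiffAt.2 hGC⟩
  exact hχb.contMDiffWithinAt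

end NoChi

/-- The crux WITHOUT the inverse chart: `χ`, H7 and H9 deleted. -/
def GromovRecognitionRelEndNoChi : Prop :=
  ∀ (M : Type) [TopologicalSpace M] [T2Space M] [SecondCountableTopology M]
    [ChartedSpace E4 M] [IsManifold (𝓡 4) ∞ M] [ConnectedSpace M]
    (sf : MForm (𝓡 4) M ℝ 2) (K : Set M) (R : ℝ) (ψ : M → E4),
    (∀ x : M, Subsingleton (π_ 2 M x)) → IsSymplectic sf → EndsCoCompact K R ψ →
      ContMDiffOn (𝓡 4) 𝓘(ℝ, E4) ∞ ψ Kᶜ → Set.BijOn ψ Kᶜ (Metric.closedBall (0 : E4) R)ᶜ →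
        PullbackClause sf K ψ → Conclusion sf ψ

/-- **The crux is equivalent to its `χ`-free form**: the hypotheses on the inverse chart (H7: `χ` is
`C^∞` on the end; H9: `χ ∘ ψ = id` on `Kᶜ`) follow from the others by the inverse function theorem. -/
theorem crux_iff_noChi :
    Summit.SmoothPoincare4.SmoothPoincare4.Theses.SymplecticOrigami.GromovRecognitionRelEnd ↔
      GromovRecognitionRelEndNoChi := by
  rw [crux_iff]
  constructor
  · intro h M _ _ _ _ _ _ sf K R ψ h1 h234 h5 h6 h8 h10
    have hK : IsOpen Kᶜ := (isClosed_of_endsCoCompact h5 h8.mapsTo).isOpen_compl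
    obtain ⟨h7, h9⟩ := contMDiffOn_invFunOn hK h6 h8
      (fun x hx => mfderiv_injective_of_pullbackClause h234.2.2 h10 hx)
    exact h M sf K R ψ (Function.invFunOn ψ Kᶜ) h1 h234 h5 ⟨h6, h7, h8, h9⟩ h10
  · intro h M _ _ _ _ _ _ sf K R ψ χ h1 h234 h5 h6789 h10
    exact h M sf K R ψ h1 h234 h5 h6789.1 h6789.2.2.1 h10


/-! ## 8b. Load-bearing (in the `χ`-free form): the smoothness of the end chart

With `χ` gone (§8), the `C^∞` hypothesis H6 on `ψ` is the only regularity input on the end chart, and it is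
used: the `C¹` symplectic shear `S(x) = (x₀, x₁ + x₀|x₀|, x₂, x₃)` of `(ℝ⁴, ω₀)` is a homeomorphism,
differentiable everywhere with `ω₀(dS v, dS w) = ω₀(v, w)`, so `(ℝ⁴, ω₀, K = S⁻¹(B̄(0,1)), R = 1, ψ = S)`
satisfies everything but H6, while no `C^∞` map can agree with `S` near the far points of the hyperplane
`{x₀ = 0}` (`S` is not `C²` there). -/

/-- The `χ`-free crux with the SMOOTHNESS of the end chart `ψ` (H6) deleted. -/
def GromovRecognitionRelEndNoChiWithoutSmooth : Prop :=
  ∀ (M : Type) [TopologicalSpace M] [T2Space M] [SecondCountableTopology M]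
    [ChartedSpace E4 M] [IsManifold (𝓡 4) ∞ M] [ConnectedSpace M]
    (sf : MForm (𝓡 4) M ℝ 2) (K : Set M) (R : ℝ) (ψ : M → E4),
    (∀ x : M, Subsingleton (π_ 2 M x)) → IsSymplectic sf → EndsCoCompact K R ψ →
      Set.BijOn ψ Kᶜ (Metric.closedBall (0 : E4) R)ᶜ → PullbackClause sf K ψ → Conclusion sf ψ

namespace C1Shear

/-! ### The `C¹` function `f(t) = t|t|` -/

/-- `f(t) = t|t|`: `C¹` with `f' = 2|t|`, not `C²` at `0`. -/
def f (t : ℝ) : ℝ := t * |t|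

/-- `f' = 2|t|` everywhere. -/
theorem hasDerivAt_f (t : ℝ) : HasDerivAt f (2 * |t|) t := by
  rcases lt_trichotomy t 0 with ht | rfl | ht
  · have hev : f =ᶠ[𝓝 t] fun u => -(u * u) := by
      filter_upwards [(isOpen_gt' (0 : ℝ)).mem_nhds ht] with u hu
      simp [f, abs_of_neg hu]
    refine HasDerivAt.congr_of_eventuallyEq ?_ hev
    exact (((hasDerivAt_id t).mul (hasDerivAt_id t)).neg).congr_deriv
      (by simp only [id, abs_of_neg ht]; ring)
  · rw [hasDerivAt_iff_isLittleO_nhds_zero]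
    have heq : (fun h : ℝ => f (0 + h) - f 0 - h • (2 * |(0 : ℝ)|)) = fun h => h * |h| := by
      funext h; simp [f]
    rw [heq]
    have h1 : (fun h : ℝ => |h|) =o[𝓝 0] fun _ => (1 : ℝ) := by
      rw [isLittleO_one_iff]
      exact continuous_abs.tendsto' 0 0 abs_zero
    have h2 := (isBigO_refl (fun h : ℝ => h) (𝓝 0)).mul_isLittleO h1
    simpa using h2
  · have hev : f =ᶠ[𝓝 t] fun u => u * u := by
      filter_upwards [(isOpen_lt' (0 : ℝ)).mem_nhds ht] with u hu
      simp [f, abs_of_pos hu]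
    refine HasDerivAt.congr_of_eventuallyEq ?_ hev
    exact ((hasDerivAt_id t).mul (hasDerivAt_id t)).congr_deriv
      (by simp only [id, abs_of_pos ht]; ring)

/-- `deriv f = 2|·|`. -/
theorem deriv_f : deriv f = fun t => 2 * |t| := funext fun t => (hasDerivAt_f t).deriv

/-- `f` is differentiable. -/
theorem differentiable_f : Differentiable ℝ f := fun t => (hasDerivAt_f t).differentiableAt

/-- `f` is continuous. -/
theorem continuous_f : Continuous f := differentiable_f.continuous

/-- `f 0 = 0`. -/
@[simp] theorem f_zero : f 0 = 0 := by simp [f]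

/-- `f` is NOT `C²` at `0` (`f' = 2|t|` is not differentiable there). -/
theorem not_contDiffAt_f : ¬ ContDiffAt ℝ 2 f 0 := by
  intro h
  have h1 : ContDiffAt ℝ 1 (deriv f) 0 := h.derivWithin (m := 1) (by norm_num)
  have h2 : DifferentiableAt ℝ (deriv f) 0 := h1.differentiableAt (by simp)
  rw [deriv_f] at h2
  have h3 : DifferentiableAt ℝ (fun t : ℝ => (2 : ℝ)⁻¹ * (2 * |t|)) 0 := h2.const_mul _
  have h4 : (fun t : ℝ => (2 : ℝ)⁻¹ * (2 * |t|)) = (abs : ℝ → ℝ) := by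
    funext t; ring
  rw [h4] at h3
  exact not_differentiableAt_abs_zero h3

/-! ### The `C¹` symplectic shear `S(x) = x + f(x₀)e₁` -/

/-- the coordinate projections as continuous linear maps -/
abbrev pr (i : Fin 4) : E4 →L[ℝ] ℝ := PiLp.proj (𝕜 := ℝ) 2 (fun _ : Fin 4 => ℝ) i

/-- `e i`. -/
abbrev e (i : Fin 4) : E4 := EuclideanSpace.single i 1

/-- The shear `S(x) = x + f(x₀) e₁ = (x₀, x₁ + x₀|x₀|, x₂, x₃)`: a `C¹` (not `C²`) symplectomorphism of
`(ℝ⁴, ω₀)`. -/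
def S (x : E4) : E4 := x + f (x 0) • e 1

/-- Its inverse `S⁻¹(y) = y - f(y₀) e₁`. -/
def Sinv (y : E4) : E4 := y - f (y 0) • e 1

/-- `S` preserves the first coordinate. -/
theorem S_apply0 (x : E4) : S x 0 = x 0 := by simp [S, e]
/-- `S⁻¹` preserves the first coordinate. -/
theorem Sinv_apply0 (y : E4) : Sinv y 0 = y 0 := by simp [Sinv, e]

/-- `S⁻¹ ∘ S = id`. -/
theorem Sinv_S (x : E4) : Sinv (S x) = x := by
  rw [Sinv, S_apply0, S]; abel

/-- `S ∘ S⁻¹ = id`. -/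
theorem S_Sinv (y : E4) : S (Sinv y) = y := by
  rw [S, Sinv_apply0, Sinv]; abel

/-- `S` is continuous. -/
theorem continuous_S : Continuous S :=
  continuous_id.add ((continuous_f.comp (pr 0).continuous).smul continuous_const)

/-- `S⁻¹` is continuous. -/
theorem continuous_Sinv : Continuous Sinv :=
  continuous_id.sub ((continuous_f.comp (pr 0).continuous).smul continuous_const)

/-- `S` as a homeomorphism of `ℝ⁴`. -/
def SH : E4 ≃ₜ E4 where
  toFun := S
  invFun := Sinv
  left_inv := Sinv_S
  right_inv := S_Sinv
  continuous_toFun := continuous_S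
  continuous_invFun := continuous_Sinv

/-- `dS_x = id + 2|x₀| (dx₀ ⊗ e₁)`. -/
theorem hasFDerivAt_S (x : E4) :
    HasFDerivAt S (ContinuousLinearMap.id ℝ E4 + ((2 * |x 0|) • pr 0).smulRight (e 1)) x := by
  have h0 := (hasDerivAt_f (x 0)).comp_hasFDerivAt x (pr 0).hasFDerivAt
  exact (hasFDerivAt_id x).add (h0.smul_const (e 1))

/-- Coordinates of `dS_x v`: `(v₀, v₁ + 2|x₀|v₀, v₂, v₃)`. -/
theorem fderiv_S_apply (x v : E4) (i : Fin 4) :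
    fderiv ℝ S x v i = v i + (2 * |x 0| * v 0) * (e 1) i := by
  rw [(hasFDerivAt_S x).fderiv]
  simp [e, smul_eq_mul]

/-- `S` is symplectic: `ω₀(dS v, dS w) = ω₀(v, w)`. -/
theorem std_fderiv_S (x v w : E4) :
    stdSymplecticForm (fderiv ℝ S x v) (fderiv ℝ S x w) = stdSymplecticForm v w := by
  simp [stdSymplecticForm, fderiv_S_apply, e]
  ring

/-- `S` is NOT `C^∞` (not even `C²`) at any point of the hyperplane `{x₀ = 0}`. -/
theorem not_contDiffAt_S {p : E4} (hp : p 0 = 0) : ¬ ContDiffAt ℝ ∞ S p := by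
  intro h
  -- restrict to the line `t ↦ p + t e₀` and read coordinate `1`
  have hline : ContDiffAt ℝ ∞ (fun t : ℝ => p + t • e 0) 0 :=
    contDiffAt_const.add (contDiffAt_id.smul contDiffAt_const)
  have hcomp : ContDiffAt ℝ ∞ (fun t : ℝ => (S (p + t • e 0)) 1) 0 := by
    have h' : ContDiffAt ℝ ∞ S (p + (0 : ℝ) • e 0) := by simpa using h
    exact (pr 1).contDiff.contDiffAt.comp 0 (h'.comp 0 hline)
  have hval : (fun t : ℝ => (S (p + t • e 0)) 1) = fun t => p 1 + f t := by
    funext t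
    simp [S, e, hp]
  rw [hval] at hcomp
  have hf : ContDiffAt ℝ ∞ f 0 := by
    have := hcomp.sub (contDiffAt_const (c := p 1))
    simpa using this
  exact not_contDiffAt_f (hf.of_le (by norm_cast))

/-- The compact set `K = S⁻¹(B̄(0, 1))`. -/
def K1 : Set E4 := S ⁻¹' Metric.closedBall (0 : E4) 1

/-- Preimages of closed balls under `S` are compact. -/
theorem isCompact_preimage_S (r : ℝ) : IsCompact (S ⁻¹' Metric.closedBall (0 : E4) r) :=
  SH.isCompact_preimage.2 (isCompact_closedBall _ _)

/-- All hypotheses of the `χ`-free crux except the smoothness of `ψ` hold for `M = ℝ⁴`, `sf = ω₀`,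
`K = S⁻¹(B̄(0,1))`, `R = 1`, `ψ = S`. -/
theorem hypotheses :
    (∀ x : E4, Subsingleton (π_ 2 E4 x)) ∧ IsSymplectic stdSymplecticMForm ∧ EndsCoCompact K1 1 S ∧
      Set.BijOn S K1ᶜ (Metric.closedBall (0 : E4) 1)ᶜ ∧ PullbackClause stdSymplecticMForm K1 S := by
  refine ⟨subsingleton_pi_two_euclideanSpace,
    ⟨isSmoothForm_stdSymplecticMForm, isClosedForm_stdSymplecticMForm, stdSymplecticMForm_nondegenerate⟩,
    ?_, ?_, ?_⟩
  · intro R' hR'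
    have h : K1 ∪ {x : E4 | ‖S x‖ ≤ R'} = S ⁻¹' Metric.closedBall (0 : E4) R' := by
      ext x
      simp only [K1, mem_union, mem_preimage, Metric.mem_closedBall, dist_zero_right, mem_setOf_eq]
      constructor
      · rintro (h | h) <;> linarith
      · intro h; exact Or.inr h
    rw [h]
    exact isCompact_preimage_S R'
  · refine ⟨fun x hx => hx, SH.injective.injOn, fun y hy => ⟨Sinv y, ?_, S_Sinv y⟩⟩
    show ¬ S (Sinv y) ∈ Metric.closedBall (0 : E4) 1
    rw [S_Sinv]; exact hy
  · intro x _ v w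
    have h : mfderiv (𝓡 4) 𝓘(ℝ, E4) S x = fderiv ℝ S x := mfderiv_eq_fderiv
    rw [stdSymplecticMForm_apply, h]
    exact (std_fderiv_S x v w).symm

/-- … but the conclusion fails: `Φ` would be `C^∞` and equal to `S` near the far point `(0, r+2, 0, 0)`
of the hyperplane `{x₀ = 0}`, where `S` is not `C²`. -/
theorem not_conclusion : ¬ Conclusion stdSymplecticMForm S := by
  rintro ⟨Φ, -, K', hK', hagree⟩
  obtain ⟨r, hr⟩ := hK'.isBounded.subset_closedBall (0 : E4)
  set p : E4 := (|r| + 2) • e 1 with hp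
  have hp0 : p 0 = 0 := by simp [hp, e]
  have hpn : ‖p‖ = |r| + 2 := by
    rw [hp, norm_smul, Real.norm_eq_abs, abs_of_pos (by positivity)]; simp [e]
  have hpK : p ∉ K' := by
    intro h
    have := hr h
    rw [Metric.mem_closedBall, dist_zero_right, hpn] at this
    linarith [le_abs_self r]
  have hev : (⇑Φ : E4 → E4) =ᶠ[𝓝 p] S :=
    Filter.eventuallyEq_of_mem (hK'.isClosed.isOpen_compl.mem_nhds hpK) fun x hx => hagree x hx
  have hS : ContMDiffAt 𝓘(ℝ, E4) 𝓘(ℝ, E4) ∞ S p := (Φ.contMDiff.contMDiffAt).congr_of_eventuallyEq hev.symm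
  exact not_contDiffAt_S hp0 (contMDiffAt_iff_contDiffAt.1 hS)

end C1Shear

/-- **The smoothness of the end chart is load-bearing** (in the `χ`-free form of the crux, to which the crux
is equivalent): with H6 deleted the statement is FALSE — witness the `C¹` symplectic shear `S` of `(ℝ⁴, ω₀)`.
(For the junk-ish reason that `Φ` must be `C^∞` and equal to `ψ` near infinity; informative content: a
`C¹` symplectomorphism of the end need not be smoothable RELATIVE to itself.) -/
theorem gromovRecognitionRelEnd_noChi_false_without_smooth : ¬ GromovRecognitionRelEndNoChiWithoutSmooth := by
  intro h
  obtain ⟨h1, h234, h5, h8, h10⟩ := C1Shear.hypotheses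
  exact C1Shear.not_conclusion (h E4 stdSymplecticMForm C1Shear.K1 1 C1Shear.S h1 h234 h5 h8 h10)

/-! ## 10. Load-bearing analysis: H1 (`π₂(M) = 0`) — forced by the conclusion; droppable iff no
non-minimal model exists -/

section PiTwo

variable {M : Type} [TopologicalSpace M]

/-- **The conclusion forces `π₂(M) = 0`**: a homeomorphism `M ≃ₜ ℝ⁴` transports `π₂(ℝ⁴) = 0`
(homotopy invariance of the vanishing of `π₂`, tree lemma `subsingleton_homotopyGroup_of_homotopyEquiv`). -/
theorem subsingleton_pi_two_of_homeomorph (Φ : M ≃ₜ E4) (x : M) : Subsingleton (π_ 2 M x) :=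
  subsingleton_homotopyGroup_of_homotopyEquiv Φ.toHomotopyEquiv subsingleton_pi_two_euclideanSpace x

variable [ChartedSpace E4 M] [IsManifold (𝓡 4) ∞ M]

/-- In particular H1 follows from the conclusion of the crux. -/
theorem subsingleton_pi_two_of_conclusion {sf : MForm (𝓡 4) M ℝ 2} {ψ : M → E4}
    (h : Conclusion sf ψ) (x : M) : Subsingleton (π_ 2 M x) := by
  obtain ⟨Φ, -, -⟩ := h
  exact subsingleton_pi_two_of_homeomorph Φ.toHomeomorph x

end PiTwo

/-- The crux with H1 (`π₂(M) = 0`) deleted. -/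
def GromovRecognitionRelEndWithoutPi2 : Prop :=
  ∀ (M : Type) [TopologicalSpace M] [T2Space M] [SecondCountableTopology M]
    [ChartedSpace E4 M] [IsManifold (𝓡 4) ∞ M] [ConnectedSpace M]
    (sf : MForm (𝓡 4) M ℝ 2) (K : Set M) (R : ℝ) (ψ : M → E4) (χ : E4 → M),
    IsSymplectic sf → EndsCoCompact K R ψ → IsEndChart K R ψ χ → PullbackClause sf K ψ → Conclusion sf ψ

/-- A NON-MINIMAL MODEL: a connected symplectic 4-manifold, standard at infinity in the sense of the
crux (H2–H10), with `π₂ ≠ 0` at some point. In print this is the one-point blow-up of `(ℝ⁴, ω₀)`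
(total space of `𝒪(-1) → ℂP¹`, the exceptional sphere has positive area; McDuff 1990, and the sentence
after MS2017 Rem. 4.5.2 (viii)); it is not constructible over Mathlib today (no `ℂP¹`, no gluing). -/
structure NonMinimalModel where
  /-- carrier -/
  M : Type
  [top : TopologicalSpace M]
  [t2 : T2Space M]
  [sc : SecondCountableTopology M]
  [cs : ChartedSpace E4 M]
  [mfd : IsManifold (𝓡 4) ∞ M]
  [conn : ConnectedSpace M]
  /-- the symplectic form -/
  sf : MForm (𝓡 4) M ℝ 2
  /-- the compact set off which the end chart lives -/
  K : Set M
  /-- the radius of the model end -/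
  R : ℝ
  /-- the end chart -/
  ψ : M → E4
  /-- its inverse -/
  χ : E4 → M
  symplectic : IsSymplectic sf
  ends : EndsCoCompact K R ψ
  endChart : IsEndChart K R ψ χ
  pullback : PullbackClause sf K ψ
  /-- a point where `π₂` is non-trivial -/
  x : M
  nonMinimal : ¬ Subsingleton (π_ 2 M x)

attribute [instance] NonMinimalModel.top NonMinimalModel.t2 NonMinimalModel.sc NonMinimalModel.cs
  NonMinimalModel.mfd NonMinimalModel.conn

/-- `H :=` "a non-minimal model exists" (the blow-up of `ℝ⁴`; true in print, not constructible here). -/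
def NonMinimalModelExists : Prop := Nonempty NonMinimalModel

/-- **H1 is load-bearing modulo the blow-up**: a non-minimal model refutes the crux without H1
(its conclusion would force `π₂ = 0`). -/
theorem gromovRecognitionRelEnd_false_without_pi2_of (h : NonMinimalModelExists) :
    ¬ GromovRecognitionRelEndWithoutPi2 := by
  obtain ⟨m⟩ := h
  intro hW
  exact m.nonMinimal (subsingleton_pi_two_of_conclusion
    (hW m.M m.sf m.K m.R m.ψ m.χ m.symplectic m.ends m.endChart m.pullback) m.x)

/-- **Exact status of H1.** The crux without `π₂(M) = 0` holds iff the crux holds AND no non-minimal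
model exists: `π₂ = 0` is precisely the clause excluding blow-ups. -/
theorem gromovRecognitionRelEndWithoutPi2_iff :
    GromovRecognitionRelEndWithoutPi2 ↔
      (Summit.SmoothPoincare4.SmoothPoincare4.Theses.SymplecticOrigami.GromovRecognitionRelEnd ∧
        ¬ NonMinimalModelExists) := by
  constructor
  · intro hW
    refine ⟨?_, fun h => gromovRecognitionRelEnd_false_without_pi2_of h hW⟩
    rw [crux_iff]
    intro M _ _ _ _ _ _ sf K R ψ χ _ h234 h5 h6789 h10
    exact hW M sf K R ψ χ h234 h5 h6789 h10
  · rintro ⟨hc, hn⟩ M _ _ _ _ _ _ sf K R ψ χ h234 h5 h6789 h10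
    rw [crux_iff] at hc
    by_cases hπ : ∀ x : M, Subsingleton (π_ 2 M x)
    · exact hc M sf K R ψ χ hπ h234 h5 h6789 h10
    · simp only [not_forall] at hπ
      obtain ⟨x, hx⟩ := hπ
      exact absurd ⟨⟨M, sf, K, R, ψ, χ, h234, h5, h6789, h10, x, hx⟩⟩ hn

/-! ## 11. The compactification attack made concrete: the round `S⁴` with a stereographic end

`M = S⁴`, `ψ` = a stereographic chart `c` (a diffeomorphism of `S⁴ ∖ {N}` onto `ℝ⁴`, `N` the pole it
misses), `χ = c⁻¹`, `K = {N} ∪ c⁻¹(B̄(0,1))`, `R = 1`. Then `Kᶜ = c⁻¹({1 < ‖z‖})` and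
* H1 (`π₂(S⁴) = 0`), connectedness, Hausdorff, second countable: ✓;
* H5 (every sub-end co-compact): ✓ trivially, `S⁴` being compact and `K ∪ {‖ψ‖ ≤ R'}` closed;
* H6–H9 (smooth end chart with smooth inverse): ✓ (`c` is a chart of the analytic atlas);
* H10 holds for the junk-extended pull-back `sf := ψ*ω₀` (DEFINED pointwise through `mfderiv`, so
  H10 is an identity) — a form which is honest, smooth, closed and symplectic on `S⁴ ∖ {N}` and blows
  up at `N` (`~ ‖y‖⁻⁴` in the chart at `N`);
* the END RETURNS: the `∞`-side of the end accumulates at `N ∈ K`, i.e. `K ∪ {x ∈ Kᶜ | ‖ψ x‖ < 2}` is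
  NOT open (`Sphere4.not_isOpen_truncation`), and `M` is compact, so not even homeomorphic to `ℝ⁴`.
Consequences (all kernel-checked below):
* the S-stub "the end does not return" (`stub_endDoesNotReturn` of line `cross-cap-laurent`, the
  panel's common finding C1, restated verbatim as `StubEndDoesNotReturn`) is FALSE without H10
  (`sf := 0`) and FALSE without `IsSmoothForm sf` (`sf := ψ*ω₀` junk-extended) — so its proof MUST
  use the continuity of `sf` across `K` together with `sf = ψ*ω₀` (the volume argument), exactly as
  its proof plan says; and FALSE without H5 (shear end of §4);
* the crux with the REGULARITY of `sf` deleted (H2 ∧ H3 ∧ H4 dropped, H10 kept) is FALSE for a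
  non-junk reason — `M = S⁴` is compact — even with the conclusion weakened to `Nonempty (M ≃ₜ ℝ⁴)`
  (`§12`). The §6/§6b/§6c witnesses killed H2, H3, H4 one at a time only through the fine
  structure of the conclusion (`Φ*ω₀` is smooth/closed/nondegenerate) on `M = ℝ⁴`. -/

namespace Sphere4

/-- The round 4-sphere. -/
local notation "S4" => Metric.sphere (0 : EuclideanSpace ℝ (Fin 5)) 1

/-- `dim ℝ⁵ = 4 + 1` as a `Fact` (the instance Mathlib keeps local to its sphere charts). -/
instance factFinrankFive : Fact (Module.finrank ℝ (EuclideanSpace ℝ (Fin 5)) = 4 + 1) :=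
  ⟨by rw [finrank_euclideanSpace_fin]⟩

/-- A base point `p` (the chart used is the stereographic projection from `-p`). -/
def p : S4 := ⟨EuclideanSpace.single 0 1, by simp⟩

/-- The pole `N = -p` missed by the chart at `p`. -/
def N : S4 := -p

/-- The stereographic chart at `p`. -/
def c : OpenPartialHomeomorph S4 E4 := chartAt E4 p

/-- Its source is `S⁴ ∖ {N}`. -/
theorem c_source : c.source = {N}ᶜ := by
  show (stereographic' 4 (-p)).source = {N}ᶜ
  rw [stereographic'_source]; rfl

/-- Its target is all of `ℝ⁴`. -/
theorem c_target : c.target = univ := by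
  show (stereographic' 4 (-p)).target = univ
  exact stereographic'_target (-p)

/-- Points other than `N` are in the source. -/
theorem mem_source {x : S4} (hx : x ≠ N) : x ∈ c.source := by
  rw [c_source]; exact hx

/-- Points of the source are not `N`. -/
theorem ne_of_mem_source {x : S4} (hx : x ∈ c.source) : x ≠ N := by
  rw [c_source] at hx; exact hx

/-- `S⁴` is compact. -/
instance : CompactSpace S4 := isCompact_iff_compactSpace.1 (isCompact_sphere _ _)

/-- `S⁴` is connected. -/
instance : ConnectedSpace S4 := by
  refine isConnected_iff_connectedSpace.mp (isConnected_sphere ?_ 0 zero_le_one)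
  rw [← Module.finrank_eq_rank, finrank_euclideanSpace_fin]
  norm_num

/-- THE END MAP `ψ = c` (junk value at `N`). -/
def ψ : S4 → E4 := c

/-- Its inverse `χ = c⁻¹`. -/
def χ : E4 → S4 := c.symm

/-- `χ z` lies in the source, i.e. is not `N`. -/
theorem χ_mem_source (z : E4) : χ z ∈ c.source := c.map_target (by rw [c_target]; exact mem_univ z)

/-- `ψ (χ z) = z`. -/
theorem ψ_χ (z : E4) : ψ (χ z) = z := c.right_inv (by rw [c_target]; exact mem_univ z)

/-- `χ (ψ x) = x` for `x ≠ N`. -/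
theorem χ_ψ {x : S4} (hx : x ≠ N) : χ (ψ x) = x := c.left_inv (mem_source hx)

/-- THE COMPACT SET `K = {N} ∪ ψ⁻¹(B̄(0,1))`. -/
def K : Set S4 := {x | x = N ∨ ‖ψ x‖ ≤ 1}

/-- Membership in `Kᶜ`. -/
theorem mem_compl_K {x : S4} : x ∈ Kᶜ ↔ x ≠ N ∧ 1 < ‖ψ x‖ := by
  simp [K, not_or]

/-- `Kᶜ ⊆ source`. -/
theorem compl_K_subset : Kᶜ ⊆ c.source := fun _ hx => mem_source (mem_compl_K.1 hx).1

/-- The sub-level sets `K ∪ {‖ψ‖ ≤ R'}`, `R' ≥ 1`, are complements of `source ∩ ψ⁻¹{R' < ‖z‖}`. -/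
theorem compl_sublevel {R' : ℝ} (hR' : 1 ≤ R') :
    (K ∪ {x | ‖ψ x‖ ≤ R'})ᶜ = c.source ∩ ψ ⁻¹' {z | R' < ‖z‖} := by
  ext x
  rw [c_source]
  simp only [K, mem_compl_iff, mem_union, mem_setOf_eq, not_or, not_le, mem_inter_iff, mem_preimage,
    mem_singleton_iff]
  constructor
  · rintro ⟨⟨h1, -⟩, h3⟩; exact ⟨h1, h3⟩
  · rintro ⟨h1, h3⟩; exact ⟨⟨h1, by linarith⟩, h3⟩

/-- H5: every sub-end is co-compact (closed in the compact `S⁴`). -/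
theorem endsCoCompact : EndsCoCompact K 1 ψ := by
  intro R' hR'
  have ho : IsOpen (c.source ∩ ψ ⁻¹' {z : E4 | R' < ‖z‖}) :=
    c.isOpen_inter_preimage (isOpen_lt continuous_const continuous_norm)
  have hc : IsClosed (K ∪ {x | ‖ψ x‖ ≤ R'}) := by
    rw [← compl_compl (K ∪ {x | ‖ψ x‖ ≤ R'}), compl_sublevel hR']
    exact ho.isClosed_compl
  exact hc.isCompact

/-- H6–H9: `ψ|Kᶜ` is a smooth bijection onto `{1 < ‖z‖}` with smooth inverse `χ`. -/
theorem isEndChart : IsEndChart K 1 ψ χ := by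
  refine ⟨?_, ?_, ⟨?_, ?_, ?_⟩, fun x hx => χ_ψ (mem_compl_K.1 hx).1⟩
  · exact (contMDiffOn_chart (I := 𝓡 4) (n := ∞) (x := p)).mono compl_K_subset
  · refine (contMDiffOn_chart_symm (I := 𝓡 4) (n := ∞) (x := p)).mono ?_
    show (Metric.closedBall (0 : E4) 1)ᶜ ⊆ c.target
    rw [c_target]; exact subset_univ _
  · intro x hx
    simpa [Metric.mem_closedBall, dist_zero_right] using (mem_compl_K.1 hx).2
  · exact c.injOn.mono compl_K_subset
  · intro z hz
    have hz' : 1 < ‖z‖ := by simpa [Metric.mem_closedBall, dist_zero_right] using hz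
    refine ⟨χ z, mem_compl_K.2 ⟨ne_of_mem_source (χ_mem_source z), ?_⟩, ψ_χ z⟩
    rw [ψ_χ]; exact hz'

/-- `e₀ ∈ ℝ⁴`. -/
abbrev e0 : E4 := EuclideanSpace.single 0 1

/-- **The end returns to `N`:** the truncation `K ∪ {x ∈ Kᶜ | ‖ψ x‖ < 2}` is NOT open. (If it were,
its complement `C = ψ⁻¹{2 ≤ ‖z‖}` would be compact, hence so would be `ψ(C) = {2 ≤ ‖z‖}`.) -/
theorem not_isOpen_truncation : ¬ IsOpen (K ∪ {x | x ∈ Kᶜ ∧ ‖ψ x‖ < 2}) := by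
  intro hU
  set C : Set S4 := (K ∪ {x | x ∈ Kᶜ ∧ ‖ψ x‖ < 2})ᶜ with hC
  have hCc : IsCompact C := hU.isClosed_compl.isCompact
  have hCsub : C ⊆ c.source := by
    intro x hx
    apply mem_source
    intro hxN
    exact hx (Or.inl (Or.inl hxN))
  have himg : IsCompact (ψ '' C) := hCc.image_of_continuousOn (c.continuousOn.mono hCsub)
  obtain ⟨r, hr⟩ := himg.isBounded.subset_closedBall (0 : E4)
  -- the far point `z = (|r| + 3) e₀` lies in `ψ '' C`
  set z : E4 := (|r| + 3) • e0 with hz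
  have hzn : ‖z‖ = |r| + 3 := by
    rw [hz, norm_smul, Real.norm_eq_abs, abs_of_pos (by positivity)]; simp [e0]
  have hzC : z ∈ ψ '' C := by
    refine ⟨χ z, ?_, ψ_χ z⟩
    intro hmem
    have hχN : χ z ≠ N := ne_of_mem_source (χ_mem_source z)
    rcases hmem with (h | h) | ⟨-, h⟩
    · exact hχN h
    · rw [ψ_χ, hzn] at h; linarith [abs_nonneg r]
    · rw [ψ_χ, hzn] at h; linarith [abs_nonneg r]
  have := hr hzC
  rw [Metric.mem_closedBall, dist_zero_right, hzn] at this
  linarith [le_abs_self r]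

/-- `π₂(S⁴) = 0` (tree lemma `subsingleton_homotopyGroup_sphere`). -/
theorem subsingleton_pi_two (x : S4) : Subsingleton (π_ 2 S4 x) :=
  subsingleton_homotopyGroup_sphere (by rw [finrank_euclideanSpace_fin]; norm_num) x

/-- `S⁴` is not homeomorphic to `ℝ⁴` (compactness). -/
theorem not_nonempty_homeomorph : ¬ Nonempty (S4 ≃ₜ E4) := by
  rintro ⟨h⟩
  haveI : CompactSpace E4 := h.compactSpace
  obtain ⟨r, hr⟩ := (isCompact_univ (X := E4)).isBounded.subset_closedBall (0 : E4)
  have hmem := hr (mem_univ ((|r| + 1) • e0))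
  rw [Metric.mem_closedBall, dist_zero_right, norm_smul, Real.norm_eq_abs,
    abs_of_pos (by positivity : (0 : ℝ) < |r| + 1)] at hmem
  simp [e0] at hmem
  linarith [le_abs_self r]

/-- THE JUNK-EXTENDED PULL-BACK `sf = ψ*ω₀` (honest symplectic form on `S⁴ ∖ {N}`, junk at `N`). -/
def sf : MForm (𝓡 4) S4 ℝ 2 := stdSymplecticMForm.pullback (𝓡 4) ψ

/-- H10 holds for `sf` identically (at every point, by definition of the pull-back). -/
theorem pullbackClause : PullbackClause sf K ψ := fun x _ v w => by
  rw [sf, stdSymplecticMForm_pullback_apply]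

end Sphere4

/-! ### 11a. The S-stub "the end does not return" and its load-bearing hypotheses -/

/-- VERBATIM restatement of `stub_endDoesNotReturn` (line `cross-cap-laurent`, Stub 1; the panel's
common finding C1 = `resists` bullet 1): under the end hypotheses, every truncation
`K ∪ {x ∈ Kᶜ | ‖ψ x‖ < R'}`, `R' > R`, is open. (Not imported: the skeleton carries `sorry`s.) -/
def StubEndDoesNotReturn : Prop :=
  ∀ (M : Type) [TopologicalSpace M] [T2Space M] [SecondCountableTopology M]
    [ChartedSpace E4 M] [IsManifold (𝓡 4) ∞ M]
    (sf : MForm (𝓡 4) M ℝ 2) (K : Set M) (R : ℝ) (ψ : M → E4) (χ : E4 → M),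
    IsSmoothForm sf →
    (∀ R', R ≤ R' → IsCompact (K ∪ {x | ‖ψ x‖ ≤ R'})) →
    ContMDiffOn (𝓡 4) 𝓘(ℝ, E4) ∞ ψ Kᶜ →
    ContMDiffOn 𝓘(ℝ, E4) (𝓡 4) ∞ χ (Metric.closedBall (0 : E4) R)ᶜ →
    Set.BijOn ψ Kᶜ (Metric.closedBall (0 : E4) R)ᶜ →
    (∀ x, x ∈ Kᶜ → χ (ψ x) = x) →
    (∀ x, x ∈ Kᶜ → ∀ v w, sf x ![v, w] =
      stdSymplecticForm (mfderiv (𝓡 4) 𝓘(ℝ, E4) ψ x v) (mfderiv (𝓡 4) 𝓘(ℝ, E4) ψ x w)) →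
    ∀ R', R < R' → IsOpen (K ∪ {x | x ∈ Kᶜ ∧ ‖ψ x‖ < R'})

/-- The stub, block form. -/
theorem stubEndDoesNotReturn_iff :
    StubEndDoesNotReturn ↔
      ∀ (M : Type) [TopologicalSpace M] [T2Space M] [SecondCountableTopology M]
        [ChartedSpace E4 M] [IsManifold (𝓡 4) ∞ M]
        (sf : MForm (𝓡 4) M ℝ 2) (K : Set M) (R : ℝ) (ψ : M → E4) (χ : E4 → M),
        IsSmoothForm sf → EndsCoCompact K R ψ → IsEndChart K R ψ χ → PullbackClause sf K ψ →
          ∀ R', R < R' → IsOpen (K ∪ {x | x ∈ Kᶜ ∧ ‖ψ x‖ < R'}) := by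
  constructor
  · intro h M _ _ _ _ _ sf K R ψ χ h2 h5 h6789 h10
    exact h M sf K R ψ χ h2 h5 h6789.1 h6789.2.1 h6789.2.2.1 h6789.2.2.2 h10
  · intro h M _ _ _ _ _ sf K R ψ χ h2 h5 h6 h7 h8 h9 h10
    exact h M sf K R ψ χ h2 h5 ⟨h6, h7, h8, h9⟩ h10

/-- The stub with H10 (`sf = ψ*ω₀` on `Kᶜ`) deleted. -/
def StubEndDoesNotReturnWithoutPullback : Prop :=
  ∀ (M : Type) [TopologicalSpace M] [T2Space M] [SecondCountableTopology M]
    [ChartedSpace E4 M] [IsManifold (𝓡 4) ∞ M]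
    (sf : MForm (𝓡 4) M ℝ 2) (K : Set M) (R : ℝ) (ψ : M → E4) (χ : E4 → M),
    IsSmoothForm sf → EndsCoCompact K R ψ → IsEndChart K R ψ χ →
      ∀ R', R < R' → IsOpen (K ∪ {x | x ∈ Kᶜ ∧ ‖ψ x‖ < R'})

/-- The stub with the smoothness of `sf` deleted. -/
def StubEndDoesNotReturnWithoutSmoothForm : Prop :=
  ∀ (M : Type) [TopologicalSpace M] [T2Space M] [SecondCountableTopology M]
    [ChartedSpace E4 M] [IsManifold (𝓡 4) ∞ M]
    (sf : MForm (𝓡 4) M ℝ 2) (K : Set M) (R : ℝ) (ψ : M → E4) (χ : E4 → M),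
    EndsCoCompact K R ψ → IsEndChart K R ψ χ → PullbackClause sf K ψ →
      ∀ R', R < R' → IsOpen (K ∪ {x | x ∈ Kᶜ ∧ ‖ψ x‖ < R'})

/-- The stub with H5 (ends clause) deleted. -/
def StubEndDoesNotReturnWithoutEnds : Prop :=
  ∀ (M : Type) [TopologicalSpace M] [T2Space M] [SecondCountableTopology M]
    [ChartedSpace E4 M] [IsManifold (𝓡 4) ∞ M]
    (sf : MForm (𝓡 4) M ℝ 2) (K : Set M) (R : ℝ) (ψ : M → E4) (χ : E4 → M),
    IsSmoothForm sf → IsEndChart K R ψ χ → PullbackClause sf K ψ →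
      ∀ R', R < R' → IsOpen (K ∪ {x | x ∈ Kᶜ ∧ ‖ψ x‖ < R'})

/-- **Stub 1 needs H10**: with the pull-back clause deleted the stub is FALSE — `S⁴` with `sf = 0` and
the stereographic end (the end returns to the pole `N`). So "no accumulation" is NOT a topological
consequence of the end structure; it is a property of the symplectic form. -/
theorem stubEndDoesNotReturn_false_without_pullback : ¬ StubEndDoesNotReturnWithoutPullback := by
  intro h
  exact Sphere4.not_isOpen_truncation (h _ (0 : MForm (𝓡 4) _ ℝ 2) Sphere4.K 1 Sphere4.ψ Sphere4.χ
    isSmoothForm_zero Sphere4.endsCoCompact Sphere4.isEndChart 2 one_lt_two)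

/-- **Stub 1 needs the smoothness (continuity) of `sf` across `K`**: with `IsSmoothForm sf` deleted
the stub is FALSE — `S⁴` with the junk-extended `sf = ψ*ω₀`, which satisfies H10 identically. The
volume argument of the proof plan uses exactly the boundedness of `sf` near `K`. -/
theorem stubEndDoesNotReturn_false_without_smoothForm : ¬ StubEndDoesNotReturnWithoutSmoothForm := by
  intro h
  exact Sphere4.not_isOpen_truncation (h _ Sphere4.sf Sphere4.K 1 Sphere4.ψ Sphere4.χ
    Sphere4.endsCoCompact Sphere4.isEndChart Sphere4.pullbackClause 2 one_lt_two)

namespace ShearEnd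

/-- On the shear end of `§4` the truncation `Ωᶜ ∪ {y ∈ Ω | ‖ψ y‖ < 2}` is NOT open: the points
`(0, t, 1, 0) ∈ Ω`, `‖ψ‖ ≥ |log t| ≥ 2`, converge to `(0, 0, 1, 0) ∈ Ωᶜ` as `t → 0⁺`. -/
theorem not_isOpen_truncation : ¬ IsOpen (Ωᶜ ∪ {y | y ∈ Ωᶜᶜ ∧ ‖ψ y‖ < 2}) := by
  intro hU
  have hq : pt 1 0 ∈ Ωᶜ ∪ {y | y ∈ Ωᶜᶜ ∧ ‖ψ y‖ < 2} := by
    left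
    intro h
    have := h.1
    simp at this
  obtain ⟨δ, hδ, hball⟩ := Metric.isOpen_iff.1 hU _ hq
  set t : ℝ := min (δ / 2) (Real.exp (-2)) with ht
  have htpos : 0 < t := lt_min (half_pos hδ) (Real.exp_pos _)
  have hmem : pt 1 t ∈ Metric.ball (pt 1 0) δ := by
    rw [Metric.mem_ball, dist_pt, abs_of_pos htpos]
    exact (min_le_left _ _).trans_lt (half_lt_self hδ)
  have hlog : 2 ≤ ‖ψ (pt 1 t)‖ := by
    refine le_trans ?_ (norm_ψ_pt 1)
    have h1 : Real.log t ≤ -2 := by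
      have := Real.log_le_log htpos (min_le_right (δ / 2) (Real.exp (-2)))
      rwa [Real.log_exp] at this
    rw [abs_of_nonpos (by linarith)]
    linarith
  have hΩ : pt 1 t ∈ Ω := ⟨by simpa using htpos, by linarith⟩
  rcases hball hmem with h | ⟨-, h⟩
  · exact h hΩ
  · linarith

end ShearEnd

/-- **Stub 1 needs H5** (consistency with `§4`): with the ends clause deleted the stub is FALSE on
the shear end, as its own docstring anticipates. -/
theorem stubEndDoesNotReturn_false_without_ends : ¬ StubEndDoesNotReturnWithoutEnds := by
  intro h
  obtain ⟨-, -, h6789, h10⟩ := ShearEnd.hypotheses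
  exact ShearEnd.not_isOpen_truncation (h E4 stdSymplecticMForm ShearEnd.Ωᶜ 1 ShearEnd.ψ ShearEnd.g
    isSmoothForm_stdSymplecticMForm h6789 h10 2 one_lt_two)

/-! ## 12. The crux without the regularity of the form: false with `M` compact -/

/-- The crux with H2 ∧ H3 ∧ H4 (smooth, closed, nondegenerate) deleted — `sf` an arbitrary `2`-form
subject only to H10 on `Kᶜ` — and the conclusion WEAKENED to "`M` is homeomorphic to `ℝ⁴`". -/
def GromovRecognitionRelEndWithoutFormRegularity : Prop :=
  ∀ (M : Type) [TopologicalSpace M] [T2Space M] [SecondCountableTopology M]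
    [ChartedSpace E4 M] [IsManifold (𝓡 4) ∞ M] [ConnectedSpace M]
    (sf : MForm (𝓡 4) M ℝ 2) (K : Set M) (R : ℝ) (ψ : M → E4) (χ : E4 → M),
    (∀ x : M, Subsingleton (π_ 2 M x)) → EndsCoCompact K R ψ → IsEndChart K R ψ χ →
      PullbackClause sf K ψ → Nonempty (M ≃ₜ E4)

/-- The crux's conclusion implies the weak conclusion. -/
theorem nonempty_homeomorph_of_conclusion {M : Type} [TopologicalSpace M] [ChartedSpace E4 M]
    [IsManifold (𝓡 4) ∞ M] {sf : MForm (𝓡 4) M ℝ 2} {ψ : M → E4} (h : Conclusion sf ψ) :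
    Nonempty (M ≃ₜ E4) := by
  obtain ⟨Φ, -, -⟩ := h
  exact ⟨Φ.toHomeomorph⟩

/-- **Without the regularity of `sf` the crux is FALSE for a non-junk reason**: `S⁴` with the
stereographic end and the junk-extended `sf = ψ*ω₀` satisfies H1, H5–H10 (and connectedness etc.),
and `S⁴` is compact. The regularity of `sf` ACROSS `K` is the only hypothesis standing between the
crux and the one-point compactification of its own end. -/
theorem gromovRecognitionRelEnd_false_without_formRegularity :
    ¬ GromovRecognitionRelEndWithoutFormRegularity := by
  intro h
  exact Sphere4.not_nonempty_homeomorph (h _ Sphere4.sf Sphere4.K 1 Sphere4.ψ Sphere4.χ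
    Sphere4.subsingleton_pi_two Sphere4.endsCoCompact Sphere4.isEndChart Sphere4.pullbackClause)


/-! ## 13. The topological half of "the end does not return": a checked DICHOTOMY

Under the purely topological end hypotheses (H5, `ψ|Kᶜ` a continuous bijection onto `{R < ‖z‖}` with
continuous inverse `χ`; no form at all) EXACTLY ONE of the following holds:
(A) NO ACCUMULATION — every truncation `K ∪ {x ∈ Kᶜ | ‖ψ x‖ < R'}`, `R' > R`, is open;
(B) `M` is compact (and then the `∞`-side of the end accumulates on `K`: the `S⁴` of §11).
(`noAccumulation_or_compactSpace`, `not_compactSpace_of_noAccumulation`.) So each line's S-stub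
"the end does not return" (cross-cap `stub_endDoesNotReturn`, hopf `stub_endProper`, divisor
`stub_endNoReturn`) is EQUIVALENT, over its own hypotheses, to `¬ CompactSpace M` — and THAT is where
the symplectic form must enter (finite `sf²`-volume of a compact `M` against the infinite `ω₀²`-volume
of the end; not available over Mathlib's manifold integration today). The frontier/connectedness
argument of `resists` bullet 1 is the proof below. -/

section Dichotomy

/-- The complement of a closed ball of radius `r ≥ 0` in `ℝ⁴` is connected (image of `S³ × (r, ∞)`). -/
theorem isConnected_compl_closedBall {r : ℝ} (hr : 0 ≤ r) : IsConnected (Metric.closedBall (0 : E4) r)ᶜ := by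
  have hS : IsConnected (Metric.sphere (0 : E4) 1 ×ˢ Ioi r) :=
    (isConnected_sphere EndItself.one_lt_rank 0 zero_le_one).prod isConnected_Ioi
  have himg : (fun q : E4 × ℝ => q.2 • q.1) '' (Metric.sphere (0 : E4) 1 ×ˢ Ioi r) =
      (Metric.closedBall (0 : E4) r)ᶜ := by
    ext z
    simp only [mem_image, mem_prod, mem_sphere_iff_norm, sub_zero, mem_Ioi, Prod.exists, mem_compl_iff,
      Metric.mem_closedBall, dist_zero_right, not_le]
    constructor
    · rintro ⟨x, t, ⟨hx, ht⟩, rfl⟩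
      rw [norm_smul, hx, mul_one, Real.norm_eq_abs, abs_of_pos (hr.trans_lt ht)]
      exact ht
    · intro hz
      have hz0 : ‖z‖ ≠ 0 := by linarith
      refine ⟨‖z‖⁻¹ • z, ‖z‖, ⟨?_, hz⟩, ?_⟩
      · rw [norm_smul, norm_inv, norm_norm, inv_mul_cancel₀ hz0]
      · rw [smul_smul, mul_inv_cancel₀ hz0, one_smul]
  rw [← himg]
  exact hS.image _ ((continuous_snd.smul continuous_fst).continuousOn)

variable {M : Type} [TopologicalSpace M] [T2Space M] [LocallyCompactSpace M]

/-- **Dichotomy: no accumulation, or `M` compact.** Topological end hypotheses only: H5, `ψ`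
continuous on `Kᶜ`, `χ` continuous on `{R < ‖z‖}`, `ψ : Kᶜ → {R < ‖z‖}` bijective with left inverse
`χ`. Then either every truncation `K ∪ {x ∈ Kᶜ | ‖ψ x‖ < R'}` (`R' > R`) is open, or `M` is compact.
Proof: if the truncation at `R'` is not open, it fails to be a neighbourhood of some `x₀ ∈ K`; take an
open `V ⊇ K` with compact closure; `ψ(closure V ∖ V)` is bounded by some `r₀`; on the connected far region
`A = {R₂ < ‖z‖}` (`R₂ > R', r₀`) the set `{z ∈ A | χ z ∈ V}` is clopen (a limit point `z` with
`χ z ∈ closure V ∖ V` would have `‖z‖ ≤ r₀`), so either `χ(A) ⊆ V` — then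
`M = (K ∪ {‖ψ‖ ≤ R₂}) ∪ closure V` is compact — or `χ(A) ∩ V = ∅` — then
`V ∖ χ({R' ≤ ‖z‖ ≤ R₂})` is an open neighbourhood of `x₀` inside the truncation, contradiction. -/
theorem noAccumulation_or_compactSpace (K : Set M) (R : ℝ) (ψ : M → E4) (χ : E4 → M)
    (h5 : EndsCoCompact K R ψ) (hψ : ContinuousOn ψ Kᶜ)
    (hχ : ContinuousOn χ (Metric.closedBall (0 : E4) R)ᶜ)
    (h8 : Set.BijOn ψ Kᶜ (Metric.closedBall (0 : E4) R)ᶜ) (h9 : ∀ x, x ∈ Kᶜ → χ (ψ x) = x) :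
    (∀ R', R < R' → IsOpen (K ∪ {x | x ∈ Kᶜ ∧ ‖ψ x‖ < R'})) ∨ CompactSpace M := by
  classical
  -- notation and basic facts
  set T : Set E4 := (Metric.closedBall (0 : E4) R)ᶜ with hT
  have hmemT : ∀ z : E4, z ∈ T ↔ R < ‖z‖ := fun z => by
    simp [hT, Metric.mem_closedBall, dist_zero_right]
  have hKc : IsCompact K := isCompact_of_endsCoCompact h5 h8.mapsTo
  have hKcl : IsClosed K := isClosed_of_endsCoCompact h5 h8.mapsTo
  have hright : ∀ z, z ∈ T → χ z ∈ Kᶜ ∧ ψ (χ z) = z := by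
    intro z hz
    obtain ⟨x, hx, rfl⟩ := h8.surjOn hz
    rw [h9 x hx]
    exact ⟨hx, rfl⟩
  rw [or_iff_not_imp_left]
  intro hA
  simp only [not_forall] at hA
  obtain ⟨R', hR', hU⟩ := hA
  set U : Set M := K ∪ {x | x ∈ Kᶜ ∧ ‖ψ x‖ < R'} with hU_def
  -- the open part of `U`
  have hU' : IsOpen (Kᶜ ∩ ψ ⁻¹' Metric.ball (0 : E4) R') :=
    hψ.isOpen_inter_preimage hKcl.isOpen_compl Metric.isOpen_ball
  -- a point `x₀ ∈ K` at which `U` is not a neighbourhood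
  obtain ⟨x₀, hx₀U, hx₀⟩ : ∃ x₀ ∈ U, U ∉ 𝓝 x₀ := by
    by_contra hcon
    simp only [not_exists, not_and, not_not] at hcon
    exact hU (isOpen_iff_mem_nhds.2 hcon)
  have hx₀K : x₀ ∈ K := by
    rcases hx₀U with h | ⟨hxK, hxR⟩
    · exact h
    · exfalso
      apply hx₀
      refine mem_of_superset (hU'.mem_nhds ⟨hxK, by simpa [Metric.mem_ball, dist_zero_right] using hxR⟩) ?_
      rintro y ⟨hyK, hyR⟩
      exact Or.inr ⟨hyK, by simpa [Metric.mem_ball, dist_zero_right] using hyR⟩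
  -- an open neighbourhood `V ⊇ K` with compact closure, and the bound `r₀` of `ψ(closure V ∖ V)`
  obtain ⟨V, hVo, hKV, hN⟩ := exists_isOpen_superset_and_isCompact_closure hKc
  have hB : IsCompact (closure V \ V) := hN.diff hVo
  have hBK : closure V \ V ⊆ Kᶜ := fun x hx hxK => hx.2 (hKV hxK)
  obtain ⟨r₀, hr₀⟩ := (hB.image_of_continuousOn (hψ.mono hBK)).isBounded.subset_closedBall (0 : E4)
  -- the far region `A = {R₂ < ‖z‖}`
  set R₂ : ℝ := |R'| + |r₀| + 1 with hR₂
  have hR₂R' : R' ≤ R₂ := by rw [hR₂]; linarith [le_abs_self R', abs_nonneg r₀]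
  have hR₂r₀ : r₀ < R₂ := by rw [hR₂]; linarith [le_abs_self r₀, abs_nonneg R']
  have hR₂0 : 0 ≤ R₂ := by rw [hR₂]; positivity
  have hR₂R : R < R₂ := hR'.trans_le hR₂R'
  set A : Set E4 := (Metric.closedBall (0 : E4) R₂)ᶜ with hA_def
  have hmemA : ∀ z : E4, z ∈ A ↔ R₂ < ‖z‖ := fun z => by
    simp [hA_def, Metric.mem_closedBall, dist_zero_right]
  have hAT : A ⊆ T := fun z hz => (hmemT z).2 (hR₂R.trans ((hmemA z).1 hz))
  have hAo : IsOpen A := Metric.isClosed_closedBall.isOpen_compl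
  have hAconn : IsConnected A := isConnected_compl_closedBall hR₂0
  have hχA : ContinuousOn χ A := hχ.mono hAT
  -- for `z ∈ A`, `χ z ∉ closure V ∖ V`
  have hnotB : ∀ z, z ∈ A → χ z ∈ closure V → χ z ∈ V := by
    intro z hz hzc
    by_contra hzV
    have hzB : χ z ∈ closure V \ V := ⟨hzc, hzV⟩
    have h1 : ψ (χ z) ∈ ψ '' (closure V \ V) := mem_image_of_mem ψ hzB
    have h2 := hr₀ h1
    rw [(hright z (hAT hz)).2, Metric.mem_closedBall, dist_zero_right] at h2
    linarith [(hmemA z).1 hz]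
  -- the clopen decomposition of `A`
  have hPo : IsOpen (A ∩ χ ⁻¹' V) := hχA.isOpen_inter_preimage hAo hVo
  have hQo : IsOpen (A ∩ χ ⁻¹' (closure V)ᶜ) := hχA.isOpen_inter_preimage hAo isClosed_closure.isOpen_compl
  have hcover : A ⊆ (A ∩ χ ⁻¹' V) ∪ (A ∩ χ ⁻¹' (closure V)ᶜ) := by
    intro z hz
    by_cases h : χ z ∈ closure V
    · exact Or.inl ⟨hz, hnotB z hz h⟩
    · exact Or.inr ⟨hz, h⟩
  have hdisj : A ∩ ((A ∩ χ ⁻¹' V) ∩ (A ∩ χ ⁻¹' (closure V)ᶜ)) = ∅ := by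
    ext z
    simp only [mem_inter_iff, mem_preimage, mem_compl_iff, mem_empty_iff_false, iff_false]
    rintro ⟨-, ⟨-, hzV⟩, -, hzc⟩
    exact hzc (subset_closure hzV)
  rcases (isPreconnected_iff_subset_of_disjoint.1 hAconn.isPreconnected) _ _ hPo hQo hcover hdisj with
    hall | hnone
  · -- Case `χ(A) ⊆ V`: `M` is compact
    have huniv : (univ : Set M) ⊆ (K ∪ {x | ‖ψ x‖ ≤ R₂}) ∪ closure V := by
      intro x _
      by_cases hxK : x ∈ K
      · exact Or.inl (Or.inl hxK)
      · by_cases hxR : ‖ψ x‖ ≤ R₂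
        · exact Or.inl (Or.inr hxR)
        · right
          have hzA : ψ x ∈ A := (hmemA _).2 (not_le.1 hxR)
          have h := (hall hzA).2
          rw [mem_preimage, h9 x hxK] at h
          exact subset_closure h
    exact ⟨((h5 R₂ hR₂R.le).union hN).of_isClosed_subset isClosed_univ huniv⟩
  · -- Case `χ(A) ∩ closure V = ∅`: `U` is a neighbourhood of `x₀` after all
    exfalso
    apply hx₀
    -- the compact annulus part `D = χ({R' ≤ ‖z‖ ≤ R₂})`
    set Ann : Set E4 := {z | R' ≤ ‖z‖ ∧ ‖z‖ ≤ R₂} with hAnn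
    have hAnnT : Ann ⊆ T := fun z hz => (hmemT z).2 (hR'.trans_le hz.1)
    have hAnnc : IsCompact Ann := by
      refine Metric.isCompact_of_isClosed_isBounded ?_ ?_
      · exact (isClosed_le continuous_const continuous_norm).inter (isClosed_le continuous_norm continuous_const)
      · exact (Metric.isBounded_closedBall (x := (0 : E4)) (r := R₂)).subset fun z hz => by
          simpa [Metric.mem_closedBall, dist_zero_right] using hz.2
    have hD : IsCompact (χ '' Ann) := hAnnc.image_of_continuousOn (hχ.mono hAnnT)
    have hDK : χ '' Ann ⊆ Kᶜ := by
      rintro _ ⟨z, hz, rfl⟩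
      exact (hright z (hAnnT hz)).1
    have hWo : IsOpen (V ∩ (χ '' Ann)ᶜ) := hVo.inter hD.isClosed.isOpen_compl
    have hx₀W : x₀ ∈ V ∩ (χ '' Ann)ᶜ := ⟨hKV hx₀K, fun h => hDK h hx₀K⟩
    refine mem_of_superset (hWo.mem_nhds hx₀W) ?_
    rintro x ⟨hxV, hxD⟩
    by_cases hxK : x ∈ K
    · exact Or.inl hxK
    · refine Or.inr ⟨hxK, ?_⟩
      by_contra hlt
      rw [not_lt] at hlt
      by_cases hle : ‖ψ x‖ ≤ R₂
      · exact hxD ⟨ψ x, ⟨hlt, hle⟩, h9 x hxK⟩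
      · have hzA : ψ x ∈ A := (hmemA _).2 (not_le.1 hle)
        have h := (hnone hzA).2
        rw [mem_preimage, h9 x hxK] at h
        exact h (subset_closure hxV)

omit [T2Space M] [LocallyCompactSpace M] in
/-- **… and the two cases exclude each other**: if every truncation is open then `M` is NOT compact
(the truncations at `R + n + 1` form an increasing open cover with no finite subcover, the end being
unbounded). -/
theorem not_compactSpace_of_noAccumulation (K : Set M) (R : ℝ) (ψ : M → E4)
    (h8 : Set.SurjOn ψ Kᶜ (Metric.closedBall (0 : E4) R)ᶜ)
    (hA : ∀ R', R < R' → IsOpen (K ∪ {x | x ∈ Kᶜ ∧ ‖ψ x‖ < R'})) : ¬ CompactSpace M := by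
  intro hM
  set Useq : ℕ → Set M := fun n => K ∪ {x | x ∈ Kᶜ ∧ ‖ψ x‖ < R + n + 1} with hUseq
  have hUo : ∀ n, IsOpen (Useq n) := fun n => hA _ (by linarith [n.cast_nonneg (α := ℝ)])
  have hcov : (univ : Set M) ⊆ ⋃ n, Useq n := by
    intro x _
    by_cases hxK : x ∈ K
    · exact mem_iUnion.2 ⟨0, Or.inl hxK⟩
    · obtain ⟨n, hn⟩ := exists_nat_gt (‖ψ x‖ - R - 1)
      exact mem_iUnion.2 ⟨n, Or.inr ⟨hxK, by linarith⟩⟩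
  obtain ⟨t, ht⟩ := (isCompact_univ (X := M)).elim_finite_subcover Useq hUo hcov
  -- a bound `n₀` for the finite subcover
  set n₀ : ℕ := t.sup id with hn₀
  have hmono : ∀ n ∈ t, Useq n ⊆ Useq n₀ := by
    intro n hn x hx
    have hle : (n : ℝ) ≤ n₀ := by exact_mod_cast (Finset.le_sup (f := id) hn : id n ≤ t.sup id)
    rcases hx with h | ⟨h1, h2⟩
    · exact Or.inl h
    · exact Or.inr ⟨h1, by linarith⟩
  have hall : (univ : Set M) ⊆ Useq n₀ := by
    intro x hx
    obtain ⟨n, hn, hxn⟩ := mem_iUnion₂.1 (ht hx)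
    exact hmono n hn hxn
  -- the far point of the end is not covered
  set z : E4 := (|R| + n₀ + 2) • (EuclideanSpace.single 0 1 : E4) with hz
  have hzn : ‖z‖ = |R| + n₀ + 2 := by
    rw [hz, norm_smul, Real.norm_eq_abs, abs_of_pos (by positivity)]; simp
  have hzT : z ∈ (Metric.closedBall (0 : E4) R)ᶜ := by
    simp only [mem_compl_iff, Metric.mem_closedBall, dist_zero_right, not_le, hzn]
    linarith [le_abs_self R, n₀.cast_nonneg (α := ℝ)]
  obtain ⟨x, hxK, hxz⟩ := h8 hzT
  rcases hall (mem_univ x) with h | ⟨-, h⟩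
  · exact hxK h
  · rw [hxz, hzn] at h
    linarith [le_abs_self R]

/-- **The S-stubs "the end does not return" are equivalent to `¬ CompactSpace M`** over the
topological end hypotheses (so, a fortiori, over their own): this is exactly where the symplectic form
has to be used, and `§11` (`S⁴`) shows it cannot be avoided. -/
theorem noAccumulation_iff_not_compactSpace (K : Set M) (R : ℝ) (ψ : M → E4) (χ : E4 → M)
    (h5 : EndsCoCompact K R ψ) (hψ : ContinuousOn ψ Kᶜ)
    (hχ : ContinuousOn χ (Metric.closedBall (0 : E4) R)ᶜ)
    (h8 : Set.BijOn ψ Kᶜ (Metric.closedBall (0 : E4) R)ᶜ) (h9 : ∀ x, x ∈ Kᶜ → χ (ψ x) = x) :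
    (∀ R', R < R' → IsOpen (K ∪ {x | x ∈ Kᶜ ∧ ‖ψ x‖ < R'})) ↔ ¬ CompactSpace M :=
  ⟨not_compactSpace_of_noAccumulation K R ψ h8.surjOn,
    fun h => (noAccumulation_or_compactSpace K R ψ χ h5 hψ hχ h8 h9).resolve_right h⟩

end Dichotomy

/-- **Reduction of the S-stub to non-compactness**, in the stub's own (manifold) setting: under the
hypotheses of `StubEndDoesNotReturn` other than `IsSmoothForm`/H10, its conclusion holds as soon as `M`
is not compact. (Manifolds charted on `ℝ⁴` are locally compact; `C^∞` maps are continuous.) What is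
left for the stub prover is only: H2 + H10 (+ H5) ⇒ `¬ CompactSpace M` — the volume count. -/
theorem stubEndDoesNotReturn_of_not_compactSpace
    (M : Type) [TopologicalSpace M] [T2Space M] [ChartedSpace E4 M]
    (K : Set M) (R : ℝ) (ψ : M → E4) (χ : E4 → M)
    (h5 : EndsCoCompact K R ψ) (h6789 : IsEndChart K R ψ χ) (hM : ¬ CompactSpace M) :
    ∀ R', R < R' → IsOpen (K ∪ {x | x ∈ Kᶜ ∧ ‖ψ x‖ < R'}) := by
  haveI : LocallyCompactSpace M := ChartedSpace.locallyCompactSpace E4 M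
  obtain ⟨h6, h7, h8, h9⟩ := h6789
  exact (noAccumulation_iff_not_compactSpace K R ψ χ h5 h6.continuousOn h7.continuousOn h8 h9).2 hM


/-! ## 14. Why the crux resists (no kill) -/

/-- RESISTS (cycles 1–2). Attacks tried on the crux itself, all failing for a reason now understood:
* *absorption at infinity* — H5 controls only the `R`-side of the end, so one tries a model in
  which some sequence `x_n ∈ Kᶜ` with `‖ψ x_n‖ → ∞` converges to a point of `K` (then no `Φ` can be
  `ψ` off a compact set). Impossible: for a compact neighbourhood `N` of the compact `K`
  (`isCompact_of_endsCoCompact`), `O = ψ(int N ∖ K)` is open in `ℝ⁴` with compact frontier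
  `⊆ ∂B_R ∪ ψ(∂N)`, hence bounded or co-bounded; co-bounded forces `M` compact, and a compact `M`
  cannot carry a continuous `sf` with `sf = ψ*ω₀` on a set of infinite `ω₀²`-volume. So the
  hypotheses pin exactly the intended configuration `M = K'' ∪ (standard end)`.
* *degenerate radius* `R < 0` (`closedBall 0 R = ∅`, `ψ : Kᶜ ≅ ℝ⁴`): the same argument forces
  `K = ∅`, and `Φ = ψ` satisfies the conclusion.
* *junk operators*: `mfderiv = 0` junk is neutralised (`mfderiv_injective_of_pullbackClause`);
  `K` need not be stated closed (`isClosed_of_endsCoCompact`); junk values of `ψ` on `K` enter the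
  conclusion only through `x ∉ K'`, and `K' ⊇ K` may be assumed since `K` is compact.
* *literature*: absolute statement = Gromov 1985 §0.3.C (p. 311) / McDuff–Salamon 2012 Thm 9.4.2;
  relative clause = McDuff–Salamon 2017 Rem. 4.5.2 (viii); Gromov's `J`-plane coordinates are only
  asymptotic to `ψ` off the corner region, the correction is a cut-off Hamiltonian isotopy on the
  simply connected end — no counterexample mechanism is known or suspected.
* *cycle 2 — compactification, concretely*: the `S⁴` model of `§11` realises the only topological
  escape (`M` compact, the end returning to a point of `K`) and satisfies EVERYTHING except the
  regularity of `sf` at the accumulation point (`§12`); so a counterexample to the crux would have to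
  carry a smooth symplectic form across the point at infinity of its own standard end — impossible by
  volume (`sf` bounded near the point, `ψ*ω₀`-volume of the end infinite). Not checkable here (no
  integration of forms on manifolds over Mathlib), but the escape is now pinned to exactly this.
* *cycle 2 — formalisation junk re-audited*: `≃ₘ⟮𝓡 4, 𝓡 4⟯` is the `C^∞` (not `C^ω`) diffeomorphism
  type (else `TwistEnd` would be a kill by analytic continuation); `IsSmoothForm` is honest chartwise
  smoothness; `IsClosedForm` alone has junk (`§6c`) but is stated together with H2; `π_ 2` is Mathlib's
  `HomotopyGroup (Fin 2)`; `mfderiv` junk neutralised (§2). No junk kill exists.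
* *cycle 2 — H1*: the conclusion forces `π₂ = 0` (§10), so H1 can only be attacked through a
  non-minimal model (blow-up), which is what the hypothesis is printed to exclude (McDuff 1990).
What WOULD kill it: an exotic `ℝ⁴` standard at infinity carrying a symplectic form standard at
infinity (equivalently an exotic `S⁴` whose puncture is symplectically standard near the point) —
excluded by the theorem itself. -/
theorem resists : True := trivial

end Summit.SmoothPoincare4.SmoothPoincare4.Cruxes.GromovRecognitionRelEnd.Disproof

end
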